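/-
Copyright (c) 2026 the pub-hodgecm-mathlib formalisation cell (harness21).  Prover seat hodgecm-mathlib-F0P3-p01 (g19): road «S3-ram» (LEAD F0P3a-plan (g13); owner lineage
F0P3a-p06 (g16), (Cnt2′) chair F0P3a-p07), organ (J2-FRAME-aniso) — the junction heads at the conjugated pattern literal, centred inside; 2026-09-02.
-/
import Literature.NumberTheory.Rogawski1990.DepthZeroKappaTransferTypeOneRamifiedJunctionStrataCountAnisotropic   -- ★ p849055 (F0P3a-p08 (g20)): `…_{raw,even}_singleton_of_anisotropic_frame`; brings ★ p848877 (F0P2-p02 (g14)) ∕ ★ p848995 (F0P3-p03 (g16)) singleton heads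
import Literature.NumberTheory.Automorphic.UnitaryLatticeTreeBlockLiteralCentring                                  -- ★ (this seat, p849074): centring of `P·ι(γ₁, u)·P⁻¹` — unitarity, integrality, `hchar ∕ hBm ∕ hroot`, rootlessness ∕ disc, strata-set invariance
import Literature.NumberTheory.Automorphic.UnitaryLatticeTreeAnisotropicBlockConformal                            -- ★ p849115 (F0P3a-p08 (g20)): `forall_valued_sub_smul_one_apply_mul_self_le_det` (conformality of the anisotropic block; ED. 2 §4)
import HarnessLib

/-!
# The ramified `κ`-orbital integral, type-(2) junction: THE FIVE STRATA COUNTS OF THE ANISOTROPIC LITERAL `P·ι(γ₁, u)·P⁻¹` AT ITS TRUE DEPTH, CENTRED INSIDE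
# (Kottwitz 1986 §3; Rogawski 1990 §4.8 Case (a), §4.9; Bruhat–Tits 1972 §10)

Topic `NumberTheory/Rogawski1990`; namespace `Literature.NumberTheory.Rogawski1990.TypeOneRamifiedJunction` (+ one generic lemma in `…Automorphic.UnitaryLatticeTree`).
THEOREMS ONLY (no definition, no instance, no notation, no named fact, no `sorry`); kernel lane `--supports stmt-HodgeConjecture-24833`; datum-free generic `K` currency of the
route-B heads.  Cell `pub/hodgecm-mathlib` (D-0151), crux H413; road «S3-ram» (Literature seeding, count-neutral); the (Cnt2′) BLOCK-LAW skeleton (`stub_T2G_{zero,pm}_{even,odd}_J0diff`,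
keeper F0P3a-p06 (g16)), sub-stub `stub_Zaniso` (composition pen A-p16 (g33), chair RULING (13)(6)) — organ **(J2-FRAME-aniso)** of A-p19 (g28), CLOSED FORM: GLUE ONLY.

THE POINT ([Kottwitz1986] §3; [Rogawski1990] §4.9 p. 55).  The route-B singleton heads count the fixed self-dual lattices of an INTEGRAL `γ ∈ U(σ, Φ₃)` of block type at its
ROOT DEPTH `d₀` (`χ_γ = (X − λ)·χ_B`, `|λ − 1|, |(B − 1)_{ij}| ≤ |ϖ|^{d₀}`, `(γ − 1)L₀ ⊆ ϖ^{d₀}L₀`).  The anisotropic literal of the block law is `γ = P·ι(γ₁, u)·P⁻¹` whose middle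
eigenvalue `u₀₀` is only `2`-deep (`|u₀₀ − 1| ≤ |ϖ|²`), while its block has TRUE depth `d₀` about `u₀₀` (`|(γ₁ − u₀₀·1)_{ij}| ≤ |ϖ|^{d₀}`).  So the heads are applied to the
CENTRED element `γ′ = P·ι(u₀₀⁻¹γ₁, 1)·P⁻¹ = u₀₀⁻¹·γ` (★ p849074: `γ′ ∈ K₀`, `χ_{γ′} = (X − 1)·χ_{u₀₀⁻¹γ₁}`, `hBm`, `hroot`; `u₀₀⁻¹γ₁` is again integral, unitary for `diag d`
(norm-one scalar), ROOTLESS and of the SAME discriminant depth), and the five strata counts are moved back to `γ` by ★ `ncard_strata_eq_of_coe_eq_smul` (a `2`-deep unit central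
rescaling does not change the five strata SETS).  Two flavours, both parities: over the RAW singleton heads ★ p848877 ∕ ★ p848995 (region hypotheses `hFfin`, `hR` kept, AT `γ′`),
and over ★ p849055 (F0P3a-p08 (g20): `hFfin`, `hR` DISCHARGED by the anisotropic frame — `P·L₀ = L₀`, `diag d` residually anisotropic, principal units squares, `|ϖ|^{2d₀} ≤
|disc γ₁|`).  In all four the census binders (`hNE ∕ [hNO] ∕ hNP ∕ hNM`: the root's collar labels, which live at level `ϖ^{d₀}`) are the head's AT `γ′` VERBATIM, the conclusion is
the head's AT `γ` VERBATIM (the J0diff's own set-builder element `P₁·ι(γ₁, u_w)·P₁⁻¹`), and `γ, γ′` enter as elements of `U(σ, Φ₃)` with their matrices named (`hγ`, `hγ'`; the block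
law supplies them by ★ `conj_endoGL_mem_unitaryGroupOfForm_of_formCongr_eq` ∕ `conj_endoGL_centred_mem_…` from its frame identity `hform`); the norm-one condition on `u₀₀`
is READ OFF `γ ∈ U(σ, Φ₃)` (`norm_eq_one_of_oneByOne_mem_unitaryGroupOfForm`).
HONEST LABEL: HC_CM is proved only modulo the 2 remaining named inputs (hLiu418 24832, h413 24833) until rung 0 closes; nothing printed is asserted here (composition of ★
theorems); «S3-ram» has no books consequence.

* §0 `UnitaryLatticeTree.norm_eq_one_of_oneByOne_mem_unitaryGroupOfForm` (`u ∈ U(σ, (η))`, `η ≠ 0` ⇒ `σ(u₀₀)·u₀₀ = 1`).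
* §1 **`strataCount_J₀_of_charpoly_block_raw_singleton_centred`** (odd root depth, over ★ p848877), **`strataCount_J₀_of_charpoly_block_even_singleton_centred`** (even, over ★ p848995).
* §2 **`strataCount_J₀_of_charpoly_block_raw_singleton_of_anisotropic_frame_centred`**, **`strataCount_J₀_of_charpoly_block_even_singleton_of_anisotropic_frame_centred`** (over ★ p849055).

## References
* [Kottwitz1986] R. E. Kottwitz, *Base change for unit elements of Hecke algebras*, Compositio Math. 60 (1986), §3 (counting fixed lattices; central modifications).
* [Rogawski1990] J. D. Rogawski, *Automorphic Representations of Unitary Groups in Three Variables*, Ann. of Math. Stud. 123 (1990), §4.8 Case (a) p. 53, §4.9 pp. 54–56.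
* [BruhatTits1972] F. Bruhat, J. Tits, *Groupes réductifs sur un corps local I*, Publ. Math. IHÉS 41 (1972), §10.
-/

set_option autoImplicit false

noncomputable section

open scoped Valued WithZero Matrix MatrixGroups
open Polynomial Classical SimpleGraph
open Literature.Combinatorics.SimpleGraph.TreeLayers
open Literature.NumberTheory.Automorphic Literature.NumberTheory.Automorphic.HermitianLattice Literature.NumberTheory.Automorphic.UnitaryLatticeTree

/-! ## §0 One generic lemma: the norm of the middle eigenvalue is read off unitarity -/

namespace Literature.NumberTheory.Automorphic.UnitaryLatticeTree

open Literature.NumberTheory.Rogawski1990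

/-- `u ∈ U(σ, (η))` with `η ≠ 0` forces `σ(u₀₀)·u₀₀ = 1` (the `1 × 1` unitarity relation `σ(u₀₀)·η·u₀₀ = η`). [cite: Rogawski1990, §4.8 Case (a) p. 53] -/
theorem norm_eq_one_of_oneByOne_mem_unitaryGroupOfForm {K : Type*} [Field K] {σ : K →+* K} {η : K} (hη : η ≠ 0) {u : GL (Fin 1) K}
    (hu : u ∈ unitaryGroupOfForm σ (!![η] : Matrix (Fin 1) (Fin 1) K)) :
    σ ((u : Matrix (Fin 1) (Fin 1) K) 0 0) * (u : Matrix (Fin 1) (Fin 1) K) 0 0 = 1 := by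
  rw [mem_unitaryGroupOfForm_iff] at hu
  have h00 := congrFun (congrFun hu 0) 0
  simp only [Matrix.mul_apply, Fin.sum_univ_one, Matrix.transpose_apply, Matrix.map_apply, Fin.isValue, Matrix.of_apply, Matrix.cons_val',
    Matrix.cons_val_fin_one] at h00
  have h' : σ ((u : Matrix (Fin 1) (Fin 1) K) 0 0) * (u : Matrix (Fin 1) (Fin 1) K) 0 0 * η = 1 * η := by rw [one_mul]; linear_combination h00
  exact mul_right_cancel₀ hη h'

end Literature.NumberTheory.Automorphic.UnitaryLatticeTree

namespace Literature.NumberTheory.Rogawski1990.TypeOneRamifiedJunction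

variable {K : Type*} [Field K] [Valued K ℤᵐ⁰] {σ : K →+* K} {ϖ : K}

/-! ## §1 Over the RAW singleton heads (region hypotheses `hFfin`, `hR` kept, at the centred element) -/
set_option maxHeartbeats 1600000 in
-- budget only: statement-heavy lattice tokens (verbatim the ★ head's budget).
/-- **THE FIVE STRATA COUNTS OF THE ANISOTROPIC LITERAL `γ = P·ι(γ₁, u)·P⁻¹`, CENTRED INSIDE.**  ★ `strataCount_J₀_of_charpoly_block_raw_singleton` applied to the centred
element `γ′ = P·ι(s·γ₁, 1)·P⁻¹` (`s·u₀₀ = 1`; `γ′ ∈ K₀`, `χ_{γ′} = (X − 1)·χ_{sγ₁}`, `|(sγ₁ − 1)_{ij}| ≤ |ϖ|^{d₀}`, `(γ′ − 1)L₀ ⊆ ϖ^{d₀}L₀` — ★ `UnitaryLatticeTreeBlockLiteralCentring`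
§2–§4), its conclusion transported back to `γ` by ★ `ncard_strata_eq_of_coe_eq_smul` (`↑γ′ = s • ↑γ`, `|s| = 1`, `|s − 1| ≤ |ϖ|²`).  Region data (`hFfin`, `hR`, the
root-collar census) are the head's AT `γ′`, verbatim. [cite: Kottwitz1986, §3] [cite: Rogawski1990, §4.8 Case (a) p. 53; §4.9 pp. 54–56] [cite: BruhatTits1972, §10] -/
theorem strataCount_J₀_of_charpoly_block_raw_singleton_centred [ValuativeRel K] [(Valued.v : Valuation K ℤᵐ⁰).Compatible]
    (hσ : ∀ x, σ (σ x) = x) (hvσ : ∀ a, Valued.v (σ a) = Valued.v a) (hσϖ : σ ϖ = -ϖ)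
    (hϖ : Valued.v ϖ = WithZero.exp (-1 : ℤ)) (hres : ∀ x : K, Valued.v x ≤ 1 → Valued.v (σ x - x) < 1) (h2 : Valued.v (2 : K) = 1)
    (hnorm : ∀ u : K, σ u = u → Valued.v (u - 1) < 1 → ∃ z : K, z * σ z = u ∧ Valued.v (z - 1) ≤ Valued.v (u - 1)) [Fintype 𝓀[K]] [DecidableEq 𝓀[K]]
    {P : GL (Fin 3) K} (hP : IsIntMatrix (P : Matrix (Fin 3) (Fin 3) K)) (hPi : IsIntMatrix ((P⁻¹ : GL (Fin 3) K) : Matrix (Fin 3) (Fin 3) K))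
    (γ₁ : GL (Fin 2) K) (u : GL (Fin 1) K) (hu2 : Valued.v ((u : Matrix (Fin 1) (Fin 1) K) 0 0 - 1) ≤ Valued.v ϖ ^ 2)
    (s : Kˣ) (hs : (s : K) * (u : Matrix (Fin 1) (Fin 1) K) 0 0 = 1)
    {γ γ' : unitaryGroupOfForm σ ((StdForm.antidiagonal 3).over K)} (hγ : (γ : GL (Fin 3) K) = P * endoGL (γ₁, u) * P⁻¹)
    (hγ' : (γ' : GL (Fin 3) K) = P * endoGL (Matrix.GeneralLinearGroup.scalar (Fin 2) s * γ₁, (1 : GL (Fin 1) K)) * P⁻¹)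
    {d₀ : ℕ} (hγd : ∀ i j, Valued.v (((γ₁ : Matrix (Fin 2) (Fin 2) K) - ((u : Matrix (Fin 1) (Fin 1) K) 0 0) • (1 : Matrix (Fin 2) (Fin 2) K)) i j) ≤ Valued.v ϖ ^ d₀)
    (hFfin : {v : {M : Submodule 𝒪[K] (Fin 3 → K) // IsVertex σ ϖ ((StdForm.antidiagonal 3).over K) M} | latticeGraphIso σ ϖ ((StdForm.antidiagonal 3).over K) γ' v = v}.Finite)
    (mA : ℕ) (hmA : d₀ = 2 * mA + 3)
    (c₁ ε : K) (hc₁ : Valued.v c₁ = 1) (hεv : Valued.v ε = 1) (hε : ∀ z : K, Valued.v z ≤ 1 → Valued.v (z ^ 2 - ε) = 1)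
    (q : ℕ) (hq : q = Fintype.card 𝓀[K])
    (hR : ∀ v, v ∈ {v : {M : Submodule 𝒪[K] (Fin 3 → K) // IsVertex σ ϖ ((StdForm.antidiagonal 3).over K) M} | latticeGraphIso σ ϖ ((StdForm.antidiagonal 3).over K) γ' v = v ∧ IsSelfDualLattice σ ϖ ((StdForm.antidiagonal 3).over K) v.1 ∧ v.1.map ((Matrix.toLin' (((γ' : GL (Fin 3) K) : Matrix (Fin 3) (Fin 3) K) - 1)).restrictScalars 𝒪[K]) ≤ scaleLattice (ϖ ^ d₀) v.1} → v = (⟨stdLattice K 3, 0, isSelfDualLattice_stdLattice_three_of_v hϖ⟩ : {M : Submodule 𝒪[K] (Fin 3 → K) // IsVertex σ ϖ ((StdForm.antidiagonal 3).over K) M}))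
    (NE NP NM : ℕ)
    (hNE : ({w | w ∈ {w | ∃ c, ((latticeGraph σ ϖ ((StdForm.antidiagonal 3).over K)).Adj (⟨stdLattice K 3, 0, isSelfDualLattice_stdLattice_three_of_v hϖ⟩ : {M : Submodule 𝒪[K] (Fin 3 → K) // IsVertex σ ϖ ((StdForm.antidiagonal 3).over K) M}) c ∧ (latticeGraph σ ϖ ((StdForm.antidiagonal 3).over K)).dist ⟨stdLattice K 3, 0, isSelfDualLattice_stdLattice_three_of_v hϖ⟩ c = (latticeGraph σ ϖ ((StdForm.antidiagonal 3).over K)).dist ⟨stdLattice K 3, 0, isSelfDualLattice_stdLattice_three_of_v hϖ⟩ (⟨stdLattice K 3, 0, isSelfDualLattice_stdLattice_three_of_v hϖ⟩ : {M : Submodule 𝒪[K] (Fin 3 → K) // IsVertex σ ϖ ((StdForm.antidiagonal 3).over K) M}) + 1 ∧ latticeGraphIso σ ϖ ((StdForm.antidiagonal 3).over K) γ' c = c) ∧ ((latticeGraph σ ϖ ((StdForm.antidiagonal 3).over K)).Adj c w ∧ (latticeGraph σ ϖ ((StdForm.antidiagonal 3).over K)).dist ⟨stdLattice K 3, 0,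 isSelfDualLattice_stdLattice_three_of_v hϖ⟩ w = (latticeGraph σ ϖ ((StdForm.antidiagonal 3).over K)).dist ⟨stdLattice K 3, 0, isSelfDualLattice_stdLattice_three_of_v hϖ⟩ c + 1 ∧ latticeGraphIso σ ϖ ((StdForm.antidiagonal 3).over K) γ' w = w)} ∧ (¬ w.1.map ((Matrix.toLin' (((γ' : GL (Fin 3) K) : Matrix (Fin 3) (Fin 3) K) - 1)).restrictScalars 𝒪[K]) ≤ scaleLattice (ϖ ^ d₀) w.1 ∧ (w.1.map ((Matrix.toLin' (((γ' : GL (Fin 3) K) : Matrix (Fin 3) (Fin 3) K) - 1)).restrictScalars 𝒪[K]) ≤ scaleLattice (ϖ ^ (d₀ - 1)) w.1 ∧ ¬ w.1.map ((Matrix.toLin' (((γ' : GL (Fin 3) K) : Matrix (Fin 3) (Fin 3) K) - 1)).restrictScalars 𝒪[K]) ≤ scaleLattice (ϖ ^ d₀) w.1))}).ncard = NE)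
    (hNP : ({w | w ∈ {w | ∃ c, ((latticeGraph σ ϖ ((StdForm.antidiagonal 3).over K)).Adj (⟨stdLattice K 3, 0, isSelfDualLattice_stdLattice_three_of_v hϖ⟩ : {M : Submodule 𝒪[K] (Fin 3 → K) // IsVertex σ ϖ ((StdForm.antidiagonal 3).over K) M}) c ∧ (latticeGraph σ ϖ ((StdForm.antidiagonal 3).over K)).dist ⟨stdLattice K 3, 0, isSelfDualLattice_stdLattice_three_of_v hϖ⟩ c = (latticeGraph σ ϖ ((StdForm.antidiagonal 3).over K)).dist ⟨stdLattice K 3, 0, isSelfDualLattice_stdLattice_three_of_v hϖ⟩ (⟨stdLattice K 3, 0, isSelfDualLattice_stdLattice_three_of_v hϖ⟩ : {M : Submodule 𝒪[K] (Fin 3 → K) // IsVertex σ ϖ ((StdForm.antidiagonal 3).over K) M}) + 1 ∧ latticeGraphIso σ ϖ ((StdForm.antidiagonal 3).over K) γ' c = c) ∧ ((latticeGraph σ ϖ ((StdForm.antidiagonal 3).over K)).Adj c w ∧ (latticeGraph σ ϖ ((StdForm.antidiagonal 3).over K)).dist ⟨stdLattice K 3, 0, isSelfDualLattice_stdLattice_three_of_v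 hϖ⟩ w = (latticeGraph σ ϖ ((StdForm.antidiagonal 3).over K)).dist ⟨stdLattice K 3, 0, isSelfDualLattice_stdLattice_three_of_v hϖ⟩ c + 1 ∧ latticeGraphIso σ ϖ ((StdForm.antidiagonal 3).over K) γ' w = w)} ∧ (¬ w.1.map ((Matrix.toLin' (((γ' : GL (Fin 3) K) : Matrix (Fin 3) (Fin 3) K) - 1)).restrictScalars 𝒪[K]) ≤ scaleLattice (ϖ ^ d₀) w.1 ∧ (w.1.map ((Matrix.toLin' (((γ' : GL (Fin 3) K) : Matrix (Fin 3) (Fin 3) K) - 1)).restrictScalars 𝒪[K]) ≤ scaleLattice (ϖ ^ (d₀ - 2)) w.1 ∧ ¬ w.1.map ((Matrix.toLin' (((γ' : GL (Fin 3) K) : Matrix (Fin 3) (Fin 3) K) - 1)).restrictScalars 𝒪[K]) ≤ scaleLattice (ϖ ^ (d₀ - 1)) w.1) ∧ ∃ y ∈ w.1, ∃ a : K, Valued.v a = 1 ∧ Valued.v ((ϖ ^ (d₀ - 2))⁻¹ * pairing σ ((StdForm.antidiagonal 3).over K) y ((((γ' : GL (Fin 3) K) : Matrix (Fin 3) (Fin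 3) K) - 1) *ᵥ y) - (c₁) * a ^ 2) < 1)}).ncard = NP)
    (hNM : ({w | w ∈ {w | ∃ c, ((latticeGraph σ ϖ ((StdForm.antidiagonal 3).over K)).Adj (⟨stdLattice K 3, 0, isSelfDualLattice_stdLattice_three_of_v hϖ⟩ : {M : Submodule 𝒪[K] (Fin 3 → K) // IsVertex σ ϖ ((StdForm.antidiagonal 3).over K) M}) c ∧ (latticeGraph σ ϖ ((StdForm.antidiagonal 3).over K)).dist ⟨stdLattice K 3, 0, isSelfDualLattice_stdLattice_three_of_v hϖ⟩ c = (latticeGraph σ ϖ ((StdForm.antidiagonal 3).over K)).dist ⟨stdLattice K 3, 0, isSelfDualLattice_stdLattice_three_of_v hϖ⟩ (⟨stdLattice K 3, 0, isSelfDualLattice_stdLattice_three_of_v hϖ⟩ : {M : Submodule 𝒪[K] (Fin 3 → K) // IsVertex σ ϖ ((StdForm.antidiagonal 3).over K) M}) + 1 ∧ latticeGraphIso σ ϖ ((StdForm.antidiagonal 3).over K) γ' c = c) ∧ ((latticeGraph σ ϖ ((StdForm.antidiagonal 3).over K)).Adj c w ∧ (latticeGraph σ ϖ ((StdForm.antidiagonal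 3).over K)).dist ⟨stdLattice K 3, 0, isSelfDualLattice_stdLattice_three_of_v hϖ⟩ w = (latticeGraph σ ϖ ((StdForm.antidiagonal 3).over K)).dist ⟨stdLattice K 3, 0, isSelfDualLattice_stdLattice_three_of_v hϖ⟩ c + 1 ∧ latticeGraphIso σ ϖ ((StdForm.antidiagonal 3).over K) γ' w = w)} ∧ (¬ w.1.map ((Matrix.toLin' (((γ' : GL (Fin 3) K) : Matrix (Fin 3) (Fin 3) K) - 1)).restrictScalars 𝒪[K]) ≤ scaleLattice (ϖ ^ d₀) w.1 ∧ (w.1.map ((Matrix.toLin' (((γ' : GL (Fin 3) K) : Matrix (Fin 3) (Fin 3) K) - 1)).restrictScalars 𝒪[K]) ≤ scaleLattice (ϖ ^ (d₀ - 2)) w.1 ∧ ¬ w.1.map ((Matrix.toLin' (((γ' : GL (Fin 3) K) : Matrix (Fin 3) (Fin 3) K) - 1)).restrictScalars 𝒪[K]) ≤ scaleLattice (ϖ ^ (d₀ - 1)) w.1) ∧ ¬ (∃ y ∈ w.1, ∃ a : K, Valued.v a = 1 ∧ Valued.v ((ϖ ^ (d₀ - 2))⁻¹ * pairing σ ((StdForm.antidiagonal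 3).over K) y ((((γ' : GL (Fin 3) K) : Matrix (Fin 3) (Fin 3) K) - 1) *ᵥ y) - (c₁) * a ^ 2) < 1))}).ncard = NM) (j : Fin 5) :
    ({M : Submodule 𝒪[K] (Fin 3 → K) | IsSelfDualLattice σ ϖ ((StdForm.antidiagonal 3).over K) M ∧ mapGL (γ : GL (Fin 3) K) M = M ∧
        (![¬ M.map ((Matrix.toLin' (((γ : GL (Fin 3) K) : Matrix (Fin 3) (Fin 3) K) - 1)).restrictScalars 𝒪[K]) ≤ scaleLattice ϖ M,
                  M.map ((Matrix.toLin' (((γ : GL (Fin 3) K) : Matrix (Fin 3) (Fin 3) K) - 1)).restrictScalars 𝒪[K]) ≤ scaleLattice ϖ M ∧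
                    ¬ M.map ((Matrix.toLin' (((γ : GL (Fin 3) K) : Matrix (Fin 3) (Fin 3) K) - 1)).restrictScalars 𝒪[K]) ≤ scaleLattice (ϖ ^ 2) M ∧
                    ¬ M.map ((Matrix.toLin' ((((γ : GL (Fin 3) K) : Matrix (Fin 3) (Fin 3) K) - 1) ^ 2)).restrictScalars 𝒪[K]) ≤ scaleLattice (ϖ ^ 3) M,
                  M.map ((Matrix.toLin' (((γ : GL (Fin 3) K) : Matrix (Fin 3) (Fin 3) K) - 1)).restrictScalars 𝒪[K]) ≤ scaleLattice ϖ M ∧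
                    ¬ M.map ((Matrix.toLin' (((γ : GL (Fin 3) K) : Matrix (Fin 3) (Fin 3) K) - 1)).restrictScalars 𝒪[K]) ≤ scaleLattice (ϖ ^ 2) M ∧
                    M.map ((Matrix.toLin' ((((γ : GL (Fin 3) K) : Matrix (Fin 3) (Fin 3) K) - 1) ^ 2)).restrictScalars 𝒪[K]) ≤ scaleLattice (ϖ ^ 3) M ∧
                    ∃ y ∈ M, ∃ a : K, Valued.v a = 1 ∧
                      Valued.v (ϖ⁻¹ * pairing σ (((StdForm.antidiagonal 3).over K)) y
                        ((((γ : GL (Fin 3) K) : Matrix (Fin 3) (Fin 3) K) - 1) *ᵥ y) - c₁ * a ^ 2) < 1,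
                  M.map ((Matrix.toLin' (((γ : GL (Fin 3) K) : Matrix (Fin 3) (Fin 3) K) - 1)).restrictScalars 𝒪[K]) ≤ scaleLattice ϖ M ∧
                    ¬ M.map ((Matrix.toLin' (((γ : GL (Fin 3) K) : Matrix (Fin 3) (Fin 3) K) - 1)).restrictScalars 𝒪[K]) ≤ scaleLattice (ϖ ^ 2) M ∧
                    M.map ((Matrix.toLin' ((((γ : GL (Fin 3) K) : Matrix (Fin 3) (Fin 3) K) - 1) ^ 2)).restrictScalars 𝒪[K]) ≤ scaleLattice (ϖ ^ 3) M ∧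
                    ∃ y ∈ M, ∃ a : K, Valued.v a = 1 ∧
                      Valued.v (ϖ⁻¹ * pairing σ (((StdForm.antidiagonal 3).over K)) y
                        ((((γ : GL (Fin 3) K) : Matrix (Fin 3) (Fin 3) K) - 1) *ᵥ y) - c₁ * ε * a ^ 2) < 1,
                  M.map ((Matrix.toLin' (((γ : GL (Fin 3) K) : Matrix (Fin 3) (Fin 3) K) - 1)).restrictScalars 𝒪[K]) ≤ scaleLattice (ϖ ^ 2) M] : Fin 5 → Prop) j}.ncard) =
      (if IsSquare (-1 : 𝓀[K]) then
          ((1 : ℕ) • (![0, 0, 0, 0, 1] : Fin 5 → ℕ) + NE • (![q ^ (3 * mA + 3), q ^ (3 * mA + 2), q.choose 2 * q ^ (2 * mA) * ∑ i ∈ Finset.range mA, q ^ i, q.choose 2 * q ^ (2 * mA) * ∑ i ∈ Finset.range mA, q ^ i,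
          ∑ i ∈ Finset.range (mA + 1), q ^ (2 * i) + ∑ i ∈ Finset.range mA, q ^ (2 * mA + 1 + i)] : Fin 5 → ℕ) + NP • (![0, 0, q ^ (2 * mA), 0, ∑ i ∈ Finset.range mA, q ^ (2 * i)] : Fin 5 → ℕ) + NM • (![0, 0, 0, q ^ (2 * mA), ∑ i ∈ Finset.range mA, q ^ (2 * i)] : Fin 5 → ℕ)) j
        else
          ((1 : ℕ) • (![0, 0, 0, 0, 1] : Fin 5 → ℕ) + NE • (![q ^ (3 * mA + 3), q ^ (3 * mA + 2), q.choose 2 * q ^ (2 * mA) * ∑ i ∈ Finset.range mA, q ^ i, q.choose 2 * q ^ (2 * mA) * ∑ i ∈ Finset.range mA, q ^ i,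
          ∑ i ∈ Finset.range (mA + 1), q ^ (2 * i) + ∑ i ∈ Finset.range mA, q ^ (2 * mA + 1 + i)] : Fin 5 → ℕ) + NP • (![0, 0, if Even mA then q ^ (2 * mA) else 0, if Even mA then 0 else q ^ (2 * mA), ∑ i ∈ Finset.range mA, q ^ (2 * i)] : Fin 5 → ℕ) + NM • (![0, 0, if Even mA then 0 else q ^ (2 * mA), if Even mA then q ^ (2 * mA) else 0, ∑ i ∈ Finset.range mA, q ^ (2 * i)] : Fin 5 → ℕ)) j) := by
  have hϖ0 : ϖ ≠ 0 := fun h0 => by rw [h0, map_zero] at hϖ; exact WithZero.coe_ne_zero hϖ.symm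
  have hϖlt : Valued.v ϖ < 1 := by rw [hϖ, ← WithZero.exp_zero]; exact WithZero.exp_lt_exp.2 (by norm_num)
  have hd0 : d₀ ≠ 0 := by rw [hmA]; omega
  have hlt : Valued.v ϖ ^ d₀ < 1 := pow_lt_one₀ zero_le hϖlt hd0
  -- `|u₀₀| = 1` from `|u₀₀ − 1| ≤ |ϖ|² < 1`
  have hvu : Valued.v ((u : Matrix (Fin 1) (Fin 1) K) 0 0) = 1 := by
    have hlt1 : Valued.v ((u : Matrix (Fin 1) (Fin 1) K) 0 0 - 1) < 1 := hu2.trans_lt (pow_lt_one₀ zero_le hϖlt two_ne_zero)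
    have h := Valued.v.map_one_add_of_lt hlt1
    rwa [add_sub_cancel] at h
  obtain ⟨hsv, hsv1⟩ := v_eq_one_and_v_sub_one_le_of_mul_eq_one (ϖ := ϖ) hvu hu2 hs
  -- the centred block `s·γ₁` has depth `d₀` about `1`
  have hBm : ∀ i j, Valued.v ((((Matrix.GeneralLinearGroup.scalar (Fin 2) s * γ₁ : GL (Fin 2) K) : Matrix (Fin 2) (Fin 2) K) - 1) i j) ≤ Valued.v ϖ ^ d₀ := by
    rw [coe_scalar_mul_two_eq_smul]
    exact v_smul_sub_one_apply_le_of_mul_eq_one hs hsv.le hγd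
  have hBint : IsIntMatrix ((Matrix.GeneralLinearGroup.scalar (Fin 2) s * γ₁ : GL (Fin 2) K) : Matrix (Fin 2) (Fin 2) K) :=
    isIntMatrix_of_forall_v_sub_one_le_of_lt_one hlt hBm
  have hBinv : IsIntMatrix (((Matrix.GeneralLinearGroup.scalar (Fin 2) s * γ₁)⁻¹ : GL (Fin 2) K) : Matrix (Fin 2) (Fin 2) K) :=
    isIntMatrix_coe_inv_of_forall_v_sub_one_le_of_lt_one hlt hBm
  -- `γ′ ∈ K₀`
  have hγ0 : γ' ∈ unitaryInt σ ((StdForm.antidiagonal 3).over K) := by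
    rw [mem_unitaryInt_iff]
    change IsIntMatrix ((γ' : GL (Fin 3) K) : Matrix (Fin 3) (Fin 3) K) ∧ IsIntMatrix (((γ' : GL (Fin 3) K)⁻¹ : GL (Fin 3) K) : Matrix (Fin 3) (Fin 3) K)
    rw [hγ']
    exact ⟨isIntMatrix_coe_conj_endoGL hP hPi hBint isIntMatrix_coe_one,
      isIntMatrix_coe_conj_endoGL_inv hP hPi hBinv (by rw [inv_one]; exact isIntMatrix_coe_one)⟩
  -- `hchar ∕ hlam ∕ hroot` at `γ′`
  have hchar : (((γ' : GL (Fin 3) K) : Matrix (Fin 3) (Fin 3) K)).charpoly =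
      (X - C (1 : K)) * ((Matrix.GeneralLinearGroup.scalar (Fin 2) s * γ₁ : GL (Fin 2) K) : Matrix (Fin 2) (Fin 2) K).charpoly := by
    rw [hγ']; exact charpoly_coe_conj_endoGL_one P _
  have hroot : (stdLattice K 3).map ((Matrix.toLin' (((γ' : GL (Fin 3) K) : Matrix (Fin 3) (Fin 3) K) - 1)).restrictScalars 𝒪[K]) ≤ scaleLattice (ϖ ^ d₀) (stdLattice K 3) := by
    rw [hγ']
    exact map_sub_one_stdLattice_le_scaleLattice_of_conj_endoGL_one (pow_ne_zero _ hϖ0) hP hPi (fun i j => by rw [map_pow]; exact hBm i j)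
  have key := strataCount_J₀_of_charpoly_block_raw_singleton hσ hvσ hσϖ hϖ hres h2 hnorm hγ0 1 _ hchar (UnitaryLatticeTree.v_one_sub_one_le _) hBm hroot hFfin
    mA hmA c₁ ε hc₁ hεv hε q hq hR NE NP NM hNE hNP hNM j
  -- back to `γ`: `↑γ′ = s • ↑γ`
  have hTT : ((γ' : GL (Fin 3) K) : Matrix (Fin 3) (Fin 3) K) = (s : K) • ((γ : GL (Fin 3) K) : Matrix (Fin 3) (Fin 3) K) := by
    rw [hγ, hγ']; exact coe_conj_endoGL_centred_eq_smul P γ₁ u s hs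
  rw [ncard_strata_eq_of_coe_eq_smul hvσ hϖ ((StdForm.antidiagonal 3).over K) hsv hsv1 (γ : GL (Fin 3) K) (γ' : GL (Fin 3) K) hTT c₁ (c₁ * ε) j] at key
  exact key


set_option maxHeartbeats 1600000 in
-- budget only: statement-heavy lattice tokens (verbatim the ★ head's budget).
/-- **EVEN ROOT DEPTH: THE FIVE STRATA COUNTS OF THE ANISOTROPIC LITERAL `γ = P·ι(γ₁, u)·P⁻¹`, CENTRED INSIDE** (`d₀ = 2mA + 2`; census `(NE, NO, NP, NM)`).  ★
`strataCount_J₀_of_charpoly_block_even_singleton` (F0P3-p03 (g16)) applied to the centred element `γ′ = P·ι(s·γ₁, 1)·P⁻¹` exactly as in the odd twin, the conclusion moved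
back to `γ` by ★ `ncard_strata_eq_of_coe_eq_smul`. [cite: Kottwitz1986, §3] [cite: Rogawski1990, §4.8 Case (a) p. 53; §4.9 pp. 54–56] [cite: BruhatTits1972, §10] -/
theorem strataCount_J₀_of_charpoly_block_even_singleton_centred [ValuativeRel K] [(Valued.v : Valuation K ℤᵐ⁰).Compatible]
    (hσ : ∀ x, σ (σ x) = x) (hvσ : ∀ a, Valued.v (σ a) = Valued.v a) (hσϖ : σ ϖ = -ϖ)
    (hϖ : Valued.v ϖ = WithZero.exp (-1 : ℤ)) (hres : ∀ x : K, Valued.v x ≤ 1 → Valued.v (σ x - x) < 1) (h2 : Valued.v (2 : K) = 1)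
    (hnorm : ∀ u : K, σ u = u → Valued.v (u - 1) < 1 → ∃ z : K, z * σ z = u ∧ Valued.v (z - 1) ≤ Valued.v (u - 1)) [Fintype 𝓀[K]] [DecidableEq 𝓀[K]]
    {P : GL (Fin 3) K} (hP : IsIntMatrix (P : Matrix (Fin 3) (Fin 3) K)) (hPi : IsIntMatrix ((P⁻¹ : GL (Fin 3) K) : Matrix (Fin 3) (Fin 3) K))
    (γ₁ : GL (Fin 2) K) (u : GL (Fin 1) K) (hu2 : Valued.v ((u : Matrix (Fin 1) (Fin 1) K) 0 0 - 1) ≤ Valued.v ϖ ^ 2)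
    (s : Kˣ) (hs : (s : K) * (u : Matrix (Fin 1) (Fin 1) K) 0 0 = 1)
    {γ γ' : unitaryGroupOfForm σ ((StdForm.antidiagonal 3).over K)} (hγ : (γ : GL (Fin 3) K) = P * endoGL (γ₁, u) * P⁻¹)
    (hγ' : (γ' : GL (Fin 3) K) = P * endoGL (Matrix.GeneralLinearGroup.scalar (Fin 2) s * γ₁, (1 : GL (Fin 1) K)) * P⁻¹)
    {d₀ : ℕ} (hγd : ∀ i j, Valued.v (((γ₁ : Matrix (Fin 2) (Fin 2) K) - ((u : Matrix (Fin 1) (Fin 1) K) 0 0) • (1 : Matrix (Fin 2) (Fin 2) K)) i j) ≤ Valued.v ϖ ^ d₀)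
    (hFfin : {v : {M : Submodule 𝒪[K] (Fin 3 → K) // IsVertex σ ϖ ((StdForm.antidiagonal 3).over K) M} | latticeGraphIso σ ϖ ((StdForm.antidiagonal 3).over K) γ' v = v}.Finite)
    (mA : ℕ) (hmA : d₀ = 2 * mA + 2)
    (c₁ ε : K) (hc₁ : Valued.v c₁ = 1) (hεv : Valued.v ε = 1) (hε : ∀ z : K, Valued.v z ≤ 1 → Valued.v (z ^ 2 - ε) = 1)
    (q : ℕ) (hq : q = Fintype.card 𝓀[K])
    (hR : ∀ v, v ∈ {v : {M : Submodule 𝒪[K] (Fin 3 → K) // IsVertex σ ϖ ((StdForm.antidiagonal 3).over K) M} | latticeGraphIso σ ϖ ((StdForm.antidiagonal 3).over K) γ' v = v ∧ IsSelfDualLattice σ ϖ ((StdForm.antidiagonal 3).over K) v.1 ∧ v.1.map ((Matrix.toLin' (((γ' : GL (Fin 3) K) : Matrix (Fin 3) (Fin 3) K) - 1)).restrictScalars 𝒪[K]) ≤ scaleLattice (ϖ ^ d₀) v.1} → v = (⟨stdLattice K 3, 0, isSelfDualLattice_stdLattice_three_of_v hϖ⟩ : {M : Submodule 𝒪[K]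 (Fin 3 → K) // IsVertex σ ϖ ((StdForm.antidiagonal 3).over K) M}))
    (NE NO NP NM : ℕ)
    (hNE : ({w | w ∈ {w | ∃ c, ((latticeGraph σ ϖ ((StdForm.antidiagonal 3).over K)).Adj (⟨stdLattice K 3, 0, isSelfDualLattice_stdLattice_three_of_v hϖ⟩ : {M : Submodule 𝒪[K] (Fin 3 → K) // IsVertex σ ϖ ((StdForm.antidiagonal 3).over K) M}) c ∧ (latticeGraph σ ϖ ((StdForm.antidiagonal 3).over K)).dist ⟨stdLattice K 3, 0, isSelfDualLattice_stdLattice_three_of_v hϖ⟩ c = (latticeGraph σ ϖ ((StdForm.antidiagonal 3).over K)).dist ⟨stdLattice K 3, 0, isSelfDualLattice_stdLattice_three_of_v hϖ⟩ (⟨stdLattice K 3, 0, isSelfDualLattice_stdLattice_three_of_v hϖ⟩ : {M : Submodule 𝒪[K] (Fin 3 → K) // IsVertex σ ϖ ((StdForm.antidiagonal 3).over K) M}) + 1 ∧ latticeGraphIso σ ϖ ((StdForm.antidiagonal 3).over K) γ' c = c) ∧ ((latticeGraph σ ϖ ((StdForm.antidiagonal 3).over K)).Adj c w ∧ (latticeGraph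 σ ϖ ((StdForm.antidiagonal 3).over K)).dist ⟨stdLattice K 3, 0, isSelfDualLattice_stdLattice_three_of_v hϖ⟩ w = (latticeGraph σ ϖ ((StdForm.antidiagonal 3).over K)).dist ⟨stdLattice K 3, 0, isSelfDualLattice_stdLattice_three_of_v hϖ⟩ c + 1 ∧ latticeGraphIso σ ϖ ((StdForm.antidiagonal 3).over K) γ' w = w)} ∧ (¬ w.1.map ((Matrix.toLin' (((γ' : GL (Fin 3) K) : Matrix (Fin 3) (Fin 3) K) - 1)).restrictScalars 𝒪[K]) ≤ scaleLattice (ϖ ^ d₀) w.1 ∧ (w.1.map ((Matrix.toLin' (((γ' : GL (Fin 3) K) : Matrix (Fin 3) (Fin 3) K) - 1)).restrictScalars 𝒪[K]) ≤ scaleLattice (ϖ ^ (d₀ - 2)) w.1 ∧ ¬ w.1.map ((Matrix.toLin' (((γ' : GL (Fin 3) K) : Matrix (Fin 3) (Fin 3) K) - 1)).restrictScalars 𝒪[K]) ≤ scaleLattice (ϖ ^ (d₀ - 1)) w.1))}).ncard = NE)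
    (hNO : ({w | w ∈ {w | ∃ c, ((latticeGraph σ ϖ ((StdForm.antidiagonal 3).over K)).Adj (⟨stdLattice K 3, 0, isSelfDualLattice_stdLattice_three_of_v hϖ⟩ : {M : Submodule 𝒪[K] (Fin 3 → K) // IsVertex σ ϖ ((StdForm.antidiagonal 3).over K) M}) c ∧ (latticeGraph σ ϖ ((StdForm.antidiagonal 3).over K)).dist ⟨stdLattice K 3, 0, isSelfDualLattice_stdLattice_three_of_v hϖ⟩ c = (latticeGraph σ ϖ ((StdForm.antidiagonal 3).over K)).dist ⟨stdLattice K 3, 0, isSelfDualLattice_stdLattice_three_of_v hϖ⟩ (⟨stdLattice K 3, 0, isSelfDualLattice_stdLattice_three_of_v hϖ⟩ : {M : Submodule 𝒪[K] (Fin 3 → K) // IsVertex σ ϖ ((StdForm.antidiagonal 3).over K) M}) + 1 ∧ latticeGraphIso σ ϖ ((StdForm.antidiagonal 3).over K) γ' c = c) ∧ ((latticeGraph σ ϖ ((StdForm.antidiagonal 3).over K)).Adj c w ∧ (latticeGraph σ ϖ ((StdForm.antidiagonal 3).over K)).dist ⟨stdLattice K 3, 0, isSelfDualLattice_stdLattice_three_of_v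 hϖ⟩ w = (latticeGraph σ ϖ ((StdForm.antidiagonal 3).over K)).dist ⟨stdLattice K 3, 0, isSelfDualLattice_stdLattice_three_of_v hϖ⟩ c + 1 ∧ latticeGraphIso σ ϖ ((StdForm.antidiagonal 3).over K) γ' w = w)} ∧ (¬ w.1.map ((Matrix.toLin' (((γ' : GL (Fin 3) K) : Matrix (Fin 3) (Fin 3) K) - 1)).restrictScalars 𝒪[K]) ≤ scaleLattice (ϖ ^ d₀) w.1 ∧ (w.1.map ((Matrix.toLin' (((γ' : GL (Fin 3) K) : Matrix (Fin 3) (Fin 3) K) - 1)).restrictScalars 𝒪[K]) ≤ scaleLattice (ϖ ^ (d₀ - 1)) w.1 ∧ ¬ w.1.map ((Matrix.toLin' (((γ' : GL (Fin 3) K) : Matrix (Fin 3) (Fin 3) K) - 1)).restrictScalars 𝒪[K]) ≤ scaleLattice (ϖ ^ d₀) w.1) ∧ ¬ w.1.map ((Matrix.toLin' ((((γ' : GL (Fin 3) K) : Matrix (Fin 3) (Fin 3) K) - 1) ^ 2)).restrictScalars 𝒪[K]) ≤ scaleLattice (ϖ ^ (2 * d₀ - 1)) w.1)}).ncard = NO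)
    (hNP : ({w | w ∈ {w | ∃ c, ((latticeGraph σ ϖ ((StdForm.antidiagonal 3).over K)).Adj (⟨stdLattice K 3, 0, isSelfDualLattice_stdLattice_three_of_v hϖ⟩ : {M : Submodule 𝒪[K] (Fin 3 → K) // IsVertex σ ϖ ((StdForm.antidiagonal 3).over K) M}) c ∧ (latticeGraph σ ϖ ((StdForm.antidiagonal 3).over K)).dist ⟨stdLattice K 3, 0, isSelfDualLattice_stdLattice_three_of_v hϖ⟩ c = (latticeGraph σ ϖ ((StdForm.antidiagonal 3).over K)).dist ⟨stdLattice K 3, 0, isSelfDualLattice_stdLattice_three_of_v hϖ⟩ (⟨stdLattice K 3, 0, isSelfDualLattice_stdLattice_three_of_v hϖ⟩ : {M : Submodule 𝒪[K] (Fin 3 → K) // IsVertex σ ϖ ((StdForm.antidiagonal 3).over K) M}) + 1 ∧ latticeGraphIso σ ϖ ((StdForm.antidiagonal 3).over K) γ' c = c) ∧ ((latticeGraph σ ϖ ((StdForm.antidiagonal 3).over K)).Adj c w ∧ (latticeGraph σ ϖ ((StdForm.antidiagonal 3).over K)).dist ⟨stdLattice K 3, 0, isSelfDualLattice_stdLattice_three_of_v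 hϖ⟩ w = (latticeGraph σ ϖ ((StdForm.antidiagonal 3).over K)).dist ⟨stdLattice K 3, 0, isSelfDualLattice_stdLattice_three_of_v hϖ⟩ c + 1 ∧ latticeGraphIso σ ϖ ((StdForm.antidiagonal 3).over K) γ' w = w)} ∧ (¬ w.1.map ((Matrix.toLin' (((γ' : GL (Fin 3) K) : Matrix (Fin 3) (Fin 3) K) - 1)).restrictScalars 𝒪[K]) ≤ scaleLattice (ϖ ^ d₀) w.1 ∧ (w.1.map ((Matrix.toLin' (((γ' : GL (Fin 3) K) : Matrix (Fin 3) (Fin 3) K) - 1)).restrictScalars 𝒪[K]) ≤ scaleLattice (ϖ ^ (d₀ - 1)) w.1 ∧ ¬ w.1.map ((Matrix.toLin' (((γ' : GL (Fin 3) K) : Matrix (Fin 3) (Fin 3) K) - 1)).restrictScalars 𝒪[K]) ≤ scaleLattice (ϖ ^ d₀) w.1) ∧ w.1.map ((Matrix.toLin' ((((γ' : GL (Fin 3) K) : Matrix (Fin 3) (Fin 3) K) - 1) ^ 2)).restrictScalars 𝒪[K]) ≤ scaleLattice (ϖ ^ (2 * d₀ - 1)) w.1 ∧ ∃ y ∈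 w.1, ∃ a : K, Valued.v a = 1 ∧ Valued.v ((ϖ ^ (d₀ - 1))⁻¹ * pairing σ ((StdForm.antidiagonal 3).over K) y ((((γ' : GL (Fin 3) K) : Matrix (Fin 3) (Fin 3) K) - 1) *ᵥ y) - (c₁) * a ^ 2) < 1)}).ncard = NP)
    (hNM : ({w | w ∈ {w | ∃ c, ((latticeGraph σ ϖ ((StdForm.antidiagonal 3).over K)).Adj (⟨stdLattice K 3, 0, isSelfDualLattice_stdLattice_three_of_v hϖ⟩ : {M : Submodule 𝒪[K] (Fin 3 → K) // IsVertex σ ϖ ((StdForm.antidiagonal 3).over K) M}) c ∧ (latticeGraph σ ϖ ((StdForm.antidiagonal 3).over K)).dist ⟨stdLattice K 3, 0, isSelfDualLattice_stdLattice_three_of_v hϖ⟩ c = (latticeGraph σ ϖ ((StdForm.antidiagonal 3).over K)).dist ⟨stdLattice K 3, 0, isSelfDualLattice_stdLattice_three_of_v hϖ⟩ (⟨stdLattice K 3, 0, isSelfDualLattice_stdLattice_three_of_v hϖ⟩ : {M : Submodule 𝒪[K] (Fin 3 → K) // IsVertex σ ϖ ((StdForm.antidiagonal 3).over K) M}) +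 1 ∧ latticeGraphIso σ ϖ ((StdForm.antidiagonal 3).over K) γ' c = c) ∧ ((latticeGraph σ ϖ ((StdForm.antidiagonal 3).over K)).Adj c w ∧ (latticeGraph σ ϖ ((StdForm.antidiagonal 3).over K)).dist ⟨stdLattice K 3, 0, isSelfDualLattice_stdLattice_three_of_v hϖ⟩ w = (latticeGraph σ ϖ ((StdForm.antidiagonal 3).over K)).dist ⟨stdLattice K 3, 0, isSelfDualLattice_stdLattice_three_of_v hϖ⟩ c + 1 ∧ latticeGraphIso σ ϖ ((StdForm.antidiagonal 3).over K) γ' w = w)} ∧ (¬ w.1.map ((Matrix.toLin' (((γ' : GL (Fin 3) K) : Matrix (Fin 3) (Fin 3) K) - 1)).restrictScalars 𝒪[K]) ≤ scaleLattice (ϖ ^ d₀) w.1 ∧ (w.1.map ((Matrix.toLin' (((γ' : GL (Fin 3) K) : Matrix (Fin 3) (Fin 3) K) - 1)).restrictScalars 𝒪[K]) ≤ scaleLattice (ϖ ^ (d₀ - 1)) w.1 ∧ ¬ w.1.map ((Matrix.toLin' (((γ' : GL (Fin 3) K) : Matrix (Fin 3) (Fin 3) K) - 1)).restrictScalars 𝒪[K])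 ≤ scaleLattice (ϖ ^ d₀) w.1) ∧ w.1.map ((Matrix.toLin' ((((γ' : GL (Fin 3) K) : Matrix (Fin 3) (Fin 3) K) - 1) ^ 2)).restrictScalars 𝒪[K]) ≤ scaleLattice (ϖ ^ (2 * d₀ - 1)) w.1 ∧ ¬ (∃ y ∈ w.1, ∃ a : K, Valued.v a = 1 ∧ Valued.v ((ϖ ^ (d₀ - 1))⁻¹ * pairing σ ((StdForm.antidiagonal 3).over K) y ((((γ' : GL (Fin 3) K) : Matrix (Fin 3) (Fin 3) K) - 1) *ᵥ y) - (c₁) * a ^ 2) < 1))}).ncard = NM) (j : Fin 5) :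
    ({M : Submodule 𝒪[K] (Fin 3 → K) | IsSelfDualLattice σ ϖ ((StdForm.antidiagonal 3).over K) M ∧ mapGL (γ : GL (Fin 3) K) M = M ∧
        (![¬ M.map ((Matrix.toLin' (((γ : GL (Fin 3) K) : Matrix (Fin 3) (Fin 3) K) - 1)).restrictScalars 𝒪[K]) ≤ scaleLattice ϖ M,
                  M.map ((Matrix.toLin' (((γ : GL (Fin 3) K) : Matrix (Fin 3) (Fin 3) K) - 1)).restrictScalars 𝒪[K]) ≤ scaleLattice ϖ M ∧
                    ¬ M.map ((Matrix.toLin' (((γ : GL (Fin 3) K) : Matrix (Fin 3) (Fin 3) K) - 1)).restrictScalars 𝒪[K]) ≤ scaleLattice (ϖ ^ 2) M ∧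
                    ¬ M.map ((Matrix.toLin' ((((γ : GL (Fin 3) K) : Matrix (Fin 3) (Fin 3) K) - 1) ^ 2)).restrictScalars 𝒪[K]) ≤ scaleLattice (ϖ ^ 3) M,
                  M.map ((Matrix.toLin' (((γ : GL (Fin 3) K) : Matrix (Fin 3) (Fin 3) K) - 1)).restrictScalars 𝒪[K]) ≤ scaleLattice ϖ M ∧
                    ¬ M.map ((Matrix.toLin' (((γ : GL (Fin 3) K) : Matrix (Fin 3) (Fin 3) K) - 1)).restrictScalars 𝒪[K]) ≤ scaleLattice (ϖ ^ 2) M ∧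
                    M.map ((Matrix.toLin' ((((γ : GL (Fin 3) K) : Matrix (Fin 3) (Fin 3) K) - 1) ^ 2)).restrictScalars 𝒪[K]) ≤ scaleLattice (ϖ ^ 3) M ∧
                    ∃ y ∈ M, ∃ a : K, Valued.v a = 1 ∧
                      Valued.v (ϖ⁻¹ * pairing σ (((StdForm.antidiagonal 3).over K)) y
                        ((((γ : GL (Fin 3) K) : Matrix (Fin 3) (Fin 3) K) - 1) *ᵥ y) - c₁ * a ^ 2) < 1,
                  M.map ((Matrix.toLin' (((γ : GL (Fin 3) K) : Matrix (Fin 3) (Fin 3) K) - 1)).restrictScalars 𝒪[K]) ≤ scaleLattice ϖ M ∧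
                    ¬ M.map ((Matrix.toLin' (((γ : GL (Fin 3) K) : Matrix (Fin 3) (Fin 3) K) - 1)).restrictScalars 𝒪[K]) ≤ scaleLattice (ϖ ^ 2) M ∧
                    M.map ((Matrix.toLin' ((((γ : GL (Fin 3) K) : Matrix (Fin 3) (Fin 3) K) - 1) ^ 2)).restrictScalars 𝒪[K]) ≤ scaleLattice (ϖ ^ 3) M ∧
                    ∃ y ∈ M, ∃ a : K, Valued.v a = 1 ∧
                      Valued.v (ϖ⁻¹ * pairing σ (((StdForm.antidiagonal 3).over K)) y
                        ((((γ : GL (Fin 3) K) : Matrix (Fin 3) (Fin 3) K) - 1) *ᵥ y) - c₁ * ε * a ^ 2) < 1,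
                  M.map ((Matrix.toLin' (((γ : GL (Fin 3) K) : Matrix (Fin 3) (Fin 3) K) - 1)).restrictScalars 𝒪[K]) ≤ scaleLattice (ϖ ^ 2) M] : Fin 5 → Prop) j}.ncard) =
      (if IsSquare (-1 : 𝓀[K]) then
          ((1 : ℕ) • (![0, 0, 0, 0, 1] : Fin 5 → ℕ) + NE • (if mA = 0 then (![1, 0, 0, 0, 0] : Fin 5 → ℕ) else (![q ^ (3 * (mA - 1) + 3), q ^ (3 * (mA - 1) + 2), q.choose 2 * q ^ (2 * (mA - 1)) * ∑ i ∈ Finset.range (mA - 1), q ^ i, q.choose 2 * q ^ (2 * (mA - 1)) * ∑ i ∈ Finset.range (mA - 1), q ^ i,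
          ∑ i ∈ Finset.range (mA - 1 + 1), q ^ (2 * i) + ∑ i ∈ Finset.range (mA - 1), q ^ (2 * (mA - 1) + 1 + i)] : Fin 5 → ℕ)) + NO • (![q ^ (3 * mA + 1), q ^ (3 * mA), q.choose 2 * q ^ (2 * mA - 2) * ∑ i ∈ Finset.range mA, q ^ i, q.choose 2 * q ^ (2 * mA - 2) * ∑ i ∈ Finset.range mA, q ^ i,
          ∑ i ∈ Finset.range mA, q ^ (2 * i) + ∑ i ∈ Finset.range mA, q ^ (2 * mA - 1 + i)] : Fin 5 → ℕ) + NP • (![0, 0, q ^ (2 * mA), 0, ∑ i ∈ Finset.range mA, q ^ (2 * i)] : Fin 5 → ℕ) + NM • (![0, 0, 0, q ^ (2 * mA), ∑ i ∈ Finset.range mA, q ^ (2 * i)] : Fin 5 → ℕ)) j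
        else
          ((1 : ℕ) • (![0, 0, 0, 0, 1] : Fin 5 → ℕ) + NE • (if mA = 0 then (![1, 0, 0, 0, 0] : Fin 5 → ℕ) else (![q ^ (3 * (mA - 1) + 3), q ^ (3 * (mA - 1) + 2), q.choose 2 * q ^ (2 * (mA - 1)) * ∑ i ∈ Finset.range (mA - 1), q ^ i, q.choose 2 * q ^ (2 * (mA - 1)) * ∑ i ∈ Finset.range (mA - 1), q ^ i,
          ∑ i ∈ Finset.range (mA - 1 + 1), q ^ (2 * i) + ∑ i ∈ Finset.range (mA - 1), q ^ (2 * (mA - 1) + 1 + i)] : Fin 5 → ℕ)) + NO • (![q ^ (3 * mA + 1), q ^ (3 * mA), q.choose 2 * q ^ (2 * mA - 2) * ∑ i ∈ Finset.range mA, q ^ i, q.choose 2 * q ^ (2 * mA - 2) * ∑ i ∈ Finset.range mA, q ^ i,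
          ∑ i ∈ Finset.range mA, q ^ (2 * i) + ∑ i ∈ Finset.range mA, q ^ (2 * mA - 1 + i)] : Fin 5 → ℕ) + NP • (![0, 0, if Even mA then q ^ (2 * mA) else 0, if Even mA then 0 else q ^ (2 * mA), ∑ i ∈ Finset.range mA, q ^ (2 * i)] : Fin 5 → ℕ) + NM • (![0, 0, if Even mA then 0 else q ^ (2 * mA), if Even mA then q ^ (2 * mA) else 0, ∑ i ∈ Finset.range mA, q ^ (2 * i)] : Fin 5 → ℕ)) j) := by
  have hϖ0 : ϖ ≠ 0 := fun h0 => by rw [h0, map_zero] at hϖ; exact WithZero.coe_ne_zero hϖ.symm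
  have hϖlt : Valued.v ϖ < 1 := by rw [hϖ, ← WithZero.exp_zero]; exact WithZero.exp_lt_exp.2 (by norm_num)
  have hd0 : d₀ ≠ 0 := by rw [hmA]; omega
  have hlt : Valued.v ϖ ^ d₀ < 1 := pow_lt_one₀ zero_le hϖlt hd0
  -- `|u₀₀| = 1` from `|u₀₀ − 1| ≤ |ϖ|² < 1`
  have hvu : Valued.v ((u : Matrix (Fin 1) (Fin 1) K) 0 0) = 1 := by
    have hlt1 : Valued.v ((u : Matrix (Fin 1) (Fin 1) K) 0 0 - 1) < 1 := hu2.trans_lt (pow_lt_one₀ zero_le hϖlt two_ne_zero)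
    have h := Valued.v.map_one_add_of_lt hlt1
    rwa [add_sub_cancel] at h
  obtain ⟨hsv, hsv1⟩ := v_eq_one_and_v_sub_one_le_of_mul_eq_one (ϖ := ϖ) hvu hu2 hs
  -- the centred block `s·γ₁` has depth `d₀` about `1`
  have hBm : ∀ i j, Valued.v ((((Matrix.GeneralLinearGroup.scalar (Fin 2) s * γ₁ : GL (Fin 2) K) : Matrix (Fin 2) (Fin 2) K) - 1) i j) ≤ Valued.v ϖ ^ d₀ := by
    rw [coe_scalar_mul_two_eq_smul]
    exact v_smul_sub_one_apply_le_of_mul_eq_one hs hsv.le hγd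
  have hBint : IsIntMatrix ((Matrix.GeneralLinearGroup.scalar (Fin 2) s * γ₁ : GL (Fin 2) K) : Matrix (Fin 2) (Fin 2) K) :=
    isIntMatrix_of_forall_v_sub_one_le_of_lt_one hlt hBm
  have hBinv : IsIntMatrix (((Matrix.GeneralLinearGroup.scalar (Fin 2) s * γ₁)⁻¹ : GL (Fin 2) K) : Matrix (Fin 2) (Fin 2) K) :=
    isIntMatrix_coe_inv_of_forall_v_sub_one_le_of_lt_one hlt hBm
  -- `γ′ ∈ K₀`
  have hγ0 : γ' ∈ unitaryInt σ ((StdForm.antidiagonal 3).over K) := by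
    rw [mem_unitaryInt_iff]
    change IsIntMatrix ((γ' : GL (Fin 3) K) : Matrix (Fin 3) (Fin 3) K) ∧ IsIntMatrix (((γ' : GL (Fin 3) K)⁻¹ : GL (Fin 3) K) : Matrix (Fin 3) (Fin 3) K)
    rw [hγ']
    exact ⟨isIntMatrix_coe_conj_endoGL hP hPi hBint isIntMatrix_coe_one,
      isIntMatrix_coe_conj_endoGL_inv hP hPi hBinv (by rw [inv_one]; exact isIntMatrix_coe_one)⟩
  -- `hchar ∕ hlam ∕ hroot` at `γ′`
  have hchar : (((γ' : GL (Fin 3) K) : Matrix (Fin 3) (Fin 3) K)).charpoly =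
      (X - C (1 : K)) * ((Matrix.GeneralLinearGroup.scalar (Fin 2) s * γ₁ : GL (Fin 2) K) : Matrix (Fin 2) (Fin 2) K).charpoly := by
    rw [hγ']; exact charpoly_coe_conj_endoGL_one P _
  have hroot : (stdLattice K 3).map ((Matrix.toLin' (((γ' : GL (Fin 3) K) : Matrix (Fin 3) (Fin 3) K) - 1)).restrictScalars 𝒪[K]) ≤ scaleLattice (ϖ ^ d₀) (stdLattice K 3) := by
    rw [hγ']
    exact map_sub_one_stdLattice_le_scaleLattice_of_conj_endoGL_one (pow_ne_zero _ hϖ0) hP hPi (fun i j => by rw [map_pow]; exact hBm i j)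
  have key := strataCount_J₀_of_charpoly_block_even_singleton hσ hvσ hσϖ hϖ hres h2 hnorm hγ0 1 _ hchar (UnitaryLatticeTree.v_one_sub_one_le _) hBm hroot hFfin
    mA hmA c₁ ε hc₁ hεv hε q hq hR NE NO NP NM hNE hNO hNP hNM j
  -- back to `γ`: `↑γ′ = s • ↑γ`
  have hTT : ((γ' : GL (Fin 3) K) : Matrix (Fin 3) (Fin 3) K) = (s : K) • ((γ : GL (Fin 3) K) : Matrix (Fin 3) (Fin 3) K) := by
    rw [hγ, hγ']; exact coe_conj_endoGL_centred_eq_smul P γ₁ u s hs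
  rw [ncard_strata_eq_of_coe_eq_smul hvσ hϖ ((StdForm.antidiagonal 3).over K) hsv hsv1 (γ : GL (Fin 3) K) (γ' : GL (Fin 3) K) hTT c₁ (c₁ * ε) j] at key
  exact key

/-! ## §2 Over ★ p849055 (region hypotheses discharged by the anisotropic frame; remaining inputs: the census, the true depth `hγd`, `hdisc`) -/

set_option maxHeartbeats 1600000 in
-- budget only: statement-heavy lattice tokens (verbatim the ★ head's budget).
/-- **ODD ROOT DEPTH — THE FIVE STRATA COUNTS OF THE ANISOTROPIC LITERAL `γ = P·ι(γ₁, u)·P⁻¹` FROM THE BLOCK-LAW BINDERS, THE TRUE DEPTH AND THE ROOT'S COLLAR CENSUS.**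
★ `strataCount_J₀_of_charpoly_block_raw_singleton_of_anisotropic_frame` (F0P3a-p08 (g20)) applied to the CENTRED element `γ′ = P·ι(s·γ₁, 1)·P⁻¹` (`s·u₀₀ = 1`): its
`hγ0 ∕ hchar ∕ hlam ∕ hBm ∕ hroot ∕ hγint ∕ hu1 ∕ hγU ∕ hirr ∕ hdisc` slots are ALL filled from the block-law binders (`hP hP0 hγU hirr hdisc` for `γ₁`, `hu2` for `u₀₀`) and the
true depth `hγd : |(γ₁ − u₀₀·1)_{ij}| ≤ |ϖ|^{d₀}` by ★ `UnitaryLatticeTreeBlockLiteralCentring` (`s·γ₁` is integral, unitary, rootless, of the same discriminant depth, `d₀`-deep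
about `1`; `σ(u₀₀)·u₀₀ = 1` is read off `γ ∈ U(σ, Φ₃)`); the census `(NE, NP, NM)` is taken AT `γ′`; the conclusion is moved back to `γ` by ★ `ncard_strata_eq_of_coe_eq_smul`.
[cite: Kottwitz1986, §3] [cite: Rogawski1990, §4.8 Case (a) p. 53; §4.9 pp. 54–56] [cite: BruhatTits1972, §10] -/
theorem strataCount_J₀_of_charpoly_block_raw_singleton_of_anisotropic_frame_centred [ValuativeRel K] [(Valued.v : Valuation K ℤᵐ⁰).Compatible] [IsPrincipalIdealRing 𝒪[K]]
    (hσ : ∀ x, σ (σ x) = x) (hvσ : ∀ a, Valued.v (σ a) = Valued.v a) (hσϖ : σ ϖ = -ϖ)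
    (hϖ : Valued.v ϖ = WithZero.exp (-1 : ℤ)) (hres : ∀ x : K, Valued.v x ≤ 1 → Valued.v (σ x - x) < 1) (h2 : Valued.v (2 : K) = 1)
    (hnorm : ∀ u : K, σ u = u → Valued.v (u - 1) < 1 → ∃ z : K, z * σ z = u ∧ Valued.v (z - 1) ≤ Valued.v (u - 1)) [Fintype 𝓀[K]] [DecidableEq 𝓀[K]]
    {d₀ : ℕ}
    (mA : ℕ) (hmA : d₀ = 2 * mA + 3)
    (c₁ ε : K) (hc₁ : Valued.v c₁ = 1) (hεv : Valued.v ε = 1) (hε : ∀ z : K, Valued.v z ≤ 1 → Valued.v (z ^ 2 - ε) = 1)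
    (q : ℕ) (hq : q = Fintype.card 𝓀[K])
    (hsq : ∀ t : K, Valued.v (t - 1) < 1 → IsSquare t)
    {d : Fin 2 → K} {η : K} (P : GL (Fin 3) K)
    (hP : formCongr σ P ((StdForm.antidiagonal 3).over K) =
      !![(Matrix.diagonal d) 0 0, 0, (Matrix.diagonal d) 0 1; 0, η, 0; (Matrix.diagonal d) 1 0, 0, (Matrix.diagonal d) 1 1])
    (hP0 : mapGL P (stdLattice K 3) = stdLattice K 3)
    (hd : ∀ i, Valued.v (d i) = 1) (hdσ : ∀ i, σ (d i) = d i)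
    (hanis₀ : ∀ c : K, Valued.v c ≤ 1 → Valued.v (d 0 + d 1 * (σ c * c)) = 1)
    (hanis₁ : ∀ c : K, Valued.v c ≤ 1 → Valued.v (d 0 * (σ c * c) + d 1) = 1)
    (hησ : σ η = η) (hη : Valued.v η = 1)
    (γ₁ : GL (Fin 2) K) (u : GL (Fin 1) K) (hu2 : Valued.v ((u : Matrix (Fin 1) (Fin 1) K) 0 0 - 1) ≤ Valued.v ϖ ^ 2)
    (s : Kˣ) (hs : (s : K) * (u : Matrix (Fin 1) (Fin 1) K) 0 0 = 1)
    {γ γ' : unitaryGroupOfForm σ ((StdForm.antidiagonal 3).over K)} (hγ : (γ : GL (Fin 3) K) = P * endoGL (γ₁, u) * P⁻¹)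
    (hγ' : (γ' : GL (Fin 3) K) = P * endoGL (Matrix.GeneralLinearGroup.scalar (Fin 2) s * γ₁, (1 : GL (Fin 1) K)) * P⁻¹)
    (hγU : γ₁ ∈ unitaryGroupOfForm σ (Matrix.diagonal d))
    (hirr : ∀ x : K, ¬ (γ₁ : Matrix (Fin 2) (Fin 2) K).charpoly.IsRoot x)
    (hdisc : Valued.v ϖ ^ (2 * d₀) ≤ Valued.v ((γ₁ : Matrix (Fin 2) (Fin 2) K).trace ^ 2 - 4 * (γ₁ : Matrix (Fin 2) (Fin 2) K).det))
    (hγd : ∀ i j, Valued.v (((γ₁ : Matrix (Fin 2) (Fin 2) K) - ((u : Matrix (Fin 1) (Fin 1) K) 0 0) • (1 : Matrix (Fin 2) (Fin 2) K)) i j) ≤ Valued.v ϖ ^ d₀)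
    (NE NP NM : ℕ)
    (hNE : ({w | w ∈ {w | ∃ c, ((latticeGraph σ ϖ ((StdForm.antidiagonal 3).over K)).Adj (⟨stdLattice K 3, 0, isSelfDualLattice_stdLattice_three_of_v hϖ⟩ : {M : Submodule 𝒪[K] (Fin 3 → K) // IsVertex σ ϖ ((StdForm.antidiagonal 3).over K) M}) c ∧ (latticeGraph σ ϖ ((StdForm.antidiagonal 3).over K)).dist ⟨stdLattice K 3, 0, isSelfDualLattice_stdLattice_three_of_v hϖ⟩ c = (latticeGraph σ ϖ ((StdForm.antidiagonal 3).over K)).dist ⟨stdLattice K 3, 0, isSelfDualLattice_stdLattice_three_of_v hϖ⟩ (⟨stdLattice K 3, 0, isSelfDualLattice_stdLattice_three_of_v hϖ⟩ : {M : Submodule 𝒪[K] (Fin 3 → K) // IsVertex σ ϖ ((StdForm.antidiagonal 3).over K) M}) + 1 ∧ latticeGraphIso σ ϖ ((StdForm.antidiagonal 3).over K) γ' c = c) ∧ ((latticeGraph σ ϖ ((StdForm.antidiagonal 3).over K)).Adj c w ∧ (latticeGraph σ ϖ ((StdForm.antidiagonal 3).over K)).dist ⟨stdLattice K 3, 0,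 isSelfDualLattice_stdLattice_three_of_v hϖ⟩ w = (latticeGraph σ ϖ ((StdForm.antidiagonal 3).over K)).dist ⟨stdLattice K 3, 0, isSelfDualLattice_stdLattice_three_of_v hϖ⟩ c + 1 ∧ latticeGraphIso σ ϖ ((StdForm.antidiagonal 3).over K) γ' w = w)} ∧ (¬ w.1.map ((Matrix.toLin' (((γ' : GL (Fin 3) K) : Matrix (Fin 3) (Fin 3) K) - 1)).restrictScalars 𝒪[K]) ≤ scaleLattice (ϖ ^ d₀) w.1 ∧ (w.1.map ((Matrix.toLin' (((γ' : GL (Fin 3) K) : Matrix (Fin 3) (Fin 3) K) - 1)).restrictScalars 𝒪[K]) ≤ scaleLattice (ϖ ^ (d₀ - 1)) w.1 ∧ ¬ w.1.map ((Matrix.toLin' (((γ' : GL (Fin 3) K) : Matrix (Fin 3) (Fin 3) K) - 1)).restrictScalars 𝒪[K]) ≤ scaleLattice (ϖ ^ d₀) w.1))}).ncard = NE)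
    (hNP : ({w | w ∈ {w | ∃ c, ((latticeGraph σ ϖ ((StdForm.antidiagonal 3).over K)).Adj (⟨stdLattice K 3, 0, isSelfDualLattice_stdLattice_three_of_v hϖ⟩ : {M : Submodule 𝒪[K] (Fin 3 → K) // IsVertex σ ϖ ((StdForm.antidiagonal 3).over K) M}) c ∧ (latticeGraph σ ϖ ((StdForm.antidiagonal 3).over K)).dist ⟨stdLattice K 3, 0, isSelfDualLattice_stdLattice_three_of_v hϖ⟩ c = (latticeGraph σ ϖ ((StdForm.antidiagonal 3).over K)).dist ⟨stdLattice K 3, 0, isSelfDualLattice_stdLattice_three_of_v hϖ⟩ (⟨stdLattice K 3, 0, isSelfDualLattice_stdLattice_three_of_v hϖ⟩ : {M : Submodule 𝒪[K] (Fin 3 → K) // IsVertex σ ϖ ((StdForm.antidiagonal 3).over K) M}) + 1 ∧ latticeGraphIso σ ϖ ((StdForm.antidiagonal 3).over K) γ' c = c) ∧ ((latticeGraph σ ϖ ((StdForm.antidiagonal 3).over K)).Adj c w ∧ (latticeGraph σ ϖ ((StdForm.antidiagonal 3).over K)).dist ⟨stdLattice K 3, 0, isSelfDualLattice_stdLattice_three_of_v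 hϖ⟩ w = (latticeGraph σ ϖ ((StdForm.antidiagonal 3).over K)).dist ⟨stdLattice K 3, 0, isSelfDualLattice_stdLattice_three_of_v hϖ⟩ c + 1 ∧ latticeGraphIso σ ϖ ((StdForm.antidiagonal 3).over K) γ' w = w)} ∧ (¬ w.1.map ((Matrix.toLin' (((γ' : GL (Fin 3) K) : Matrix (Fin 3) (Fin 3) K) - 1)).restrictScalars 𝒪[K]) ≤ scaleLattice (ϖ ^ d₀) w.1 ∧ (w.1.map ((Matrix.toLin' (((γ' : GL (Fin 3) K) : Matrix (Fin 3) (Fin 3) K) - 1)).restrictScalars 𝒪[K]) ≤ scaleLattice (ϖ ^ (d₀ - 2)) w.1 ∧ ¬ w.1.map ((Matrix.toLin' (((γ' : GL (Fin 3) K) : Matrix (Fin 3) (Fin 3) K) - 1)).restrictScalars 𝒪[K]) ≤ scaleLattice (ϖ ^ (d₀ - 1)) w.1) ∧ ∃ y ∈ w.1, ∃ a : K, Valued.v a = 1 ∧ Valued.v ((ϖ ^ (d₀ - 2))⁻¹ * pairing σ ((StdForm.antidiagonal 3).over K) y ((((γ' : GL (Fin 3) K) : Matrix (Fin 3) (Fin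 3) K) - 1) *ᵥ y) - (c₁) * a ^ 2) < 1)}).ncard = NP)
    (hNM : ({w | w ∈ {w | ∃ c, ((latticeGraph σ ϖ ((StdForm.antidiagonal 3).over K)).Adj (⟨stdLattice K 3, 0, isSelfDualLattice_stdLattice_three_of_v hϖ⟩ : {M : Submodule 𝒪[K] (Fin 3 → K) // IsVertex σ ϖ ((StdForm.antidiagonal 3).over K) M}) c ∧ (latticeGraph σ ϖ ((StdForm.antidiagonal 3).over K)).dist ⟨stdLattice K 3, 0, isSelfDualLattice_stdLattice_three_of_v hϖ⟩ c = (latticeGraph σ ϖ ((StdForm.antidiagonal 3).over K)).dist ⟨stdLattice K 3, 0, isSelfDualLattice_stdLattice_three_of_v hϖ⟩ (⟨stdLattice K 3, 0, isSelfDualLattice_stdLattice_three_of_v hϖ⟩ : {M : Submodule 𝒪[K] (Fin 3 → K) // IsVertex σ ϖ ((StdForm.antidiagonal 3).over K) M}) + 1 ∧ latticeGraphIso σ ϖ ((StdForm.antidiagonal 3).over K) γ' c = c) ∧ ((latticeGraph σ ϖ ((StdForm.antidiagonal 3).over K)).Adj c w ∧ (latticeGraph σ ϖ ((StdForm.antidiagonal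 3).over K)).dist ⟨stdLattice K 3, 0, isSelfDualLattice_stdLattice_three_of_v hϖ⟩ w = (latticeGraph σ ϖ ((StdForm.antidiagonal 3).over K)).dist ⟨stdLattice K 3, 0, isSelfDualLattice_stdLattice_three_of_v hϖ⟩ c + 1 ∧ latticeGraphIso σ ϖ ((StdForm.antidiagonal 3).over K) γ' w = w)} ∧ (¬ w.1.map ((Matrix.toLin' (((γ' : GL (Fin 3) K) : Matrix (Fin 3) (Fin 3) K) - 1)).restrictScalars 𝒪[K]) ≤ scaleLattice (ϖ ^ d₀) w.1 ∧ (w.1.map ((Matrix.toLin' (((γ' : GL (Fin 3) K) : Matrix (Fin 3) (Fin 3) K) - 1)).restrictScalars 𝒪[K]) ≤ scaleLattice (ϖ ^ (d₀ - 2)) w.1 ∧ ¬ w.1.map ((Matrix.toLin' (((γ' : GL (Fin 3) K) : Matrix (Fin 3) (Fin 3) K) - 1)).restrictScalars 𝒪[K]) ≤ scaleLattice (ϖ ^ (d₀ - 1)) w.1) ∧ ¬ (∃ y ∈ w.1, ∃ a : K, Valued.v a = 1 ∧ Valued.v ((ϖ ^ (d₀ - 2))⁻¹ * pairing σ ((StdForm.antidiagonal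 3).over K) y ((((γ' : GL (Fin 3) K) : Matrix (Fin 3) (Fin 3) K) - 1) *ᵥ y) - (c₁) * a ^ 2) < 1))}).ncard = NM) (j : Fin 5) :
    ({M : Submodule 𝒪[K] (Fin 3 → K) | IsSelfDualLattice σ ϖ ((StdForm.antidiagonal 3).over K) M ∧ mapGL (γ : GL (Fin 3) K) M = M ∧
        (![¬ M.map ((Matrix.toLin' (((γ : GL (Fin 3) K) : Matrix (Fin 3) (Fin 3) K) - 1)).restrictScalars 𝒪[K]) ≤ scaleLattice ϖ M,
                  M.map ((Matrix.toLin' (((γ : GL (Fin 3) K) : Matrix (Fin 3) (Fin 3) K) - 1)).restrictScalars 𝒪[K]) ≤ scaleLattice ϖ M ∧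
                    ¬ M.map ((Matrix.toLin' (((γ : GL (Fin 3) K) : Matrix (Fin 3) (Fin 3) K) - 1)).restrictScalars 𝒪[K]) ≤ scaleLattice (ϖ ^ 2) M ∧
                    ¬ M.map ((Matrix.toLin' ((((γ : GL (Fin 3) K) : Matrix (Fin 3) (Fin 3) K) - 1) ^ 2)).restrictScalars 𝒪[K]) ≤ scaleLattice (ϖ ^ 3) M,
                  M.map ((Matrix.toLin' (((γ : GL (Fin 3) K) : Matrix (Fin 3) (Fin 3) K) - 1)).restrictScalars 𝒪[K]) ≤ scaleLattice ϖ M ∧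
                    ¬ M.map ((Matrix.toLin' (((γ : GL (Fin 3) K) : Matrix (Fin 3) (Fin 3) K) - 1)).restrictScalars 𝒪[K]) ≤ scaleLattice (ϖ ^ 2) M ∧
                    M.map ((Matrix.toLin' ((((γ : GL (Fin 3) K) : Matrix (Fin 3) (Fin 3) K) - 1) ^ 2)).restrictScalars 𝒪[K]) ≤ scaleLattice (ϖ ^ 3) M ∧
                    ∃ y ∈ M, ∃ a : K, Valued.v a = 1 ∧
                      Valued.v (ϖ⁻¹ * pairing σ (((StdForm.antidiagonal 3).over K)) y
                        ((((γ : GL (Fin 3) K) : Matrix (Fin 3) (Fin 3) K) - 1) *ᵥ y) - c₁ * a ^ 2) < 1,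
                  M.map ((Matrix.toLin' (((γ : GL (Fin 3) K) : Matrix (Fin 3) (Fin 3) K) - 1)).restrictScalars 𝒪[K]) ≤ scaleLattice ϖ M ∧
                    ¬ M.map ((Matrix.toLin' (((γ : GL (Fin 3) K) : Matrix (Fin 3) (Fin 3) K) - 1)).restrictScalars 𝒪[K]) ≤ scaleLattice (ϖ ^ 2) M ∧
                    M.map ((Matrix.toLin' ((((γ : GL (Fin 3) K) : Matrix (Fin 3) (Fin 3) K) - 1) ^ 2)).restrictScalars 𝒪[K]) ≤ scaleLattice (ϖ ^ 3) M ∧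
                    ∃ y ∈ M, ∃ a : K, Valued.v a = 1 ∧
                      Valued.v (ϖ⁻¹ * pairing σ (((StdForm.antidiagonal 3).over K)) y
                        ((((γ : GL (Fin 3) K) : Matrix (Fin 3) (Fin 3) K) - 1) *ᵥ y) - c₁ * ε * a ^ 2) < 1,
                  M.map ((Matrix.toLin' (((γ : GL (Fin 3) K) : Matrix (Fin 3) (Fin 3) K) - 1)).restrictScalars 𝒪[K]) ≤ scaleLattice (ϖ ^ 2) M] : Fin 5 → Prop) j}.ncard) =
      (if IsSquare (-1 : 𝓀[K]) then
          ((1 : ℕ) • (![0, 0, 0, 0, 1] : Fin 5 → ℕ) + NE • (![q ^ (3 * mA + 3), q ^ (3 * mA + 2), q.choose 2 * q ^ (2 * mA) * ∑ i ∈ Finset.range mA, q ^ i, q.choose 2 * q ^ (2 * mA) * ∑ i ∈ Finset.range mA, q ^ i,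
          ∑ i ∈ Finset.range (mA + 1), q ^ (2 * i) + ∑ i ∈ Finset.range mA, q ^ (2 * mA + 1 + i)] : Fin 5 → ℕ) + NP • (![0, 0, q ^ (2 * mA), 0, ∑ i ∈ Finset.range mA, q ^ (2 * i)] : Fin 5 → ℕ) + NM • (![0, 0, 0, q ^ (2 * mA), ∑ i ∈ Finset.range mA, q ^ (2 * i)] : Fin 5 → ℕ)) j
        else
          ((1 : ℕ) • (![0, 0, 0, 0, 1] : Fin 5 → ℕ) + NE • (![q ^ (3 * mA + 3), q ^ (3 * mA + 2), q.choose 2 * q ^ (2 * mA) * ∑ i ∈ Finset.range mA, q ^ i, q.choose 2 * q ^ (2 * mA) * ∑ i ∈ Finset.range mA, q ^ i,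
          ∑ i ∈ Finset.range (mA + 1), q ^ (2 * i) + ∑ i ∈ Finset.range mA, q ^ (2 * mA + 1 + i)] : Fin 5 → ℕ) + NP • (![0, 0, if Even mA then q ^ (2 * mA) else 0, if Even mA then 0 else q ^ (2 * mA), ∑ i ∈ Finset.range mA, q ^ (2 * i)] : Fin 5 → ℕ) + NM • (![0, 0, if Even mA then 0 else q ^ (2 * mA), if Even mA then q ^ (2 * mA) else 0, ∑ i ∈ Finset.range mA, q ^ (2 * i)] : Fin 5 → ℕ)) j) := by
  have hϖ0 : ϖ ≠ 0 := fun h0 => by rw [h0, map_zero] at hϖ; exact WithZero.coe_ne_zero hϖ.symm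
  have hϖlt : Valued.v ϖ < 1 := by rw [hϖ, ← WithZero.exp_zero]; exact WithZero.exp_lt_exp.2 (by norm_num)
  have hd0 : d₀ ≠ 0 := by rw [hmA]; omega
  have hlt : Valued.v ϖ ^ d₀ < 1 := pow_lt_one₀ zero_le hϖlt hd0
  have hη0 : η ≠ 0 := fun h => by rw [h, map_zero] at hη; exact zero_ne_one hη
  obtain ⟨hPi1, hPi2⟩ := (mapGL_stdLattice_eq_iff P).1 hP0
  -- `|u₀₀| = 1` from `|u₀₀ − 1| ≤ |ϖ|² < 1`; `s = u₀₀⁻¹` is `2`-deep and norm-one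
  have hvu : Valued.v ((u : Matrix (Fin 1) (Fin 1) K) 0 0) = 1 := by
    have hlt1 : Valued.v ((u : Matrix (Fin 1) (Fin 1) K) 0 0 - 1) < 1 := hu2.trans_lt (pow_lt_one₀ zero_le hϖlt two_ne_zero)
    have h := Valued.v.map_one_add_of_lt hlt1
    rwa [add_sub_cancel] at h
  obtain ⟨hsv, hsv1⟩ := v_eq_one_and_v_sub_one_le_of_mul_eq_one (ϖ := ϖ) hvu hu2 hs
  have hu : σ ((u : Matrix (Fin 1) (Fin 1) K) 0 0) * (u : Matrix (Fin 1) (Fin 1) K) 0 0 = 1 := by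
    have hU : P * endoGL (γ₁, u) * P⁻¹ ∈ unitaryGroupOfForm σ ((StdForm.antidiagonal 3).over K) := hγ ▸ γ.2
    rw [conj_mem_unitaryGroupOfForm_iff, hP, ← endoForm_diagonal_oneByOne_eq, endoGL_mem_iff] at hU
    exact norm_eq_one_of_oneByOne_mem_unitaryGroupOfForm hη0 hU.2
  have hsσ : σ (s : K) * (s : K) = 1 := norm_eq_one_of_mul_eq_one_of_norm_eq_one hu hs
  -- the centred block `s·γ₁`: depth `d₀` about `1`, integral, unitary, rootless, same discriminant depth
  have hBm : ∀ i j, Valued.v ((((Matrix.GeneralLinearGroup.scalar (Fin 2) s * γ₁ : GL (Fin 2) K) : Matrix (Fin 2) (Fin 2) K) - 1) i j) ≤ Valued.v ϖ ^ d₀ := by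
    rw [coe_scalar_mul_two_eq_smul]
    exact v_smul_sub_one_apply_le_of_mul_eq_one hs hsv.le hγd
  have hBint : IsIntMatrix ((Matrix.GeneralLinearGroup.scalar (Fin 2) s * γ₁ : GL (Fin 2) K) : Matrix (Fin 2) (Fin 2) K) :=
    isIntMatrix_of_forall_v_sub_one_le_of_lt_one hlt hBm
  have hBinv : IsIntMatrix (((Matrix.GeneralLinearGroup.scalar (Fin 2) s * γ₁)⁻¹ : GL (Fin 2) K) : Matrix (Fin 2) (Fin 2) K) :=
    isIntMatrix_coe_inv_of_forall_v_sub_one_le_of_lt_one hlt hBm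
  have hBU : Matrix.GeneralLinearGroup.scalar (Fin 2) s * γ₁ ∈ unitaryGroupOfForm σ (Matrix.diagonal d) := scalar_mul_mem_unitaryGroupOfForm hγU s hsσ
  have hBirr : ∀ x : K, ¬ ((Matrix.GeneralLinearGroup.scalar (Fin 2) s * γ₁ : GL (Fin 2) K) : Matrix (Fin 2) (Fin 2) K).charpoly.IsRoot x := by
    rw [coe_scalar_mul_two_eq_smul]
    exact forall_not_isRoot_charpoly_smul s.ne_zero hirr
  have hBdisc : Valued.v ϖ ^ (2 * d₀) ≤ Valued.v (((Matrix.GeneralLinearGroup.scalar (Fin 2) s * γ₁ : GL (Fin 2) K) : Matrix (Fin 2) (Fin 2) K).trace ^ 2 -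
      4 * ((Matrix.GeneralLinearGroup.scalar (Fin 2) s * γ₁ : GL (Fin 2) K) : Matrix (Fin 2) (Fin 2) K).det) := by
    rw [coe_scalar_mul_two_eq_smul, v_trace_sq_sub_four_mul_det_smul hsv]
    exact hdisc
  have hu1 : Valued.v (((1 : GL (Fin 1) K) : Matrix (Fin 1) (Fin 1) K) 0 0) ≤ 1 := by
    rw [Units.val_one, Matrix.one_apply_eq, map_one]
  -- `γ′ ∈ K₀`, `hchar ∕ hroot` at `γ′`
  have hγ0 : γ' ∈ unitaryInt σ ((StdForm.antidiagonal 3).over K) := by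
    rw [mem_unitaryInt_iff]
    change IsIntMatrix ((γ' : GL (Fin 3) K) : Matrix (Fin 3) (Fin 3) K) ∧ IsIntMatrix (((γ' : GL (Fin 3) K)⁻¹ : GL (Fin 3) K) : Matrix (Fin 3) (Fin 3) K)
    rw [hγ']
    exact ⟨isIntMatrix_coe_conj_endoGL hPi1 hPi2 hBint isIntMatrix_coe_one,
      isIntMatrix_coe_conj_endoGL_inv hPi1 hPi2 hBinv (by rw [inv_one]; exact isIntMatrix_coe_one)⟩
  have hchar : (((γ' : GL (Fin 3) K) : Matrix (Fin 3) (Fin 3) K)).charpoly =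
      (X - C (1 : K)) * ((Matrix.GeneralLinearGroup.scalar (Fin 2) s * γ₁ : GL (Fin 2) K) : Matrix (Fin 2) (Fin 2) K).charpoly := by
    rw [hγ']; exact charpoly_coe_conj_endoGL_one P _
  have hroot : (stdLattice K 3).map ((Matrix.toLin' (((γ' : GL (Fin 3) K) : Matrix (Fin 3) (Fin 3) K) - 1)).restrictScalars 𝒪[K]) ≤ scaleLattice (ϖ ^ d₀) (stdLattice K 3) := by
    rw [hγ']
    exact map_sub_one_stdLattice_le_scaleLattice_of_conj_endoGL_one (pow_ne_zero _ hϖ0) hPi1 hPi2 (fun i j => by rw [map_pow]; exact hBm i j)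
  have key := strataCount_J₀_of_charpoly_block_raw_singleton_of_anisotropic_frame hσ hvσ hσϖ hϖ hres h2 hnorm hγ0 1 _ hchar (UnitaryLatticeTree.v_one_sub_one_le _) hBm hroot
    mA hmA c₁ ε hc₁ hεv hε q hq hsq P hP hP0 hd hdσ hanis₀ hanis₁ hησ hη (Matrix.GeneralLinearGroup.scalar (Fin 2) s * γ₁) 1 hγ' hBint hu1 hBU hBirr hBdisc
    NE NP NM hNE hNP hNM j
  -- back to `γ`: `↑γ′ = s • ↑γ`
  have hTT : ((γ' : GL (Fin 3) K) : Matrix (Fin 3) (Fin 3) K) = (s : K) • ((γ : GL (Fin 3) K) : Matrix (Fin 3) (Fin 3) K) := by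
    rw [hγ, hγ']; exact coe_conj_endoGL_centred_eq_smul P γ₁ u s hs
  rw [ncard_strata_eq_of_coe_eq_smul hvσ hϖ ((StdForm.antidiagonal 3).over K) hsv hsv1 (γ : GL (Fin 3) K) (γ' : GL (Fin 3) K) hTT c₁ (c₁ * ε) j] at key
  exact key


set_option maxHeartbeats 1600000 in
-- budget only: statement-heavy lattice tokens (verbatim the ★ head's budget).
/-- **EVEN ROOT DEPTH — the same over ★ `strataCount_J₀_of_charpoly_block_even_singleton_of_anisotropic_frame`** (`d₀ = 2mA + 2`; census `(NE, NO, NP, NM)` AT `γ′`).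
[cite: Kottwitz1986, §3] [cite: Rogawski1990, §4.8 Case (a) p. 53; §4.9 pp. 54–56] [cite: BruhatTits1972, §10] -/
theorem strataCount_J₀_of_charpoly_block_even_singleton_of_anisotropic_frame_centred [ValuativeRel K] [(Valued.v : Valuation K ℤᵐ⁰).Compatible] [IsPrincipalIdealRing 𝒪[K]]
    (hσ : ∀ x, σ (σ x) = x) (hvσ : ∀ a, Valued.v (σ a) = Valued.v a) (hσϖ : σ ϖ = -ϖ)
    (hϖ : Valued.v ϖ = WithZero.exp (-1 : ℤ)) (hres : ∀ x : K, Valued.v x ≤ 1 → Valued.v (σ x - x) < 1) (h2 : Valued.v (2 : K) = 1)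
    (hnorm : ∀ u : K, σ u = u → Valued.v (u - 1) < 1 → ∃ z : K, z * σ z = u ∧ Valued.v (z - 1) ≤ Valued.v (u - 1)) [Fintype 𝓀[K]] [DecidableEq 𝓀[K]]
    {d₀ : ℕ}
    (mA : ℕ) (hmA : d₀ = 2 * mA + 2)
    (c₁ ε : K) (hc₁ : Valued.v c₁ = 1) (hεv : Valued.v ε = 1) (hε : ∀ z : K, Valued.v z ≤ 1 → Valued.v (z ^ 2 - ε) = 1)
    (q : ℕ) (hq : q = Fintype.card 𝓀[K])
    (hsq : ∀ t : K, Valued.v (t - 1) < 1 → IsSquare t)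
    {d : Fin 2 → K} {η : K} (P : GL (Fin 3) K)
    (hP : formCongr σ P ((StdForm.antidiagonal 3).over K) =
      !![(Matrix.diagonal d) 0 0, 0, (Matrix.diagonal d) 0 1; 0, η, 0; (Matrix.diagonal d) 1 0, 0, (Matrix.diagonal d) 1 1])
    (hP0 : mapGL P (stdLattice K 3) = stdLattice K 3)
    (hd : ∀ i, Valued.v (d i) = 1) (hdσ : ∀ i, σ (d i) = d i)
    (hanis₀ : ∀ c : K, Valued.v c ≤ 1 → Valued.v (d 0 + d 1 * (σ c * c)) = 1)
    (hanis₁ : ∀ c : K, Valued.v c ≤ 1 → Valued.v (d 0 * (σ c * c) + d 1) = 1)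
    (hησ : σ η = η) (hη : Valued.v η = 1)
    (γ₁ : GL (Fin 2) K) (u : GL (Fin 1) K) (hu2 : Valued.v ((u : Matrix (Fin 1) (Fin 1) K) 0 0 - 1) ≤ Valued.v ϖ ^ 2)
    (s : Kˣ) (hs : (s : K) * (u : Matrix (Fin 1) (Fin 1) K) 0 0 = 1)
    {γ γ' : unitaryGroupOfForm σ ((StdForm.antidiagonal 3).over K)} (hγ : (γ : GL (Fin 3) K) = P * endoGL (γ₁, u) * P⁻¹)
    (hγ' : (γ' : GL (Fin 3) K) = P * endoGL (Matrix.GeneralLinearGroup.scalar (Fin 2) s * γ₁, (1 : GL (Fin 1) K)) * P⁻¹)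
    (hγU : γ₁ ∈ unitaryGroupOfForm σ (Matrix.diagonal d))
    (hirr : ∀ x : K, ¬ (γ₁ : Matrix (Fin 2) (Fin 2) K).charpoly.IsRoot x)
    (hdisc : Valued.v ϖ ^ (2 * d₀) ≤ Valued.v ((γ₁ : Matrix (Fin 2) (Fin 2) K).trace ^ 2 - 4 * (γ₁ : Matrix (Fin 2) (Fin 2) K).det))
    (hγd : ∀ i j, Valued.v (((γ₁ : Matrix (Fin 2) (Fin 2) K) - ((u : Matrix (Fin 1) (Fin 1) K) 0 0) • (1 : Matrix (Fin 2) (Fin 2) K)) i j) ≤ Valued.v ϖ ^ d₀)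
    (NE NO NP NM : ℕ)
    (hNE : ({w | w ∈ {w | ∃ c, ((latticeGraph σ ϖ ((StdForm.antidiagonal 3).over K)).Adj (⟨stdLattice K 3, 0, isSelfDualLattice_stdLattice_three_of_v hϖ⟩ : {M : Submodule 𝒪[K] (Fin 3 → K) // IsVertex σ ϖ ((StdForm.antidiagonal 3).over K) M}) c ∧ (latticeGraph σ ϖ ((StdForm.antidiagonal 3).over K)).dist ⟨stdLattice K 3, 0, isSelfDualLattice_stdLattice_three_of_v hϖ⟩ c = (latticeGraph σ ϖ ((StdForm.antidiagonal 3).over K)).dist ⟨stdLattice K 3, 0, isSelfDualLattice_stdLattice_three_of_v hϖ⟩ (⟨stdLattice K 3, 0, isSelfDualLattice_stdLattice_three_of_v hϖ⟩ : {M : Submodule 𝒪[K] (Fin 3 → K) // IsVertex σ ϖ ((StdForm.antidiagonal 3).over K) M}) + 1 ∧ latticeGraphIso σ ϖ ((StdForm.antidiagonal 3).over K) γ' c = c) ∧ ((latticeGraph σ ϖ ((StdForm.antidiagonal 3).over K)).Adj c w ∧ (latticeGraph σ ϖ ((StdForm.antidiagonal 3).over K)).dist ⟨stdLattice K 3, 0,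 isSelfDualLattice_stdLattice_three_of_v hϖ⟩ w = (latticeGraph σ ϖ ((StdForm.antidiagonal 3).over K)).dist ⟨stdLattice K 3, 0, isSelfDualLattice_stdLattice_three_of_v hϖ⟩ c + 1 ∧ latticeGraphIso σ ϖ ((StdForm.antidiagonal 3).over K) γ' w = w)} ∧ (¬ w.1.map ((Matrix.toLin' (((γ' : GL (Fin 3) K) : Matrix (Fin 3) (Fin 3) K) - 1)).restrictScalars 𝒪[K]) ≤ scaleLattice (ϖ ^ d₀) w.1 ∧ (w.1.map ((Matrix.toLin' (((γ' : GL (Fin 3) K) : Matrix (Fin 3) (Fin 3) K) - 1)).restrictScalars 𝒪[K]) ≤ scaleLattice (ϖ ^ (d₀ - 2)) w.1 ∧ ¬ w.1.map ((Matrix.toLin' (((γ' : GL (Fin 3) K) : Matrix (Fin 3) (Fin 3) K) - 1)).restrictScalars 𝒪[K]) ≤ scaleLattice (ϖ ^ (d₀ - 1)) w.1))}).ncard = NE)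
    (hNO : ({w | w ∈ {w | ∃ c, ((latticeGraph σ ϖ ((StdForm.antidiagonal 3).over K)).Adj (⟨stdLattice K 3, 0, isSelfDualLattice_stdLattice_three_of_v hϖ⟩ : {M : Submodule 𝒪[K] (Fin 3 → K) // IsVertex σ ϖ ((StdForm.antidiagonal 3).over K) M}) c ∧ (latticeGraph σ ϖ ((StdForm.antidiagonal 3).over K)).dist ⟨stdLattice K 3, 0, isSelfDualLattice_stdLattice_three_of_v hϖ⟩ c = (latticeGraph σ ϖ ((StdForm.antidiagonal 3).over K)).dist ⟨stdLattice K 3, 0, isSelfDualLattice_stdLattice_three_of_v hϖ⟩ (⟨stdLattice K 3, 0, isSelfDualLattice_stdLattice_three_of_v hϖ⟩ : {M : Submodule 𝒪[K] (Fin 3 → K) // IsVertex σ ϖ ((StdForm.antidiagonal 3).over K) M}) + 1 ∧ latticeGraphIso σ ϖ ((StdForm.antidiagonal 3).over K) γ' c = c) ∧ ((latticeGraph σ ϖ ((StdForm.antidiagonal 3).over K)).Adj c w ∧ (latticeGraph σ ϖ ((StdForm.antidiagonal 3).over K)).dist ⟨stdLattice K 3, 0, isSelfDualLattice_stdLattice_three_of_v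 hϖ⟩ w = (latticeGraph σ ϖ ((StdForm.antidiagonal 3).over K)).dist ⟨stdLattice K 3, 0, isSelfDualLattice_stdLattice_three_of_v hϖ⟩ c + 1 ∧ latticeGraphIso σ ϖ ((StdForm.antidiagonal 3).over K) γ' w = w)} ∧ (¬ w.1.map ((Matrix.toLin' (((γ' : GL (Fin 3) K) : Matrix (Fin 3) (Fin 3) K) - 1)).restrictScalars 𝒪[K]) ≤ scaleLattice (ϖ ^ d₀) w.1 ∧ (w.1.map ((Matrix.toLin' (((γ' : GL (Fin 3) K) : Matrix (Fin 3) (Fin 3) K) - 1)).restrictScalars 𝒪[K]) ≤ scaleLattice (ϖ ^ (d₀ - 1)) w.1 ∧ ¬ w.1.map ((Matrix.toLin' (((γ' : GL (Fin 3) K) : Matrix (Fin 3) (Fin 3) K) - 1)).restrictScalars 𝒪[K]) ≤ scaleLattice (ϖ ^ d₀) w.1) ∧ ¬ w.1.map ((Matrix.toLin' ((((γ' : GL (Fin 3) K) : Matrix (Fin 3) (Fin 3) K) - 1) ^ 2)).restrictScalars 𝒪[K]) ≤ scaleLattice (ϖ ^ (2 * d₀ - 1)) w.1)}).ncard = NO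)
    (hNP : ({w | w ∈ {w | ∃ c, ((latticeGraph σ ϖ ((StdForm.antidiagonal 3).over K)).Adj (⟨stdLattice K 3, 0, isSelfDualLattice_stdLattice_three_of_v hϖ⟩ : {M : Submodule 𝒪[K] (Fin 3 → K) // IsVertex σ ϖ ((StdForm.antidiagonal 3).over K) M}) c ∧ (latticeGraph σ ϖ ((StdForm.antidiagonal 3).over K)).dist ⟨stdLattice K 3, 0, isSelfDualLattice_stdLattice_three_of_v hϖ⟩ c = (latticeGraph σ ϖ ((StdForm.antidiagonal 3).over K)).dist ⟨stdLattice K 3, 0, isSelfDualLattice_stdLattice_three_of_v hϖ⟩ (⟨stdLattice K 3, 0, isSelfDualLattice_stdLattice_three_of_v hϖ⟩ : {M : Submodule 𝒪[K] (Fin 3 → K) // IsVertex σ ϖ ((StdForm.antidiagonal 3).over K) M}) + 1 ∧ latticeGraphIso σ ϖ ((StdForm.antidiagonal 3).over K) γ' c = c) ∧ ((latticeGraph σ ϖ ((StdForm.antidiagonal 3).over K)).Adj c w ∧ (latticeGraph σ ϖ ((StdForm.antidiagonal 3).over K)).dist ⟨stdLattice K 3, 0, isSelfDualLattice_stdLattice_three_of_v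 hϖ⟩ w = (latticeGraph σ ϖ ((StdForm.antidiagonal 3).over K)).dist ⟨stdLattice K 3, 0, isSelfDualLattice_stdLattice_three_of_v hϖ⟩ c + 1 ∧ latticeGraphIso σ ϖ ((StdForm.antidiagonal 3).over K) γ' w = w)} ∧ (¬ w.1.map ((Matrix.toLin' (((γ' : GL (Fin 3) K) : Matrix (Fin 3) (Fin 3) K) - 1)).restrictScalars 𝒪[K]) ≤ scaleLattice (ϖ ^ d₀) w.1 ∧ (w.1.map ((Matrix.toLin' (((γ' : GL (Fin 3) K) : Matrix (Fin 3) (Fin 3) K) - 1)).restrictScalars 𝒪[K]) ≤ scaleLattice (ϖ ^ (d₀ - 1)) w.1 ∧ ¬ w.1.map ((Matrix.toLin' (((γ' : GL (Fin 3) K) : Matrix (Fin 3) (Fin 3) K) - 1)).restrictScalars 𝒪[K]) ≤ scaleLattice (ϖ ^ d₀) w.1) ∧ w.1.map ((Matrix.toLin' ((((γ' : GL (Fin 3) K) : Matrix (Fin 3) (Fin 3) K) - 1) ^ 2)).restrictScalars 𝒪[K]) ≤ scaleLattice (ϖ ^ (2 * d₀ - 1)) w.1 ∧ ∃ y ∈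 w.1, ∃ a : K, Valued.v a = 1 ∧ Valued.v ((ϖ ^ (d₀ - 1))⁻¹ * pairing σ ((StdForm.antidiagonal 3).over K) y ((((γ' : GL (Fin 3) K) : Matrix (Fin 3) (Fin 3) K) - 1) *ᵥ y) - (c₁) * a ^ 2) < 1)}).ncard = NP)
    (hNM : ({w | w ∈ {w | ∃ c, ((latticeGraph σ ϖ ((StdForm.antidiagonal 3).over K)).Adj (⟨stdLattice K 3, 0, isSelfDualLattice_stdLattice_three_of_v hϖ⟩ : {M : Submodule 𝒪[K] (Fin 3 → K) // IsVertex σ ϖ ((StdForm.antidiagonal 3).over K) M}) c ∧ (latticeGraph σ ϖ ((StdForm.antidiagonal 3).over K)).dist ⟨stdLattice K 3, 0, isSelfDualLattice_stdLattice_three_of_v hϖ⟩ c = (latticeGraph σ ϖ ((StdForm.antidiagonal 3).over K)).dist ⟨stdLattice K 3, 0, isSelfDualLattice_stdLattice_three_of_v hϖ⟩ (⟨stdLattice K 3, 0, isSelfDualLattice_stdLattice_three_of_v hϖ⟩ : {M : Submodule 𝒪[K] (Fin 3 → K) // IsVertex σ ϖ ((StdForm.antidiagonal 3).over K) M}) +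 1 ∧ latticeGraphIso σ ϖ ((StdForm.antidiagonal 3).over K) γ' c = c) ∧ ((latticeGraph σ ϖ ((StdForm.antidiagonal 3).over K)).Adj c w ∧ (latticeGraph σ ϖ ((StdForm.antidiagonal 3).over K)).dist ⟨stdLattice K 3, 0, isSelfDualLattice_stdLattice_three_of_v hϖ⟩ w = (latticeGraph σ ϖ ((StdForm.antidiagonal 3).over K)).dist ⟨stdLattice K 3, 0, isSelfDualLattice_stdLattice_three_of_v hϖ⟩ c + 1 ∧ latticeGraphIso σ ϖ ((StdForm.antidiagonal 3).over K) γ' w = w)} ∧ (¬ w.1.map ((Matrix.toLin' (((γ' : GL (Fin 3) K) : Matrix (Fin 3) (Fin 3) K) - 1)).restrictScalars 𝒪[K]) ≤ scaleLattice (ϖ ^ d₀) w.1 ∧ (w.1.map ((Matrix.toLin' (((γ' : GL (Fin 3) K) : Matrix (Fin 3) (Fin 3) K) - 1)).restrictScalars 𝒪[K]) ≤ scaleLattice (ϖ ^ (d₀ - 1)) w.1 ∧ ¬ w.1.map ((Matrix.toLin' (((γ' : GL (Fin 3) K) : Matrix (Fin 3) (Fin 3) K) - 1)).restrictScalars 𝒪[K])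 ≤ scaleLattice (ϖ ^ d₀) w.1) ∧ w.1.map ((Matrix.toLin' ((((γ' : GL (Fin 3) K) : Matrix (Fin 3) (Fin 3) K) - 1) ^ 2)).restrictScalars 𝒪[K]) ≤ scaleLattice (ϖ ^ (2 * d₀ - 1)) w.1 ∧ ¬ (∃ y ∈ w.1, ∃ a : K, Valued.v a = 1 ∧ Valued.v ((ϖ ^ (d₀ - 1))⁻¹ * pairing σ ((StdForm.antidiagonal 3).over K) y ((((γ' : GL (Fin 3) K) : Matrix (Fin 3) (Fin 3) K) - 1) *ᵥ y) - (c₁) * a ^ 2) < 1))}).ncard = NM) (j : Fin 5) :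
    ({M : Submodule 𝒪[K] (Fin 3 → K) | IsSelfDualLattice σ ϖ ((StdForm.antidiagonal 3).over K) M ∧ mapGL (γ : GL (Fin 3) K) M = M ∧
        (![¬ M.map ((Matrix.toLin' (((γ : GL (Fin 3) K) : Matrix (Fin 3) (Fin 3) K) - 1)).restrictScalars 𝒪[K]) ≤ scaleLattice ϖ M,
                  M.map ((Matrix.toLin' (((γ : GL (Fin 3) K) : Matrix (Fin 3) (Fin 3) K) - 1)).restrictScalars 𝒪[K]) ≤ scaleLattice ϖ M ∧
                    ¬ M.map ((Matrix.toLin' (((γ : GL (Fin 3) K) : Matrix (Fin 3) (Fin 3) K) - 1)).restrictScalars 𝒪[K]) ≤ scaleLattice (ϖ ^ 2) M ∧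
                    ¬ M.map ((Matrix.toLin' ((((γ : GL (Fin 3) K) : Matrix (Fin 3) (Fin 3) K) - 1) ^ 2)).restrictScalars 𝒪[K]) ≤ scaleLattice (ϖ ^ 3) M,
                  M.map ((Matrix.toLin' (((γ : GL (Fin 3) K) : Matrix (Fin 3) (Fin 3) K) - 1)).restrictScalars 𝒪[K]) ≤ scaleLattice ϖ M ∧
                    ¬ M.map ((Matrix.toLin' (((γ : GL (Fin 3) K) : Matrix (Fin 3) (Fin 3) K) - 1)).restrictScalars 𝒪[K]) ≤ scaleLattice (ϖ ^ 2) M ∧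
                    M.map ((Matrix.toLin' ((((γ : GL (Fin 3) K) : Matrix (Fin 3) (Fin 3) K) - 1) ^ 2)).restrictScalars 𝒪[K]) ≤ scaleLattice (ϖ ^ 3) M ∧
                    ∃ y ∈ M, ∃ a : K, Valued.v a = 1 ∧
                      Valued.v (ϖ⁻¹ * pairing σ (((StdForm.antidiagonal 3).over K)) y
                        ((((γ : GL (Fin 3) K) : Matrix (Fin 3) (Fin 3) K) - 1) *ᵥ y) - c₁ * a ^ 2) < 1,
                  M.map ((Matrix.toLin' (((γ : GL (Fin 3) K) : Matrix (Fin 3) (Fin 3) K) - 1)).restrictScalars 𝒪[K]) ≤ scaleLattice ϖ M ∧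
                    ¬ M.map ((Matrix.toLin' (((γ : GL (Fin 3) K) : Matrix (Fin 3) (Fin 3) K) - 1)).restrictScalars 𝒪[K]) ≤ scaleLattice (ϖ ^ 2) M ∧
                    M.map ((Matrix.toLin' ((((γ : GL (Fin 3) K) : Matrix (Fin 3) (Fin 3) K) - 1) ^ 2)).restrictScalars 𝒪[K]) ≤ scaleLattice (ϖ ^ 3) M ∧
                    ∃ y ∈ M, ∃ a : K, Valued.v a = 1 ∧
                      Valued.v (ϖ⁻¹ * pairing σ (((StdForm.antidiagonal 3).over K)) y
                        ((((γ : GL (Fin 3) K) : Matrix (Fin 3) (Fin 3) K) - 1) *ᵥ y) - c₁ * ε * a ^ 2) < 1,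
                  M.map ((Matrix.toLin' (((γ : GL (Fin 3) K) : Matrix (Fin 3) (Fin 3) K) - 1)).restrictScalars 𝒪[K]) ≤ scaleLattice (ϖ ^ 2) M] : Fin 5 → Prop) j}.ncard) =
      (if IsSquare (-1 : 𝓀[K]) then
          ((1 : ℕ) • (![0, 0, 0, 0, 1] : Fin 5 → ℕ) + NE • (if mA = 0 then (![1, 0, 0, 0, 0] : Fin 5 → ℕ) else (![q ^ (3 * (mA - 1) + 3), q ^ (3 * (mA - 1) + 2), q.choose 2 * q ^ (2 * (mA - 1)) * ∑ i ∈ Finset.range (mA - 1), q ^ i, q.choose 2 * q ^ (2 * (mA - 1)) * ∑ i ∈ Finset.range (mA - 1), q ^ i,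
          ∑ i ∈ Finset.range (mA - 1 + 1), q ^ (2 * i) + ∑ i ∈ Finset.range (mA - 1), q ^ (2 * (mA - 1) + 1 + i)] : Fin 5 → ℕ)) + NO • (![q ^ (3 * mA + 1), q ^ (3 * mA), q.choose 2 * q ^ (2 * mA - 2) * ∑ i ∈ Finset.range mA, q ^ i, q.choose 2 * q ^ (2 * mA - 2) * ∑ i ∈ Finset.range mA, q ^ i,
          ∑ i ∈ Finset.range mA, q ^ (2 * i) + ∑ i ∈ Finset.range mA, q ^ (2 * mA - 1 + i)] : Fin 5 → ℕ) + NP • (![0, 0, q ^ (2 * mA), 0, ∑ i ∈ Finset.range mA, q ^ (2 * i)] : Fin 5 → ℕ) + NM • (![0, 0, 0, q ^ (2 * mA), ∑ i ∈ Finset.range mA, q ^ (2 * i)] : Fin 5 → ℕ)) j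
        else
          ((1 : ℕ) • (![0, 0, 0, 0, 1] : Fin 5 → ℕ) + NE • (if mA = 0 then (![1, 0, 0, 0, 0] : Fin 5 → ℕ) else (![q ^ (3 * (mA - 1) + 3), q ^ (3 * (mA - 1) + 2), q.choose 2 * q ^ (2 * (mA - 1)) * ∑ i ∈ Finset.range (mA - 1), q ^ i, q.choose 2 * q ^ (2 * (mA - 1)) * ∑ i ∈ Finset.range (mA - 1), q ^ i,
          ∑ i ∈ Finset.range (mA - 1 + 1), q ^ (2 * i) + ∑ i ∈ Finset.range (mA - 1), q ^ (2 * (mA - 1) + 1 + i)] : Fin 5 → ℕ)) + NO • (![q ^ (3 * mA + 1), q ^ (3 * mA), q.choose 2 * q ^ (2 * mA - 2) * ∑ i ∈ Finset.range mA, q ^ i, q.choose 2 * q ^ (2 * mA - 2) * ∑ i ∈ Finset.range mA, q ^ i,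
          ∑ i ∈ Finset.range mA, q ^ (2 * i) + ∑ i ∈ Finset.range mA, q ^ (2 * mA - 1 + i)] : Fin 5 → ℕ) + NP • (![0, 0, if Even mA then q ^ (2 * mA) else 0, if Even mA then 0 else q ^ (2 * mA), ∑ i ∈ Finset.range mA, q ^ (2 * i)] : Fin 5 → ℕ) + NM • (![0, 0, if Even mA then 0 else q ^ (2 * mA), if Even mA then q ^ (2 * mA) else 0, ∑ i ∈ Finset.range mA, q ^ (2 * i)] : Fin 5 → ℕ)) j) := by
  have hϖ0 : ϖ ≠ 0 := fun h0 => by rw [h0, map_zero] at hϖ; exact WithZero.coe_ne_zero hϖ.symm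
  have hϖlt : Valued.v ϖ < 1 := by rw [hϖ, ← WithZero.exp_zero]; exact WithZero.exp_lt_exp.2 (by norm_num)
  have hd0 : d₀ ≠ 0 := by rw [hmA]; omega
  have hlt : Valued.v ϖ ^ d₀ < 1 := pow_lt_one₀ zero_le hϖlt hd0
  have hη0 : η ≠ 0 := fun h => by rw [h, map_zero] at hη; exact zero_ne_one hη
  obtain ⟨hPi1, hPi2⟩ := (mapGL_stdLattice_eq_iff P).1 hP0
  -- `|u₀₀| = 1` from `|u₀₀ − 1| ≤ |ϖ|² < 1`; `s = u₀₀⁻¹` is `2`-deep and norm-one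
  have hvu : Valued.v ((u : Matrix (Fin 1) (Fin 1) K) 0 0) = 1 := by
    have hlt1 : Valued.v ((u : Matrix (Fin 1) (Fin 1) K) 0 0 - 1) < 1 := hu2.trans_lt (pow_lt_one₀ zero_le hϖlt two_ne_zero)
    have h := Valued.v.map_one_add_of_lt hlt1
    rwa [add_sub_cancel] at h
  obtain ⟨hsv, hsv1⟩ := v_eq_one_and_v_sub_one_le_of_mul_eq_one (ϖ := ϖ) hvu hu2 hs
  have hu : σ ((u : Matrix (Fin 1) (Fin 1) K) 0 0) * (u : Matrix (Fin 1) (Fin 1) K) 0 0 = 1 := by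
    have hU : P * endoGL (γ₁, u) * P⁻¹ ∈ unitaryGroupOfForm σ ((StdForm.antidiagonal 3).over K) := hγ ▸ γ.2
    rw [conj_mem_unitaryGroupOfForm_iff, hP, ← endoForm_diagonal_oneByOne_eq, endoGL_mem_iff] at hU
    exact norm_eq_one_of_oneByOne_mem_unitaryGroupOfForm hη0 hU.2
  have hsσ : σ (s : K) * (s : K) = 1 := norm_eq_one_of_mul_eq_one_of_norm_eq_one hu hs
  -- the centred block `s·γ₁`: depth `d₀` about `1`, integral, unitary, rootless, same discriminant depth
  have hBm : ∀ i j, Valued.v ((((Matrix.GeneralLinearGroup.scalar (Fin 2) s * γ₁ : GL (Fin 2) K) : Matrix (Fin 2) (Fin 2) K) - 1) i j) ≤ Valued.v ϖ ^ d₀ := by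
    rw [coe_scalar_mul_two_eq_smul]
    exact v_smul_sub_one_apply_le_of_mul_eq_one hs hsv.le hγd
  have hBint : IsIntMatrix ((Matrix.GeneralLinearGroup.scalar (Fin 2) s * γ₁ : GL (Fin 2) K) : Matrix (Fin 2) (Fin 2) K) :=
    isIntMatrix_of_forall_v_sub_one_le_of_lt_one hlt hBm
  have hBinv : IsIntMatrix (((Matrix.GeneralLinearGroup.scalar (Fin 2) s * γ₁)⁻¹ : GL (Fin 2) K) : Matrix (Fin 2) (Fin 2) K) :=
    isIntMatrix_coe_inv_of_forall_v_sub_one_le_of_lt_one hlt hBm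
  have hBU : Matrix.GeneralLinearGroup.scalar (Fin 2) s * γ₁ ∈ unitaryGroupOfForm σ (Matrix.diagonal d) := scalar_mul_mem_unitaryGroupOfForm hγU s hsσ
  have hBirr : ∀ x : K, ¬ ((Matrix.GeneralLinearGroup.scalar (Fin 2) s * γ₁ : GL (Fin 2) K) : Matrix (Fin 2) (Fin 2) K).charpoly.IsRoot x := by
    rw [coe_scalar_mul_two_eq_smul]
    exact forall_not_isRoot_charpoly_smul s.ne_zero hirr
  have hBdisc : Valued.v ϖ ^ (2 * d₀) ≤ Valued.v (((Matrix.GeneralLinearGroup.scalar (Fin 2) s * γ₁ : GL (Fin 2) K) : Matrix (Fin 2) (Fin 2) K).trace ^ 2 -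
      4 * ((Matrix.GeneralLinearGroup.scalar (Fin 2) s * γ₁ : GL (Fin 2) K) : Matrix (Fin 2) (Fin 2) K).det) := by
    rw [coe_scalar_mul_two_eq_smul, v_trace_sq_sub_four_mul_det_smul hsv]
    exact hdisc
  have hu1 : Valued.v (((1 : GL (Fin 1) K) : Matrix (Fin 1) (Fin 1) K) 0 0) ≤ 1 := by
    rw [Units.val_one, Matrix.one_apply_eq, map_one]
  -- `γ′ ∈ K₀`, `hchar ∕ hroot` at `γ′`
  have hγ0 : γ' ∈ unitaryInt σ ((StdForm.antidiagonal 3).over K) := by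
    rw [mem_unitaryInt_iff]
    change IsIntMatrix ((γ' : GL (Fin 3) K) : Matrix (Fin 3) (Fin 3) K) ∧ IsIntMatrix (((γ' : GL (Fin 3) K)⁻¹ : GL (Fin 3) K) : Matrix (Fin 3) (Fin 3) K)
    rw [hγ']
    exact ⟨isIntMatrix_coe_conj_endoGL hPi1 hPi2 hBint isIntMatrix_coe_one,
      isIntMatrix_coe_conj_endoGL_inv hPi1 hPi2 hBinv (by rw [inv_one]; exact isIntMatrix_coe_one)⟩
  have hchar : (((γ' : GL (Fin 3) K) : Matrix (Fin 3) (Fin 3) K)).charpoly =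
      (X - C (1 : K)) * ((Matrix.GeneralLinearGroup.scalar (Fin 2) s * γ₁ : GL (Fin 2) K) : Matrix (Fin 2) (Fin 2) K).charpoly := by
    rw [hγ']; exact charpoly_coe_conj_endoGL_one P _
  have hroot : (stdLattice K 3).map ((Matrix.toLin' (((γ' : GL (Fin 3) K) : Matrix (Fin 3) (Fin 3) K) - 1)).restrictScalars 𝒪[K]) ≤ scaleLattice (ϖ ^ d₀) (stdLattice K 3) := by
    rw [hγ']
    exact map_sub_one_stdLattice_le_scaleLattice_of_conj_endoGL_one (pow_ne_zero _ hϖ0) hPi1 hPi2 (fun i j => by rw [map_pow]; exact hBm i j)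
  have key := strataCount_J₀_of_charpoly_block_even_singleton_of_anisotropic_frame hσ hvσ hσϖ hϖ hres h2 hnorm hγ0 1 _ hchar (UnitaryLatticeTree.v_one_sub_one_le _) hBm hroot
    mA hmA c₁ ε hc₁ hεv hε q hq hsq P hP hP0 hd hdσ hanis₀ hanis₁ hησ hη (Matrix.GeneralLinearGroup.scalar (Fin 2) s * γ₁) 1 hγ' hBint hu1 hBU hBirr hBdisc
    NE NO NP NM hNE hNO hNP hNM j
  -- back to `γ`: `↑γ′ = s • ↑γ`
  have hTT : ((γ' : GL (Fin 3) K) : Matrix (Fin 3) (Fin 3) K) = (s : K) • ((γ : GL (Fin 3) K) : Matrix (Fin 3) (Fin 3) K) := by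
    rw [hγ, hγ']; exact coe_conj_endoGL_centred_eq_smul P γ₁ u s hs
  rw [ncard_strata_eq_of_coe_eq_smul hvσ hϖ ((StdForm.antidiagonal 3).over K) hsv hsv1 (γ : GL (Fin 3) K) (γ' : GL (Fin 3) K) hTT c₁ (c₁ * ε) j] at key
  exact key


/-! ## §3 (ED. 2) Over ★ p849100 — EVERY REGIME: the discriminant hypothesis replaced by one entry of `γ₁ − u₀₀·1` of size `≥ |ϖ|^{d₀}` -/

set_option maxHeartbeats 1600000 in
-- budget only: statement-heavy lattice tokens (verbatim the ★ head's budget).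
/-- **ODD ROOT DEPTH, EVERY REGIME — the five strata counts of `γ = P·ι(γ₁, u)·P⁻¹` from the block-law binders, `hγd` + `hA′` (the true depth `d₀` of `γ₁ − u₀₀·1`, attained) and the
root's collar census AT `γ′`.**  ★ `strataCount_J₀_of_charpoly_block_raw_singleton_of_anisotropic_frame_of_entry` (F0P3a-p08 (g20), ED. 2) applied to the centred element
`γ′ = P·ι(s·γ₁, 1)·P⁻¹`; `hA′` moves to the centred block by ★ `exists_le_v_smul_sub_one_smul_one_apply_of_mul_eq_one`; everything else as in §2.
[cite: Kottwitz1986, §3] [cite: Rogawski1990, §4.8 Case (a) p. 53; §4.9 pp. 54–56] [cite: BruhatTits1972, §10] -/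
theorem strataCount_J₀_of_charpoly_block_raw_singleton_of_anisotropic_frame_of_entry_centred [ValuativeRel K] [(Valued.v : Valuation K ℤᵐ⁰).Compatible] [IsPrincipalIdealRing 𝒪[K]]
    (hσ : ∀ x, σ (σ x) = x) (hvσ : ∀ a, Valued.v (σ a) = Valued.v a) (hσϖ : σ ϖ = -ϖ)
    (hϖ : Valued.v ϖ = WithZero.exp (-1 : ℤ)) (hres : ∀ x : K, Valued.v x ≤ 1 → Valued.v (σ x - x) < 1) (h2 : Valued.v (2 : K) = 1)
    (hnorm : ∀ u : K, σ u = u → Valued.v (u - 1) < 1 → ∃ z : K, z * σ z = u ∧ Valued.v (z - 1) ≤ Valued.v (u - 1)) [Fintype 𝓀[K]] [DecidableEq 𝓀[K]]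
    {d₀ : ℕ}
    (mA : ℕ) (hmA : d₀ = 2 * mA + 3)
    (c₁ ε : K) (hc₁ : Valued.v c₁ = 1) (hεv : Valued.v ε = 1) (hε : ∀ z : K, Valued.v z ≤ 1 → Valued.v (z ^ 2 - ε) = 1)
    (q : ℕ) (hq : q = Fintype.card 𝓀[K])
    (hsq : ∀ t : K, Valued.v (t - 1) < 1 → IsSquare t)
    {d : Fin 2 → K} {η : K} (P : GL (Fin 3) K)
    (hP : formCongr σ P ((StdForm.antidiagonal 3).over K) =
      !![(Matrix.diagonal d) 0 0, 0, (Matrix.diagonal d) 0 1; 0, η, 0; (Matrix.diagonal d) 1 0, 0, (Matrix.diagonal d) 1 1])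
    (hP0 : mapGL P (stdLattice K 3) = stdLattice K 3)
    (hd : ∀ i, Valued.v (d i) = 1) (hdσ : ∀ i, σ (d i) = d i)
    (hanis₀ : ∀ c : K, Valued.v c ≤ 1 → Valued.v (d 0 + d 1 * (σ c * c)) = 1)
    (hanis₁ : ∀ c : K, Valued.v c ≤ 1 → Valued.v (d 0 * (σ c * c) + d 1) = 1)
    (hησ : σ η = η) (hη : Valued.v η = 1)
    (γ₁ : GL (Fin 2) K) (u : GL (Fin 1) K) (hu2 : Valued.v ((u : Matrix (Fin 1) (Fin 1) K) 0 0 - 1) ≤ Valued.v ϖ ^ 2)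
    (s : Kˣ) (hs : (s : K) * (u : Matrix (Fin 1) (Fin 1) K) 0 0 = 1)
    {γ γ' : unitaryGroupOfForm σ ((StdForm.antidiagonal 3).over K)} (hγ : (γ : GL (Fin 3) K) = P * endoGL (γ₁, u) * P⁻¹)
    (hγ' : (γ' : GL (Fin 3) K) = P * endoGL (Matrix.GeneralLinearGroup.scalar (Fin 2) s * γ₁, (1 : GL (Fin 1) K)) * P⁻¹)
    (hγU : γ₁ ∈ unitaryGroupOfForm σ (Matrix.diagonal d))
    (hirr : ∀ x : K, ¬ (γ₁ : Matrix (Fin 2) (Fin 2) K).charpoly.IsRoot x)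
    (hA' : ∃ i j, Valued.v ϖ ^ d₀ ≤ Valued.v (((γ₁ : Matrix (Fin 2) (Fin 2) K) - (u : Matrix (Fin 1) (Fin 1) K) 0 0 • (1 : Matrix (Fin 2) (Fin 2) K)) i j))
    (hγd : ∀ i j, Valued.v (((γ₁ : Matrix (Fin 2) (Fin 2) K) - ((u : Matrix (Fin 1) (Fin 1) K) 0 0) • (1 : Matrix (Fin 2) (Fin 2) K)) i j) ≤ Valued.v ϖ ^ d₀)
    (NE NP NM : ℕ)
    (hNE : ({w | w ∈ {w | ∃ c, ((latticeGraph σ ϖ ((StdForm.antidiagonal 3).over K)).Adj (⟨stdLattice K 3, 0, isSelfDualLattice_stdLattice_three_of_v hϖ⟩ : {M : Submodule 𝒪[K] (Fin 3 → K) // IsVertex σ ϖ ((StdForm.antidiagonal 3).over K) M}) c ∧ (latticeGraph σ ϖ ((StdForm.antidiagonal 3).over K)).dist ⟨stdLattice K 3, 0, isSelfDualLattice_stdLattice_three_of_v hϖ⟩ c = (latticeGraph σ ϖ ((StdForm.antidiagonal 3).over K)).dist ⟨stdLattice K 3, 0, isSelfDualLattice_stdLattice_three_of_v hϖ⟩ (⟨stdLattice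 K 3, 0, isSelfDualLattice_stdLattice_three_of_v hϖ⟩ : {M : Submodule 𝒪[K] (Fin 3 → K) // IsVertex σ ϖ ((StdForm.antidiagonal 3).over K) M}) + 1 ∧ latticeGraphIso σ ϖ ((StdForm.antidiagonal 3).over K) γ' c = c) ∧ ((latticeGraph σ ϖ ((StdForm.antidiagonal 3).over K)).Adj c w ∧ (latticeGraph σ ϖ ((StdForm.antidiagonal 3).over K)).dist ⟨stdLattice K 3, 0, isSelfDualLattice_stdLattice_three_of_v hϖ⟩ w = (latticeGraph σ ϖ ((StdForm.antidiagonal 3).over K)).dist ⟨stdLattice K 3, 0, isSelfDualLattice_stdLattice_three_of_v hϖ⟩ c + 1 ∧ latticeGraphIso σ ϖ ((StdForm.antidiagonal 3).over K) γ' w = w)} ∧ (¬ w.1.map ((Matrix.toLin' (((γ' : GL (Fin 3) K) : Matrix (Fin 3) (Fin 3) K) - 1)).restrictScalars 𝒪[K]) ≤ scaleLattice (ϖ ^ d₀) w.1 ∧ (w.1.map ((Matrix.toLin' (((γ' : GL (Fin 3) K) : Matrix (Fin 3) (Fin 3) K) - 1)).restrictScalars 𝒪[K]) ≤ scaleLattice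 (ϖ ^ (d₀ - 1)) w.1 ∧ ¬ w.1.map ((Matrix.toLin' (((γ' : GL (Fin 3) K) : Matrix (Fin 3) (Fin 3) K) - 1)).restrictScalars 𝒪[K]) ≤ scaleLattice (ϖ ^ d₀) w.1))}).ncard = NE)
    (hNP : ({w | w ∈ {w | ∃ c, ((latticeGraph σ ϖ ((StdForm.antidiagonal 3).over K)).Adj (⟨stdLattice K 3, 0, isSelfDualLattice_stdLattice_three_of_v hϖ⟩ : {M : Submodule 𝒪[K] (Fin 3 → K) // IsVertex σ ϖ ((StdForm.antidiagonal 3).over K) M}) c ∧ (latticeGraph σ ϖ ((StdForm.antidiagonal 3).over K)).dist ⟨stdLattice K 3, 0, isSelfDualLattice_stdLattice_three_of_v hϖ⟩ c = (latticeGraph σ ϖ ((StdForm.antidiagonal 3).over K)).dist ⟨stdLattice K 3, 0, isSelfDualLattice_stdLattice_three_of_v hϖ⟩ (⟨stdLattice K 3, 0, isSelfDualLattice_stdLattice_three_of_v hϖ⟩ : {M : Submodule 𝒪[K] (Fin 3 → K) // IsVertex σ ϖ ((StdForm.antidiagonal 3).over K) M}) + 1 ∧ latticeGraphIso σ ϖ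 ((StdForm.antidiagonal 3).over K) γ' c = c) ∧ ((latticeGraph σ ϖ ((StdForm.antidiagonal 3).over K)).Adj c w ∧ (latticeGraph σ ϖ ((StdForm.antidiagonal 3).over K)).dist ⟨stdLattice K 3, 0, isSelfDualLattice_stdLattice_three_of_v hϖ⟩ w = (latticeGraph σ ϖ ((StdForm.antidiagonal 3).over K)).dist ⟨stdLattice K 3, 0, isSelfDualLattice_stdLattice_three_of_v hϖ⟩ c + 1 ∧ latticeGraphIso σ ϖ ((StdForm.antidiagonal 3).over K) γ' w = w)} ∧ (¬ w.1.map ((Matrix.toLin' (((γ' : GL (Fin 3) K) : Matrix (Fin 3) (Fin 3) K) - 1)).restrictScalars 𝒪[K]) ≤ scaleLattice (ϖ ^ d₀) w.1 ∧ (w.1.map ((Matrix.toLin' (((γ' : GL (Fin 3) K) : Matrix (Fin 3) (Fin 3) K) - 1)).restrictScalars 𝒪[K]) ≤ scaleLattice (ϖ ^ (d₀ - 2)) w.1 ∧ ¬ w.1.map ((Matrix.toLin' (((γ' : GL (Fin 3) K) : Matrix (Fin 3) (Fin 3) K) - 1)).restrictScalars 𝒪[K]) ≤ scaleLattice (ϖ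 ^ (d₀ - 1)) w.1) ∧ ∃ y ∈ w.1, ∃ a : K, Valued.v a = 1 ∧ Valued.v ((ϖ ^ (d₀ - 2))⁻¹ * pairing σ ((StdForm.antidiagonal 3).over K) y ((((γ' : GL (Fin 3) K) : Matrix (Fin 3) (Fin 3) K) - 1) *ᵥ y) - (c₁) * a ^ 2) < 1)}).ncard = NP)
    (hNM : ({w | w ∈ {w | ∃ c, ((latticeGraph σ ϖ ((StdForm.antidiagonal 3).over K)).Adj (⟨stdLattice K 3, 0, isSelfDualLattice_stdLattice_three_of_v hϖ⟩ : {M : Submodule 𝒪[K] (Fin 3 → K) // IsVertex σ ϖ ((StdForm.antidiagonal 3).over K) M}) c ∧ (latticeGraph σ ϖ ((StdForm.antidiagonal 3).over K)).dist ⟨stdLattice K 3, 0, isSelfDualLattice_stdLattice_three_of_v hϖ⟩ c = (latticeGraph σ ϖ ((StdForm.antidiagonal 3).over K)).dist ⟨stdLattice K 3, 0, isSelfDualLattice_stdLattice_three_of_v hϖ⟩ (⟨stdLattice K 3, 0, isSelfDualLattice_stdLattice_three_of_v hϖ⟩ : {M : Submodule 𝒪[K] (Fin 3 → K) // IsVertex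 σ ϖ ((StdForm.antidiagonal 3).over K) M}) + 1 ∧ latticeGraphIso σ ϖ ((StdForm.antidiagonal 3).over K) γ' c = c) ∧ ((latticeGraph σ ϖ ((StdForm.antidiagonal 3).over K)).Adj c w ∧ (latticeGraph σ ϖ ((StdForm.antidiagonal 3).over K)).dist ⟨stdLattice K 3, 0, isSelfDualLattice_stdLattice_three_of_v hϖ⟩ w = (latticeGraph σ ϖ ((StdForm.antidiagonal 3).over K)).dist ⟨stdLattice K 3, 0, isSelfDualLattice_stdLattice_three_of_v hϖ⟩ c + 1 ∧ latticeGraphIso σ ϖ ((StdForm.antidiagonal 3).over K) γ' w = w)} ∧ (¬ w.1.map ((Matrix.toLin' (((γ' : GL (Fin 3) K) : Matrix (Fin 3) (Fin 3) K) - 1)).restrictScalars 𝒪[K]) ≤ scaleLattice (ϖ ^ d₀) w.1 ∧ (w.1.map ((Matrix.toLin' (((γ' : GL (Fin 3) K) : Matrix (Fin 3) (Fin 3) K) - 1)).restrictScalars 𝒪[K]) ≤ scaleLattice (ϖ ^ (d₀ - 2)) w.1 ∧ ¬ w.1.map ((Matrix.toLin' (((γ' : GL (Fin 3) K) : Matrix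 (Fin 3) (Fin 3) K) - 1)).restrictScalars 𝒪[K]) ≤ scaleLattice (ϖ ^ (d₀ - 1)) w.1) ∧ ¬ (∃ y ∈ w.1, ∃ a : K, Valued.v a = 1 ∧ Valued.v ((ϖ ^ (d₀ - 2))⁻¹ * pairing σ ((StdForm.antidiagonal 3).over K) y ((((γ' : GL (Fin 3) K) : Matrix (Fin 3) (Fin 3) K) - 1) *ᵥ y) - (c₁) * a ^ 2) < 1))}).ncard = NM) (j : Fin 5) :
    ({M : Submodule 𝒪[K] (Fin 3 → K) | IsSelfDualLattice σ ϖ ((StdForm.antidiagonal 3).over K) M ∧ mapGL (γ : GL (Fin 3) K) M = M ∧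
        (![¬ M.map ((Matrix.toLin' (((γ : GL (Fin 3) K) : Matrix (Fin 3) (Fin 3) K) - 1)).restrictScalars 𝒪[K]) ≤ scaleLattice ϖ M,
                  M.map ((Matrix.toLin' (((γ : GL (Fin 3) K) : Matrix (Fin 3) (Fin 3) K) - 1)).restrictScalars 𝒪[K]) ≤ scaleLattice ϖ M ∧
                    ¬ M.map ((Matrix.toLin' (((γ : GL (Fin 3) K) : Matrix (Fin 3) (Fin 3) K) - 1)).restrictScalars 𝒪[K]) ≤ scaleLattice (ϖ ^ 2) M ∧
                    ¬ M.map ((Matrix.toLin' ((((γ : GL (Fin 3) K) : Matrix (Fin 3) (Fin 3) K) - 1) ^ 2)).restrictScalars 𝒪[K]) ≤ scaleLattice (ϖ ^ 3) M,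
                  M.map ((Matrix.toLin' (((γ : GL (Fin 3) K) : Matrix (Fin 3) (Fin 3) K) - 1)).restrictScalars 𝒪[K]) ≤ scaleLattice ϖ M ∧
                    ¬ M.map ((Matrix.toLin' (((γ : GL (Fin 3) K) : Matrix (Fin 3) (Fin 3) K) - 1)).restrictScalars 𝒪[K]) ≤ scaleLattice (ϖ ^ 2) M ∧
                    M.map ((Matrix.toLin' ((((γ : GL (Fin 3) K) : Matrix (Fin 3) (Fin 3) K) - 1) ^ 2)).restrictScalars 𝒪[K]) ≤ scaleLattice (ϖ ^ 3) M ∧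
                    ∃ y ∈ M, ∃ a : K, Valued.v a = 1 ∧
                      Valued.v (ϖ⁻¹ * pairing σ (((StdForm.antidiagonal 3).over K)) y
                        ((((γ : GL (Fin 3) K) : Matrix (Fin 3) (Fin 3) K) - 1) *ᵥ y) - c₁ * a ^ 2) < 1,
                  M.map ((Matrix.toLin' (((γ : GL (Fin 3) K) : Matrix (Fin 3) (Fin 3) K) - 1)).restrictScalars 𝒪[K]) ≤ scaleLattice ϖ M ∧
                    ¬ M.map ((Matrix.toLin' (((γ : GL (Fin 3) K) : Matrix (Fin 3) (Fin 3) K) - 1)).restrictScalars 𝒪[K]) ≤ scaleLattice (ϖ ^ 2) M ∧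
                    M.map ((Matrix.toLin' ((((γ : GL (Fin 3) K) : Matrix (Fin 3) (Fin 3) K) - 1) ^ 2)).restrictScalars 𝒪[K]) ≤ scaleLattice (ϖ ^ 3) M ∧
                    ∃ y ∈ M, ∃ a : K, Valued.v a = 1 ∧
                      Valued.v (ϖ⁻¹ * pairing σ (((StdForm.antidiagonal 3).over K)) y
                        ((((γ : GL (Fin 3) K) : Matrix (Fin 3) (Fin 3) K) - 1) *ᵥ y) - c₁ * ε * a ^ 2) < 1,
                  M.map ((Matrix.toLin' (((γ : GL (Fin 3) K) : Matrix (Fin 3) (Fin 3) K) - 1)).restrictScalars 𝒪[K]) ≤ scaleLattice (ϖ ^ 2) M] : Fin 5 → Prop) j}.ncard) =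
      (if IsSquare (-1 : 𝓀[K]) then
          ((1 : ℕ) • (![0, 0, 0, 0, 1] : Fin 5 → ℕ) + NE • (![q ^ (3 * mA + 3), q ^ (3 * mA + 2), q.choose 2 * q ^ (2 * mA) * ∑ i ∈ Finset.range mA, q ^ i, q.choose 2 * q ^ (2 * mA) * ∑ i ∈ Finset.range mA, q ^ i,
          ∑ i ∈ Finset.range (mA + 1), q ^ (2 * i) + ∑ i ∈ Finset.range mA, q ^ (2 * mA + 1 + i)] : Fin 5 → ℕ) + NP • (![0, 0, q ^ (2 * mA), 0, ∑ i ∈ Finset.range mA, q ^ (2 * i)] : Fin 5 → ℕ) + NM • (![0, 0, 0, q ^ (2 * mA), ∑ i ∈ Finset.range mA, q ^ (2 * i)] : Fin 5 → ℕ)) j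
        else
          ((1 : ℕ) • (![0, 0, 0, 0, 1] : Fin 5 → ℕ) + NE • (![q ^ (3 * mA + 3), q ^ (3 * mA + 2), q.choose 2 * q ^ (2 * mA) * ∑ i ∈ Finset.range mA, q ^ i, q.choose 2 * q ^ (2 * mA) * ∑ i ∈ Finset.range mA, q ^ i,
          ∑ i ∈ Finset.range (mA + 1), q ^ (2 * i) + ∑ i ∈ Finset.range mA, q ^ (2 * mA + 1 + i)] : Fin 5 → ℕ) + NP • (![0, 0, if Even mA then q ^ (2 * mA) else 0, if Even mA then 0 else q ^ (2 * mA), ∑ i ∈ Finset.range mA, q ^ (2 * i)] : Fin 5 → ℕ) + NM • (![0, 0, if Even mA then 0 else q ^ (2 * mA), if Even mA then q ^ (2 * mA) else 0, ∑ i ∈ Finset.range mA, q ^ (2 * i)] : Fin 5 → ℕ)) j) := by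
  have hϖ0 : ϖ ≠ 0 := fun h0 => by rw [h0, map_zero] at hϖ; exact WithZero.coe_ne_zero hϖ.symm
  have hϖlt : Valued.v ϖ < 1 := by rw [hϖ, ← WithZero.exp_zero]; exact WithZero.exp_lt_exp.2 (by norm_num)
  have hd0 : d₀ ≠ 0 := by rw [hmA]; omega
  have hlt : Valued.v ϖ ^ d₀ < 1 := pow_lt_one₀ zero_le hϖlt hd0
  have hη0 : η ≠ 0 := fun h => by rw [h, map_zero] at hη; exact zero_ne_one hη
  obtain ⟨hPi1, hPi2⟩ := (mapGL_stdLattice_eq_iff P).1 hP0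
  have hvu : Valued.v ((u : Matrix (Fin 1) (Fin 1) K) 0 0) = 1 := by
    have hlt1 : Valued.v ((u : Matrix (Fin 1) (Fin 1) K) 0 0 - 1) < 1 := hu2.trans_lt (pow_lt_one₀ zero_le hϖlt two_ne_zero)
    have h := Valued.v.map_one_add_of_lt hlt1
    rwa [add_sub_cancel] at h
  obtain ⟨hsv, hsv1⟩ := v_eq_one_and_v_sub_one_le_of_mul_eq_one (ϖ := ϖ) hvu hu2 hs
  have hu : σ ((u : Matrix (Fin 1) (Fin 1) K) 0 0) * (u : Matrix (Fin 1) (Fin 1) K) 0 0 = 1 := by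
    have hU : P * endoGL (γ₁, u) * P⁻¹ ∈ unitaryGroupOfForm σ ((StdForm.antidiagonal 3).over K) := hγ ▸ γ.2
    rw [conj_mem_unitaryGroupOfForm_iff, hP, ← endoForm_diagonal_oneByOne_eq, endoGL_mem_iff] at hU
    exact norm_eq_one_of_oneByOne_mem_unitaryGroupOfForm hη0 hU.2
  have hsσ : σ (s : K) * (s : K) = 1 := norm_eq_one_of_mul_eq_one_of_norm_eq_one hu hs
  have hBm : ∀ i j, Valued.v ((((Matrix.GeneralLinearGroup.scalar (Fin 2) s * γ₁ : GL (Fin 2) K) : Matrix (Fin 2) (Fin 2) K) - 1) i j) ≤ Valued.v ϖ ^ d₀ := by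
    rw [coe_scalar_mul_two_eq_smul]
    exact v_smul_sub_one_apply_le_of_mul_eq_one hs hsv.le hγd
  have hBint : IsIntMatrix ((Matrix.GeneralLinearGroup.scalar (Fin 2) s * γ₁ : GL (Fin 2) K) : Matrix (Fin 2) (Fin 2) K) :=
    isIntMatrix_of_forall_v_sub_one_le_of_lt_one hlt hBm
  have hBinv : IsIntMatrix (((Matrix.GeneralLinearGroup.scalar (Fin 2) s * γ₁)⁻¹ : GL (Fin 2) K) : Matrix (Fin 2) (Fin 2) K) :=
    isIntMatrix_coe_inv_of_forall_v_sub_one_le_of_lt_one hlt hBm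
  have hBU : Matrix.GeneralLinearGroup.scalar (Fin 2) s * γ₁ ∈ unitaryGroupOfForm σ (Matrix.diagonal d) := scalar_mul_mem_unitaryGroupOfForm hγU s hsσ
  have hBirr : ∀ x : K, ¬ ((Matrix.GeneralLinearGroup.scalar (Fin 2) s * γ₁ : GL (Fin 2) K) : Matrix (Fin 2) (Fin 2) K).charpoly.IsRoot x := by
    rw [coe_scalar_mul_two_eq_smul]
    exact forall_not_isRoot_charpoly_smul s.ne_zero hirr
  have hBA : ∃ i j, Valued.v ϖ ^ d₀ ≤ Valued.v ((((Matrix.GeneralLinearGroup.scalar (Fin 2) s * γ₁ : GL (Fin 2) K) : Matrix (Fin 2) (Fin 2) K) -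
      ((1 : GL (Fin 1) K) : Matrix (Fin 1) (Fin 1) K) 0 0 • (1 : Matrix (Fin 2) (Fin 2) K)) i j) := by
    rw [coe_scalar_mul_two_eq_smul, Units.val_one, Matrix.one_apply_eq]
    exact exists_le_v_smul_sub_one_smul_one_apply_of_mul_eq_one hs hsv hA'
  have hu1 : Valued.v (((1 : GL (Fin 1) K) : Matrix (Fin 1) (Fin 1) K) 0 0) ≤ 1 := by
    rw [Units.val_one, Matrix.one_apply_eq, map_one]
  have hγ0 : γ' ∈ unitaryInt σ ((StdForm.antidiagonal 3).over K) := by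
    rw [mem_unitaryInt_iff]
    change IsIntMatrix ((γ' : GL (Fin 3) K) : Matrix (Fin 3) (Fin 3) K) ∧ IsIntMatrix (((γ' : GL (Fin 3) K)⁻¹ : GL (Fin 3) K) : Matrix (Fin 3) (Fin 3) K)
    rw [hγ']
    exact ⟨isIntMatrix_coe_conj_endoGL hPi1 hPi2 hBint isIntMatrix_coe_one,
      isIntMatrix_coe_conj_endoGL_inv hPi1 hPi2 hBinv (by rw [inv_one]; exact isIntMatrix_coe_one)⟩
  have hchar : (((γ' : GL (Fin 3) K) : Matrix (Fin 3) (Fin 3) K)).charpoly =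
      (X - C (1 : K)) * ((Matrix.GeneralLinearGroup.scalar (Fin 2) s * γ₁ : GL (Fin 2) K) : Matrix (Fin 2) (Fin 2) K).charpoly := by
    rw [hγ']; exact charpoly_coe_conj_endoGL_one P _
  have hroot : (stdLattice K 3).map ((Matrix.toLin' (((γ' : GL (Fin 3) K) : Matrix (Fin 3) (Fin 3) K) - 1)).restrictScalars 𝒪[K]) ≤ scaleLattice (ϖ ^ d₀) (stdLattice K 3) := by
    rw [hγ']
    exact map_sub_one_stdLattice_le_scaleLattice_of_conj_endoGL_one (pow_ne_zero _ hϖ0) hPi1 hPi2 (fun i j => by rw [map_pow]; exact hBm i j)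
  have key := strataCount_J₀_of_charpoly_block_raw_singleton_of_anisotropic_frame_of_entry hσ hvσ hσϖ hϖ hres h2 hnorm hγ0 1 _ hchar (UnitaryLatticeTree.v_one_sub_one_le _) hBm hroot
    mA hmA c₁ ε hc₁ hεv hε q hq hsq P hP hP0 hd hdσ hanis₀ hanis₁ hησ hη (Matrix.GeneralLinearGroup.scalar (Fin 2) s * γ₁) 1 hγ' hBint hu1 hBU hBirr hBA
    NE NP NM hNE hNP hNM j
  have hTT : ((γ' : GL (Fin 3) K) : Matrix (Fin 3) (Fin 3) K) = (s : K) • ((γ : GL (Fin 3) K) : Matrix (Fin 3) (Fin 3) K) := by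
    rw [hγ, hγ']; exact coe_conj_endoGL_centred_eq_smul P γ₁ u s hs
  rw [ncard_strata_eq_of_coe_eq_smul hvσ hϖ ((StdForm.antidiagonal 3).over K) hsv hsv1 (γ : GL (Fin 3) K) (γ' : GL (Fin 3) K) hTT c₁ (c₁ * ε) j] at key
  exact key


set_option maxHeartbeats 1600000 in
-- budget only: statement-heavy lattice tokens (verbatim the ★ head's budget).
/-- **EVEN ROOT DEPTH, EVERY REGIME — the same over ★ `strataCount_J₀_of_charpoly_block_even_singleton_of_anisotropic_frame_of_entry`** (census `(NE, NO, NP, NM)` AT `γ′`).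
[cite: Kottwitz1986, §3] [cite: Rogawski1990, §4.8 Case (a) p. 53; §4.9 pp. 54–56] [cite: BruhatTits1972, §10] -/
theorem strataCount_J₀_of_charpoly_block_even_singleton_of_anisotropic_frame_of_entry_centred [ValuativeRel K] [(Valued.v : Valuation K ℤᵐ⁰).Compatible] [IsPrincipalIdealRing 𝒪[K]]
    (hσ : ∀ x, σ (σ x) = x) (hvσ : ∀ a, Valued.v (σ a) = Valued.v a) (hσϖ : σ ϖ = -ϖ)
    (hϖ : Valued.v ϖ = WithZero.exp (-1 : ℤ)) (hres : ∀ x : K, Valued.v x ≤ 1 → Valued.v (σ x - x) < 1) (h2 : Valued.v (2 : K) = 1)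
    (hnorm : ∀ u : K, σ u = u → Valued.v (u - 1) < 1 → ∃ z : K, z * σ z = u ∧ Valued.v (z - 1) ≤ Valued.v (u - 1)) [Fintype 𝓀[K]] [DecidableEq 𝓀[K]]
    {d₀ : ℕ}
    (mA : ℕ) (hmA : d₀ = 2 * mA + 2)
    (c₁ ε : K) (hc₁ : Valued.v c₁ = 1) (hεv : Valued.v ε = 1) (hε : ∀ z : K, Valued.v z ≤ 1 → Valued.v (z ^ 2 - ε) = 1)
    (q : ℕ) (hq : q = Fintype.card 𝓀[K])
    (hsq : ∀ t : K, Valued.v (t - 1) < 1 → IsSquare t)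
    {d : Fin 2 → K} {η : K} (P : GL (Fin 3) K)
    (hP : formCongr σ P ((StdForm.antidiagonal 3).over K) =
      !![(Matrix.diagonal d) 0 0, 0, (Matrix.diagonal d) 0 1; 0, η, 0; (Matrix.diagonal d) 1 0, 0, (Matrix.diagonal d) 1 1])
    (hP0 : mapGL P (stdLattice K 3) = stdLattice K 3)
    (hd : ∀ i, Valued.v (d i) = 1) (hdσ : ∀ i, σ (d i) = d i)
    (hanis₀ : ∀ c : K, Valued.v c ≤ 1 → Valued.v (d 0 + d 1 * (σ c * c)) = 1)
    (hanis₁ : ∀ c : K, Valued.v c ≤ 1 → Valued.v (d 0 * (σ c * c) + d 1) = 1)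
    (hησ : σ η = η) (hη : Valued.v η = 1)
    (γ₁ : GL (Fin 2) K) (u : GL (Fin 1) K) (hu2 : Valued.v ((u : Matrix (Fin 1) (Fin 1) K) 0 0 - 1) ≤ Valued.v ϖ ^ 2)
    (s : Kˣ) (hs : (s : K) * (u : Matrix (Fin 1) (Fin 1) K) 0 0 = 1)
    {γ γ' : unitaryGroupOfForm σ ((StdForm.antidiagonal 3).over K)} (hγ : (γ : GL (Fin 3) K) = P * endoGL (γ₁, u) * P⁻¹)
    (hγ' : (γ' : GL (Fin 3) K) = P * endoGL (Matrix.GeneralLinearGroup.scalar (Fin 2) s * γ₁, (1 : GL (Fin 1) K)) * P⁻¹)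
    (hγU : γ₁ ∈ unitaryGroupOfForm σ (Matrix.diagonal d))
    (hirr : ∀ x : K, ¬ (γ₁ : Matrix (Fin 2) (Fin 2) K).charpoly.IsRoot x)
    (hA' : ∃ i j, Valued.v ϖ ^ d₀ ≤ Valued.v (((γ₁ : Matrix (Fin 2) (Fin 2) K) - (u : Matrix (Fin 1) (Fin 1) K) 0 0 • (1 : Matrix (Fin 2) (Fin 2) K)) i j))
    (hγd : ∀ i j, Valued.v (((γ₁ : Matrix (Fin 2) (Fin 2) K) - ((u : Matrix (Fin 1) (Fin 1) K) 0 0) • (1 : Matrix (Fin 2) (Fin 2) K)) i j) ≤ Valued.v ϖ ^ d₀)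
    (NE NO NP NM : ℕ)
    (hNE : ({w | w ∈ {w | ∃ c, ((latticeGraph σ ϖ ((StdForm.antidiagonal 3).over K)).Adj (⟨stdLattice K 3, 0, isSelfDualLattice_stdLattice_three_of_v hϖ⟩ : {M : Submodule 𝒪[K] (Fin 3 → K) // IsVertex σ ϖ ((StdForm.antidiagonal 3).over K) M}) c ∧ (latticeGraph σ ϖ ((StdForm.antidiagonal 3).over K)).dist ⟨stdLattice K 3, 0, isSelfDualLattice_stdLattice_three_of_v hϖ⟩ c = (latticeGraph σ ϖ ((StdForm.antidiagonal 3).over K)).dist ⟨stdLattice K 3, 0, isSelfDualLattice_stdLattice_three_of_v hϖ⟩ (⟨stdLattice K 3, 0, isSelfDualLattice_stdLattice_three_of_v hϖ⟩ : {M : Submodule 𝒪[K] (Fin 3 → K) // IsVertex σ ϖ ((StdForm.antidiagonal 3).over K) M}) + 1 ∧ latticeGraphIso σ ϖ ((StdForm.antidiagonal 3).over K) γ' c = c) ∧ ((latticeGraph σ ϖ ((StdForm.antidiagonal 3).over K)).Adj c w ∧ (latticeGraph σ ϖ ((StdForm.antidiagonal 3).over K)).dist ⟨stdLattice K 3, 0,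 isSelfDualLattice_stdLattice_three_of_v hϖ⟩ w = (latticeGraph σ ϖ ((StdForm.antidiagonal 3).over K)).dist ⟨stdLattice K 3, 0, isSelfDualLattice_stdLattice_three_of_v hϖ⟩ c + 1 ∧ latticeGraphIso σ ϖ ((StdForm.antidiagonal 3).over K) γ' w = w)} ∧ (¬ w.1.map ((Matrix.toLin' (((γ' : GL (Fin 3) K) : Matrix (Fin 3) (Fin 3) K) - 1)).restrictScalars 𝒪[K]) ≤ scaleLattice (ϖ ^ d₀) w.1 ∧ (w.1.map ((Matrix.toLin' (((γ' : GL (Fin 3) K) : Matrix (Fin 3) (Fin 3) K) - 1)).restrictScalars 𝒪[K]) ≤ scaleLattice (ϖ ^ (d₀ - 2)) w.1 ∧ ¬ w.1.map ((Matrix.toLin' (((γ' : GL (Fin 3) K) : Matrix (Fin 3) (Fin 3) K) - 1)).restrictScalars 𝒪[K]) ≤ scaleLattice (ϖ ^ (d₀ - 1)) w.1))}).ncard = NE)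
    (hNO : ({w | w ∈ {w | ∃ c, ((latticeGraph σ ϖ ((StdForm.antidiagonal 3).over K)).Adj (⟨stdLattice K 3, 0, isSelfDualLattice_stdLattice_three_of_v hϖ⟩ : {M : Submodule 𝒪[K] (Fin 3 → K) // IsVertex σ ϖ ((StdForm.antidiagonal 3).over K) M}) c ∧ (latticeGraph σ ϖ ((StdForm.antidiagonal 3).over K)).dist ⟨stdLattice K 3, 0, isSelfDualLattice_stdLattice_three_of_v hϖ⟩ c = (latticeGraph σ ϖ ((StdForm.antidiagonal 3).over K)).dist ⟨stdLattice K 3, 0, isSelfDualLattice_stdLattice_three_of_v hϖ⟩ (⟨stdLattice K 3, 0, isSelfDualLattice_stdLattice_three_of_v hϖ⟩ : {M : Submodule 𝒪[K] (Fin 3 → K) // IsVertex σ ϖ ((StdForm.antidiagonal 3).over K) M}) + 1 ∧ latticeGraphIso σ ϖ ((StdForm.antidiagonal 3).over K) γ' c = c) ∧ ((latticeGraph σ ϖ ((StdForm.antidiagonal 3).over K)).Adj c w ∧ (latticeGraph σ ϖ ((StdForm.antidiagonal 3).over K)).dist ⟨stdLattice K 3, 0, isSelfDualLattice_stdLattice_three_of_v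 hϖ⟩ w = (latticeGraph σ ϖ ((StdForm.antidiagonal 3).over K)).dist ⟨stdLattice K 3, 0, isSelfDualLattice_stdLattice_three_of_v hϖ⟩ c + 1 ∧ latticeGraphIso σ ϖ ((StdForm.antidiagonal 3).over K) γ' w = w)} ∧ (¬ w.1.map ((Matrix.toLin' (((γ' : GL (Fin 3) K) : Matrix (Fin 3) (Fin 3) K) - 1)).restrictScalars 𝒪[K]) ≤ scaleLattice (ϖ ^ d₀) w.1 ∧ (w.1.map ((Matrix.toLin' (((γ' : GL (Fin 3) K) : Matrix (Fin 3) (Fin 3) K) - 1)).restrictScalars 𝒪[K]) ≤ scaleLattice (ϖ ^ (d₀ - 1)) w.1 ∧ ¬ w.1.map ((Matrix.toLin' (((γ' : GL (Fin 3) K) : Matrix (Fin 3) (Fin 3) K) - 1)).restrictScalars 𝒪[K]) ≤ scaleLattice (ϖ ^ d₀) w.1) ∧ ¬ w.1.map ((Matrix.toLin' ((((γ' : GL (Fin 3) K) : Matrix (Fin 3) (Fin 3) K) - 1) ^ 2)).restrictScalars 𝒪[K]) ≤ scaleLattice (ϖ ^ (2 * d₀ - 1)) w.1)}).ncard = NO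)
    (hNP : ({w | w ∈ {w | ∃ c, ((latticeGraph σ ϖ ((StdForm.antidiagonal 3).over K)).Adj (⟨stdLattice K 3, 0, isSelfDualLattice_stdLattice_three_of_v hϖ⟩ : {M : Submodule 𝒪[K] (Fin 3 → K) // IsVertex σ ϖ ((StdForm.antidiagonal 3).over K) M}) c ∧ (latticeGraph σ ϖ ((StdForm.antidiagonal 3).over K)).dist ⟨stdLattice K 3, 0, isSelfDualLattice_stdLattice_three_of_v hϖ⟩ c = (latticeGraph σ ϖ ((StdForm.antidiagonal 3).over K)).dist ⟨stdLattice K 3, 0, isSelfDualLattice_stdLattice_three_of_v hϖ⟩ (⟨stdLattice K 3, 0, isSelfDualLattice_stdLattice_three_of_v hϖ⟩ : {M : Submodule 𝒪[K] (Fin 3 → K) // IsVertex σ ϖ ((StdForm.antidiagonal 3).over K) M}) + 1 ∧ latticeGraphIso σ ϖ ((StdForm.antidiagonal 3).over K) γ' c = c) ∧ ((latticeGraph σ ϖ ((StdForm.antidiagonal 3).over K)).Adj c w ∧ (latticeGraph σ ϖ ((StdForm.antidiagonal 3).over K)).dist ⟨stdLattice K 3, 0, isSelfDualLattice_stdLattice_three_of_v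 hϖ⟩ w = (latticeGraph σ ϖ ((StdForm.antidiagonal 3).over K)).dist ⟨stdLattice K 3, 0, isSelfDualLattice_stdLattice_three_of_v hϖ⟩ c + 1 ∧ latticeGraphIso σ ϖ ((StdForm.antidiagonal 3).over K) γ' w = w)} ∧ (¬ w.1.map ((Matrix.toLin' (((γ' : GL (Fin 3) K) : Matrix (Fin 3) (Fin 3) K) - 1)).restrictScalars 𝒪[K]) ≤ scaleLattice (ϖ ^ d₀) w.1 ∧ (w.1.map ((Matrix.toLin' (((γ' : GL (Fin 3) K) : Matrix (Fin 3) (Fin 3) K) - 1)).restrictScalars 𝒪[K]) ≤ scaleLattice (ϖ ^ (d₀ - 1)) w.1 ∧ ¬ w.1.map ((Matrix.toLin' (((γ' : GL (Fin 3) K) : Matrix (Fin 3) (Fin 3) K) - 1)).restrictScalars 𝒪[K]) ≤ scaleLattice (ϖ ^ d₀) w.1) ∧ w.1.map ((Matrix.toLin' ((((γ' : GL (Fin 3) K) : Matrix (Fin 3) (Fin 3) K) - 1) ^ 2)).restrictScalars 𝒪[K]) ≤ scaleLattice (ϖ ^ (2 * d₀ - 1)) w.1 ∧ ∃ y ∈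 w.1, ∃ a : K, Valued.v a = 1 ∧ Valued.v ((ϖ ^ (d₀ - 1))⁻¹ * pairing σ ((StdForm.antidiagonal 3).over K) y ((((γ' : GL (Fin 3) K) : Matrix (Fin 3) (Fin 3) K) - 1) *ᵥ y) - (c₁) * a ^ 2) < 1)}).ncard = NP)
    (hNM : ({w | w ∈ {w | ∃ c, ((latticeGraph σ ϖ ((StdForm.antidiagonal 3).over K)).Adj (⟨stdLattice K 3, 0, isSelfDualLattice_stdLattice_three_of_v hϖ⟩ : {M : Submodule 𝒪[K] (Fin 3 → K) // IsVertex σ ϖ ((StdForm.antidiagonal 3).over K) M}) c ∧ (latticeGraph σ ϖ ((StdForm.antidiagonal 3).over K)).dist ⟨stdLattice K 3, 0, isSelfDualLattice_stdLattice_three_of_v hϖ⟩ c = (latticeGraph σ ϖ ((StdForm.antidiagonal 3).over K)).dist ⟨stdLattice K 3, 0, isSelfDualLattice_stdLattice_three_of_v hϖ⟩ (⟨stdLattice K 3, 0, isSelfDualLattice_stdLattice_three_of_v hϖ⟩ : {M : Submodule 𝒪[K] (Fin 3 → K) // IsVertex σ ϖ ((StdForm.antidiagonal 3).over K) M}) +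 1 ∧ latticeGraphIso σ ϖ ((StdForm.antidiagonal 3).over K) γ' c = c) ∧ ((latticeGraph σ ϖ ((StdForm.antidiagonal 3).over K)).Adj c w ∧ (latticeGraph σ ϖ ((StdForm.antidiagonal 3).over K)).dist ⟨stdLattice K 3, 0, isSelfDualLattice_stdLattice_three_of_v hϖ⟩ w = (latticeGraph σ ϖ ((StdForm.antidiagonal 3).over K)).dist ⟨stdLattice K 3, 0, isSelfDualLattice_stdLattice_three_of_v hϖ⟩ c + 1 ∧ latticeGraphIso σ ϖ ((StdForm.antidiagonal 3).over K) γ' w = w)} ∧ (¬ w.1.map ((Matrix.toLin' (((γ' : GL (Fin 3) K) : Matrix (Fin 3) (Fin 3) K) - 1)).restrictScalars 𝒪[K]) ≤ scaleLattice (ϖ ^ d₀) w.1 ∧ (w.1.map ((Matrix.toLin' (((γ' : GL (Fin 3) K) : Matrix (Fin 3) (Fin 3) K) - 1)).restrictScalars 𝒪[K]) ≤ scaleLattice (ϖ ^ (d₀ - 1)) w.1 ∧ ¬ w.1.map ((Matrix.toLin' (((γ' : GL (Fin 3) K) : Matrix (Fin 3) (Fin 3) K) - 1)).restrictScalars 𝒪[K])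 ≤ scaleLattice (ϖ ^ d₀) w.1) ∧ w.1.map ((Matrix.toLin' ((((γ' : GL (Fin 3) K) : Matrix (Fin 3) (Fin 3) K) - 1) ^ 2)).restrictScalars 𝒪[K]) ≤ scaleLattice (ϖ ^ (2 * d₀ - 1)) w.1 ∧ ¬ (∃ y ∈ w.1, ∃ a : K, Valued.v a = 1 ∧ Valued.v ((ϖ ^ (d₀ - 1))⁻¹ * pairing σ ((StdForm.antidiagonal 3).over K) y ((((γ' : GL (Fin 3) K) : Matrix (Fin 3) (Fin 3) K) - 1) *ᵥ y) - (c₁) * a ^ 2) < 1))}).ncard = NM) (j : Fin 5) :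
    ({M : Submodule 𝒪[K] (Fin 3 → K) | IsSelfDualLattice σ ϖ ((StdForm.antidiagonal 3).over K) M ∧ mapGL (γ : GL (Fin 3) K) M = M ∧
        (![¬ M.map ((Matrix.toLin' (((γ : GL (Fin 3) K) : Matrix (Fin 3) (Fin 3) K) - 1)).restrictScalars 𝒪[K]) ≤ scaleLattice ϖ M,
                  M.map ((Matrix.toLin' (((γ : GL (Fin 3) K) : Matrix (Fin 3) (Fin 3) K) - 1)).restrictScalars 𝒪[K]) ≤ scaleLattice ϖ M ∧
                    ¬ M.map ((Matrix.toLin' (((γ : GL (Fin 3) K) : Matrix (Fin 3) (Fin 3) K) - 1)).restrictScalars 𝒪[K]) ≤ scaleLattice (ϖ ^ 2) M ∧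
                    ¬ M.map ((Matrix.toLin' ((((γ : GL (Fin 3) K) : Matrix (Fin 3) (Fin 3) K) - 1) ^ 2)).restrictScalars 𝒪[K]) ≤ scaleLattice (ϖ ^ 3) M,
                  M.map ((Matrix.toLin' (((γ : GL (Fin 3) K) : Matrix (Fin 3) (Fin 3) K) - 1)).restrictScalars 𝒪[K]) ≤ scaleLattice ϖ M ∧
                    ¬ M.map ((Matrix.toLin' (((γ : GL (Fin 3) K) : Matrix (Fin 3) (Fin 3) K) - 1)).restrictScalars 𝒪[K]) ≤ scaleLattice (ϖ ^ 2) M ∧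
                    M.map ((Matrix.toLin' ((((γ : GL (Fin 3) K) : Matrix (Fin 3) (Fin 3) K) - 1) ^ 2)).restrictScalars 𝒪[K]) ≤ scaleLattice (ϖ ^ 3) M ∧
                    ∃ y ∈ M, ∃ a : K, Valued.v a = 1 ∧
                      Valued.v (ϖ⁻¹ * pairing σ (((StdForm.antidiagonal 3).over K)) y
                        ((((γ : GL (Fin 3) K) : Matrix (Fin 3) (Fin 3) K) - 1) *ᵥ y) - c₁ * a ^ 2) < 1,
                  M.map ((Matrix.toLin' (((γ : GL (Fin 3) K) : Matrix (Fin 3) (Fin 3) K) - 1)).restrictScalars 𝒪[K]) ≤ scaleLattice ϖ M ∧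
                    ¬ M.map ((Matrix.toLin' (((γ : GL (Fin 3) K) : Matrix (Fin 3) (Fin 3) K) - 1)).restrictScalars 𝒪[K]) ≤ scaleLattice (ϖ ^ 2) M ∧
                    M.map ((Matrix.toLin' ((((γ : GL (Fin 3) K) : Matrix (Fin 3) (Fin 3) K) - 1) ^ 2)).restrictScalars 𝒪[K]) ≤ scaleLattice (ϖ ^ 3) M ∧
                    ∃ y ∈ M, ∃ a : K, Valued.v a = 1 ∧
                      Valued.v (ϖ⁻¹ * pairing σ (((StdForm.antidiagonal 3).over K)) y
                        ((((γ : GL (Fin 3) K) : Matrix (Fin 3) (Fin 3) K) - 1) *ᵥ y) - c₁ * ε * a ^ 2) < 1,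
                  M.map ((Matrix.toLin' (((γ : GL (Fin 3) K) : Matrix (Fin 3) (Fin 3) K) - 1)).restrictScalars 𝒪[K]) ≤ scaleLattice (ϖ ^ 2) M] : Fin 5 → Prop) j}.ncard) =
      (if IsSquare (-1 : 𝓀[K]) then
          ((1 : ℕ) • (![0, 0, 0, 0, 1] : Fin 5 → ℕ) + NE • (if mA = 0 then (![1, 0, 0, 0, 0] : Fin 5 → ℕ) else (![q ^ (3 * (mA - 1) + 3), q ^ (3 * (mA - 1) + 2), q.choose 2 * q ^ (2 * (mA - 1)) * ∑ i ∈ Finset.range (mA - 1), q ^ i, q.choose 2 * q ^ (2 * (mA - 1)) * ∑ i ∈ Finset.range (mA - 1), q ^ i,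
          ∑ i ∈ Finset.range (mA - 1 + 1), q ^ (2 * i) + ∑ i ∈ Finset.range (mA - 1), q ^ (2 * (mA - 1) + 1 + i)] : Fin 5 → ℕ)) + NO • (![q ^ (3 * mA + 1), q ^ (3 * mA), q.choose 2 * q ^ (2 * mA - 2) * ∑ i ∈ Finset.range mA, q ^ i, q.choose 2 * q ^ (2 * mA - 2) * ∑ i ∈ Finset.range mA, q ^ i,
          ∑ i ∈ Finset.range mA, q ^ (2 * i) + ∑ i ∈ Finset.range mA, q ^ (2 * mA - 1 + i)] : Fin 5 → ℕ) + NP • (![0, 0, q ^ (2 * mA), 0, ∑ i ∈ Finset.range mA, q ^ (2 * i)] : Fin 5 → ℕ) + NM • (![0, 0, 0, q ^ (2 * mA), ∑ i ∈ Finset.range mA, q ^ (2 * i)] : Fin 5 → ℕ)) j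
        else
          ((1 : ℕ) • (![0, 0, 0, 0, 1] : Fin 5 → ℕ) + NE • (if mA = 0 then (![1, 0, 0, 0, 0] : Fin 5 → ℕ) else (![q ^ (3 * (mA - 1) + 3), q ^ (3 * (mA - 1) + 2), q.choose 2 * q ^ (2 * (mA - 1)) * ∑ i ∈ Finset.range (mA - 1), q ^ i, q.choose 2 * q ^ (2 * (mA - 1)) * ∑ i ∈ Finset.range (mA - 1), q ^ i,
          ∑ i ∈ Finset.range (mA - 1 + 1), q ^ (2 * i) + ∑ i ∈ Finset.range (mA - 1), q ^ (2 * (mA - 1) + 1 + i)] : Fin 5 → ℕ)) + NO • (![q ^ (3 * mA + 1), q ^ (3 * mA), q.choose 2 * q ^ (2 * mA - 2) * ∑ i ∈ Finset.range mA, q ^ i, q.choose 2 * q ^ (2 * mA - 2) * ∑ i ∈ Finset.range mA, q ^ i,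
          ∑ i ∈ Finset.range mA, q ^ (2 * i) + ∑ i ∈ Finset.range mA, q ^ (2 * mA - 1 + i)] : Fin 5 → ℕ) + NP • (![0, 0, if Even mA then q ^ (2 * mA) else 0, if Even mA then 0 else q ^ (2 * mA), ∑ i ∈ Finset.range mA, q ^ (2 * i)] : Fin 5 → ℕ) + NM • (![0, 0, if Even mA then 0 else q ^ (2 * mA), if Even mA then q ^ (2 * mA) else 0, ∑ i ∈ Finset.range mA, q ^ (2 * i)] : Fin 5 → ℕ)) j) := by
  have hϖ0 : ϖ ≠ 0 := fun h0 => by rw [h0, map_zero] at hϖ; exact WithZero.coe_ne_zero hϖ.symm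
  have hϖlt : Valued.v ϖ < 1 := by rw [hϖ, ← WithZero.exp_zero]; exact WithZero.exp_lt_exp.2 (by norm_num)
  have hd0 : d₀ ≠ 0 := by rw [hmA]; omega
  have hlt : Valued.v ϖ ^ d₀ < 1 := pow_lt_one₀ zero_le hϖlt hd0
  have hη0 : η ≠ 0 := fun h => by rw [h, map_zero] at hη; exact zero_ne_one hη
  obtain ⟨hPi1, hPi2⟩ := (mapGL_stdLattice_eq_iff P).1 hP0
  have hvu : Valued.v ((u : Matrix (Fin 1) (Fin 1) K) 0 0) = 1 := by
    have hlt1 : Valued.v ((u : Matrix (Fin 1) (Fin 1) K) 0 0 - 1) < 1 := hu2.trans_lt (pow_lt_one₀ zero_le hϖlt two_ne_zero)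
    have h := Valued.v.map_one_add_of_lt hlt1
    rwa [add_sub_cancel] at h
  obtain ⟨hsv, hsv1⟩ := v_eq_one_and_v_sub_one_le_of_mul_eq_one (ϖ := ϖ) hvu hu2 hs
  have hu : σ ((u : Matrix (Fin 1) (Fin 1) K) 0 0) * (u : Matrix (Fin 1) (Fin 1) K) 0 0 = 1 := by
    have hU : P * endoGL (γ₁, u) * P⁻¹ ∈ unitaryGroupOfForm σ ((StdForm.antidiagonal 3).over K) := hγ ▸ γ.2
    rw [conj_mem_unitaryGroupOfForm_iff, hP, ← endoForm_diagonal_oneByOne_eq, endoGL_mem_iff] at hU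
    exact norm_eq_one_of_oneByOne_mem_unitaryGroupOfForm hη0 hU.2
  have hsσ : σ (s : K) * (s : K) = 1 := norm_eq_one_of_mul_eq_one_of_norm_eq_one hu hs
  have hBm : ∀ i j, Valued.v ((((Matrix.GeneralLinearGroup.scalar (Fin 2) s * γ₁ : GL (Fin 2) K) : Matrix (Fin 2) (Fin 2) K) - 1) i j) ≤ Valued.v ϖ ^ d₀ := by
    rw [coe_scalar_mul_two_eq_smul]
    exact v_smul_sub_one_apply_le_of_mul_eq_one hs hsv.le hγd
  have hBint : IsIntMatrix ((Matrix.GeneralLinearGroup.scalar (Fin 2) s * γ₁ : GL (Fin 2) K) : Matrix (Fin 2) (Fin 2) K) :=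
    isIntMatrix_of_forall_v_sub_one_le_of_lt_one hlt hBm
  have hBinv : IsIntMatrix (((Matrix.GeneralLinearGroup.scalar (Fin 2) s * γ₁)⁻¹ : GL (Fin 2) K) : Matrix (Fin 2) (Fin 2) K) :=
    isIntMatrix_coe_inv_of_forall_v_sub_one_le_of_lt_one hlt hBm
  have hBU : Matrix.GeneralLinearGroup.scalar (Fin 2) s * γ₁ ∈ unitaryGroupOfForm σ (Matrix.diagonal d) := scalar_mul_mem_unitaryGroupOfForm hγU s hsσ
  have hBirr : ∀ x : K, ¬ ((Matrix.GeneralLinearGroup.scalar (Fin 2) s * γ₁ : GL (Fin 2) K) : Matrix (Fin 2) (Fin 2) K).charpoly.IsRoot x := by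
    rw [coe_scalar_mul_two_eq_smul]
    exact forall_not_isRoot_charpoly_smul s.ne_zero hirr
  have hBA : ∃ i j, Valued.v ϖ ^ d₀ ≤ Valued.v ((((Matrix.GeneralLinearGroup.scalar (Fin 2) s * γ₁ : GL (Fin 2) K) : Matrix (Fin 2) (Fin 2) K) -
      ((1 : GL (Fin 1) K) : Matrix (Fin 1) (Fin 1) K) 0 0 • (1 : Matrix (Fin 2) (Fin 2) K)) i j) := by
    rw [coe_scalar_mul_two_eq_smul, Units.val_one, Matrix.one_apply_eq]
    exact exists_le_v_smul_sub_one_smul_one_apply_of_mul_eq_one hs hsv hA'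
  have hu1 : Valued.v (((1 : GL (Fin 1) K) : Matrix (Fin 1) (Fin 1) K) 0 0) ≤ 1 := by
    rw [Units.val_one, Matrix.one_apply_eq, map_one]
  have hγ0 : γ' ∈ unitaryInt σ ((StdForm.antidiagonal 3).over K) := by
    rw [mem_unitaryInt_iff]
    change IsIntMatrix ((γ' : GL (Fin 3) K) : Matrix (Fin 3) (Fin 3) K) ∧ IsIntMatrix (((γ' : GL (Fin 3) K)⁻¹ : GL (Fin 3) K) : Matrix (Fin 3) (Fin 3) K)
    rw [hγ']
    exact ⟨isIntMatrix_coe_conj_endoGL hPi1 hPi2 hBint isIntMatrix_coe_one,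
      isIntMatrix_coe_conj_endoGL_inv hPi1 hPi2 hBinv (by rw [inv_one]; exact isIntMatrix_coe_one)⟩
  have hchar : (((γ' : GL (Fin 3) K) : Matrix (Fin 3) (Fin 3) K)).charpoly =
      (X - C (1 : K)) * ((Matrix.GeneralLinearGroup.scalar (Fin 2) s * γ₁ : GL (Fin 2) K) : Matrix (Fin 2) (Fin 2) K).charpoly := by
    rw [hγ']; exact charpoly_coe_conj_endoGL_one P _
  have hroot : (stdLattice K 3).map ((Matrix.toLin' (((γ' : GL (Fin 3) K) : Matrix (Fin 3) (Fin 3) K) - 1)).restrictScalars 𝒪[K]) ≤ scaleLattice (ϖ ^ d₀) (stdLattice K 3) := by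
    rw [hγ']
    exact map_sub_one_stdLattice_le_scaleLattice_of_conj_endoGL_one (pow_ne_zero _ hϖ0) hPi1 hPi2 (fun i j => by rw [map_pow]; exact hBm i j)
  have key := strataCount_J₀_of_charpoly_block_even_singleton_of_anisotropic_frame_of_entry hσ hvσ hσϖ hϖ hres h2 hnorm hγ0 1 _ hchar (UnitaryLatticeTree.v_one_sub_one_le _) hBm hroot
    mA hmA c₁ ε hc₁ hεv hε q hq hsq P hP hP0 hd hdσ hanis₀ hanis₁ hησ hη (Matrix.GeneralLinearGroup.scalar (Fin 2) s * γ₁) 1 hγ' hBint hu1 hBU hBirr hBA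
    NE NO NP NM hNE hNO hNP hNM j
  have hTT : ((γ' : GL (Fin 3) K) : Matrix (Fin 3) (Fin 3) K) = (s : K) • ((γ : GL (Fin 3) K) : Matrix (Fin 3) (Fin 3) K) := by
    rw [hγ, hγ']; exact coe_conj_endoGL_centred_eq_smul P γ₁ u s hs
  rw [ncard_strata_eq_of_coe_eq_smul hvσ hϖ ((StdForm.antidiagonal 3).over K) hsv hsv1 (γ : GL (Fin 3) K) (γ' : GL (Fin 3) K) hTT c₁ (c₁ * ε) j] at key
  exact key


/-! ## §4 (ED. 2) Keyed on ONE socket datum: `|det(γ₁ − u₀₀·1)| = |ϖ|^{2d₀}` (conformality ★ p849115 gives `hγd`; the ultrametric determinant bound gives `hA′`) -/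

set_option maxHeartbeats 1600000 in
-- budget only: statement-heavy lattice tokens (verbatim the ★ head's budget).
/-- **ODD ROOT DEPTH, DETERMINANT-KEYED — the five strata counts of `γ = P·ι(γ₁, u)·P⁻¹` from the block-law binders, the ONE depth datum
`hdet : |det(γ₁ − u₀₀·1)| = |ϖ|^{2d₀}` (= `|χ_{γ₁}(u₀₀)|`, the J0diff's `hm` clause read at `w`) and the root's collar census AT `γ′`.**  `hγd` by conformality of the
anisotropic block (★ `forall_valued_sub_smul_one_apply_mul_self_le_det`, F0P3a-p08 (g20)) ∘ ★ `forall_v_apply_le_pow_of_mul_self_le_det_of_v_det_eq`; `hA′` by ★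
`exists_pow_le_v_apply_of_v_det_eq`; then §3. [cite: Kottwitz1986, §3] [cite: Rogawski1990, §4.8 Case (a) p. 53; §4.9 pp. 54–56] [cite: BruhatTits1972, §10] -/
theorem strataCount_J₀_of_charpoly_block_raw_singleton_of_anisotropic_frame_of_det_centred [ValuativeRel K] [(Valued.v : Valuation K ℤᵐ⁰).Compatible] [IsPrincipalIdealRing 𝒪[K]]
    (hσ : ∀ x, σ (σ x) = x) (hvσ : ∀ a, Valued.v (σ a) = Valued.v a) (hσϖ : σ ϖ = -ϖ)
    (hϖ : Valued.v ϖ = WithZero.exp (-1 : ℤ)) (hres : ∀ x : K, Valued.v x ≤ 1 → Valued.v (σ x - x) < 1) (h2 : Valued.v (2 : K) = 1)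
    (hnorm : ∀ u : K, σ u = u → Valued.v (u - 1) < 1 → ∃ z : K, z * σ z = u ∧ Valued.v (z - 1) ≤ Valued.v (u - 1)) [Fintype 𝓀[K]] [DecidableEq 𝓀[K]]
    {d₀ : ℕ}
    (mA : ℕ) (hmA : d₀ = 2 * mA + 3)
    (c₁ ε : K) (hc₁ : Valued.v c₁ = 1) (hεv : Valued.v ε = 1) (hε : ∀ z : K, Valued.v z ≤ 1 → Valued.v (z ^ 2 - ε) = 1)
    (q : ℕ) (hq : q = Fintype.card 𝓀[K])
    (hsq : ∀ t : K, Valued.v (t - 1) < 1 → IsSquare t)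
    {d : Fin 2 → K} {η : K} (P : GL (Fin 3) K)
    (hP : formCongr σ P ((StdForm.antidiagonal 3).over K) =
      !![(Matrix.diagonal d) 0 0, 0, (Matrix.diagonal d) 0 1; 0, η, 0; (Matrix.diagonal d) 1 0, 0, (Matrix.diagonal d) 1 1])
    (hP0 : mapGL P (stdLattice K 3) = stdLattice K 3)
    (hd : ∀ i, Valued.v (d i) = 1) (hdσ : ∀ i, σ (d i) = d i)
    (hanis₀ : ∀ c : K, Valued.v c ≤ 1 → Valued.v (d 0 + d 1 * (σ c * c)) = 1)
    (hanis₁ : ∀ c : K, Valued.v c ≤ 1 → Valued.v (d 0 * (σ c * c) + d 1) = 1)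
    (hησ : σ η = η) (hη : Valued.v η = 1)
    (γ₁ : GL (Fin 2) K) (u : GL (Fin 1) K) (hu2 : Valued.v ((u : Matrix (Fin 1) (Fin 1) K) 0 0 - 1) ≤ Valued.v ϖ ^ 2)
    (s : Kˣ) (hs : (s : K) * (u : Matrix (Fin 1) (Fin 1) K) 0 0 = 1)
    {γ γ' : unitaryGroupOfForm σ ((StdForm.antidiagonal 3).over K)} (hγ : (γ : GL (Fin 3) K) = P * endoGL (γ₁, u) * P⁻¹)
    (hγ' : (γ' : GL (Fin 3) K) = P * endoGL (Matrix.GeneralLinearGroup.scalar (Fin 2) s * γ₁, (1 : GL (Fin 1) K)) * P⁻¹)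
    (hγU : γ₁ ∈ unitaryGroupOfForm σ (Matrix.diagonal d))
    (hirr : ∀ x : K, ¬ (γ₁ : Matrix (Fin 2) (Fin 2) K).charpoly.IsRoot x)
    (hdet : Valued.v ((γ₁ : Matrix (Fin 2) (Fin 2) K) - ((u : Matrix (Fin 1) (Fin 1) K) 0 0) • (1 : Matrix (Fin 2) (Fin 2) K)).det = Valued.v ϖ ^ (2 * d₀))
    (NE NP NM : ℕ)
    (hNE : ({w | w ∈ {w | ∃ c, ((latticeGraph σ ϖ ((StdForm.antidiagonal 3).over K)).Adj (⟨stdLattice K 3, 0, isSelfDualLattice_stdLattice_three_of_v hϖ⟩ : {M : Submodule 𝒪[K] (Fin 3 → K) // IsVertex σ ϖ ((StdForm.antidiagonal 3).over K) M}) c ∧ (latticeGraph σ ϖ ((StdForm.antidiagonal 3).over K)).dist ⟨stdLattice K 3, 0, isSelfDualLattice_stdLattice_three_of_v hϖ⟩ c = (latticeGraph σ ϖ ((StdForm.antidiagonal 3).over K)).dist ⟨stdLattice K 3, 0, isSelfDualLattice_stdLattice_three_of_v hϖ⟩ (⟨stdLattice K 3, 0, isSelfDualLattice_stdLattice_three_of_v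 hϖ⟩ : {M : Submodule 𝒪[K] (Fin 3 → K) // IsVertex σ ϖ ((StdForm.antidiagonal 3).over K) M}) + 1 ∧ latticeGraphIso σ ϖ ((StdForm.antidiagonal 3).over K) γ' c = c) ∧ ((latticeGraph σ ϖ ((StdForm.antidiagonal 3).over K)).Adj c w ∧ (latticeGraph σ ϖ ((StdForm.antidiagonal 3).over K)).dist ⟨stdLattice K 3, 0, isSelfDualLattice_stdLattice_three_of_v hϖ⟩ w = (latticeGraph σ ϖ ((StdForm.antidiagonal 3).over K)).dist ⟨stdLattice K 3, 0, isSelfDualLattice_stdLattice_three_of_v hϖ⟩ c + 1 ∧ latticeGraphIso σ ϖ ((StdForm.antidiagonal 3).over K) γ' w = w)} ∧ (¬ w.1.map ((Matrix.toLin' (((γ' : GL (Fin 3) K) : Matrix (Fin 3) (Fin 3) K) - 1)).restrictScalars 𝒪[K]) ≤ scaleLattice (ϖ ^ d₀) w.1 ∧ (w.1.map ((Matrix.toLin' (((γ' : GL (Fin 3) K) : Matrix (Fin 3) (Fin 3) K) - 1)).restrictScalars 𝒪[K]) ≤ scaleLattice (ϖ ^ (d₀ - 1)) w.1 ∧ ¬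 w.1.map ((Matrix.toLin' (((γ' : GL (Fin 3) K) : Matrix (Fin 3) (Fin 3) K) - 1)).restrictScalars 𝒪[K]) ≤ scaleLattice (ϖ ^ d₀) w.1))}).ncard = NE)
    (hNP : ({w | w ∈ {w | ∃ c, ((latticeGraph σ ϖ ((StdForm.antidiagonal 3).over K)).Adj (⟨stdLattice K 3, 0, isSelfDualLattice_stdLattice_three_of_v hϖ⟩ : {M : Submodule 𝒪[K] (Fin 3 → K) // IsVertex σ ϖ ((StdForm.antidiagonal 3).over K) M}) c ∧ (latticeGraph σ ϖ ((StdForm.antidiagonal 3).over K)).dist ⟨stdLattice K 3, 0, isSelfDualLattice_stdLattice_three_of_v hϖ⟩ c = (latticeGraph σ ϖ ((StdForm.antidiagonal 3).over K)).dist ⟨stdLattice K 3, 0, isSelfDualLattice_stdLattice_three_of_v hϖ⟩ (⟨stdLattice K 3, 0, isSelfDualLattice_stdLattice_three_of_v hϖ⟩ : {M : Submodule 𝒪[K] (Fin 3 → K) // IsVertex σ ϖ ((StdForm.antidiagonal 3).over K) M}) + 1 ∧ latticeGraphIso σ ϖ ((StdForm.antidiagonal 3).over K) γ' c = c) ∧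 ((latticeGraph σ ϖ ((StdForm.antidiagonal 3).over K)).Adj c w ∧ (latticeGraph σ ϖ ((StdForm.antidiagonal 3).over K)).dist ⟨stdLattice K 3, 0, isSelfDualLattice_stdLattice_three_of_v hϖ⟩ w = (latticeGraph σ ϖ ((StdForm.antidiagonal 3).over K)).dist ⟨stdLattice K 3, 0, isSelfDualLattice_stdLattice_three_of_v hϖ⟩ c + 1 ∧ latticeGraphIso σ ϖ ((StdForm.antidiagonal 3).over K) γ' w = w)} ∧ (¬ w.1.map ((Matrix.toLin' (((γ' : GL (Fin 3) K) : Matrix (Fin 3) (Fin 3) K) - 1)).restrictScalars 𝒪[K]) ≤ scaleLattice (ϖ ^ d₀) w.1 ∧ (w.1.map ((Matrix.toLin' (((γ' : GL (Fin 3) K) : Matrix (Fin 3) (Fin 3) K) - 1)).restrictScalars 𝒪[K]) ≤ scaleLattice (ϖ ^ (d₀ - 2)) w.1 ∧ ¬ w.1.map ((Matrix.toLin' (((γ' : GL (Fin 3) K) : Matrix (Fin 3) (Fin 3) K) - 1)).restrictScalars 𝒪[K]) ≤ scaleLattice (ϖ ^ (d₀ - 1)) w.1) ∧ ∃ y ∈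 w.1, ∃ a : K, Valued.v a = 1 ∧ Valued.v ((ϖ ^ (d₀ - 2))⁻¹ * pairing σ ((StdForm.antidiagonal 3).over K) y ((((γ' : GL (Fin 3) K) : Matrix (Fin 3) (Fin 3) K) - 1) *ᵥ y) - (c₁) * a ^ 2) < 1)}).ncard = NP)
    (hNM : ({w | w ∈ {w | ∃ c, ((latticeGraph σ ϖ ((StdForm.antidiagonal 3).over K)).Adj (⟨stdLattice K 3, 0, isSelfDualLattice_stdLattice_three_of_v hϖ⟩ : {M : Submodule 𝒪[K] (Fin 3 → K) // IsVertex σ ϖ ((StdForm.antidiagonal 3).over K) M}) c ∧ (latticeGraph σ ϖ ((StdForm.antidiagonal 3).over K)).dist ⟨stdLattice K 3, 0, isSelfDualLattice_stdLattice_three_of_v hϖ⟩ c = (latticeGraph σ ϖ ((StdForm.antidiagonal 3).over K)).dist ⟨stdLattice K 3, 0, isSelfDualLattice_stdLattice_three_of_v hϖ⟩ (⟨stdLattice K 3, 0, isSelfDualLattice_stdLattice_three_of_v hϖ⟩ : {M : Submodule 𝒪[K] (Fin 3 → K) // IsVertex σ ϖ ((StdForm.antidiagonal 3).over K) M}) +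 1 ∧ latticeGraphIso σ ϖ ((StdForm.antidiagonal 3).over K) γ' c = c) ∧ ((latticeGraph σ ϖ ((StdForm.antidiagonal 3).over K)).Adj c w ∧ (latticeGraph σ ϖ ((StdForm.antidiagonal 3).over K)).dist ⟨stdLattice K 3, 0, isSelfDualLattice_stdLattice_three_of_v hϖ⟩ w = (latticeGraph σ ϖ ((StdForm.antidiagonal 3).over K)).dist ⟨stdLattice K 3, 0, isSelfDualLattice_stdLattice_three_of_v hϖ⟩ c + 1 ∧ latticeGraphIso σ ϖ ((StdForm.antidiagonal 3).over K) γ' w = w)} ∧ (¬ w.1.map ((Matrix.toLin' (((γ' : GL (Fin 3) K) : Matrix (Fin 3) (Fin 3) K) - 1)).restrictScalars 𝒪[K]) ≤ scaleLattice (ϖ ^ d₀) w.1 ∧ (w.1.map ((Matrix.toLin' (((γ' : GL (Fin 3) K) : Matrix (Fin 3) (Fin 3) K) - 1)).restrictScalars 𝒪[K]) ≤ scaleLattice (ϖ ^ (d₀ - 2)) w.1 ∧ ¬ w.1.map ((Matrix.toLin' (((γ' : GL (Fin 3) K) : Matrix (Fin 3) (Fin 3) K) - 1)).restrictScalars 𝒪[K])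 ≤ scaleLattice (ϖ ^ (d₀ - 1)) w.1) ∧ ¬ (∃ y ∈ w.1, ∃ a : K, Valued.v a = 1 ∧ Valued.v ((ϖ ^ (d₀ - 2))⁻¹ * pairing σ ((StdForm.antidiagonal 3).over K) y ((((γ' : GL (Fin 3) K) : Matrix (Fin 3) (Fin 3) K) - 1) *ᵥ y) - (c₁) * a ^ 2) < 1))}).ncard = NM) (j : Fin 5) :
    ({M : Submodule 𝒪[K] (Fin 3 → K) | IsSelfDualLattice σ ϖ ((StdForm.antidiagonal 3).over K) M ∧ mapGL (γ : GL (Fin 3) K) M = M ∧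
        (![¬ M.map ((Matrix.toLin' (((γ : GL (Fin 3) K) : Matrix (Fin 3) (Fin 3) K) - 1)).restrictScalars 𝒪[K]) ≤ scaleLattice ϖ M,
                  M.map ((Matrix.toLin' (((γ : GL (Fin 3) K) : Matrix (Fin 3) (Fin 3) K) - 1)).restrictScalars 𝒪[K]) ≤ scaleLattice ϖ M ∧
                    ¬ M.map ((Matrix.toLin' (((γ : GL (Fin 3) K) : Matrix (Fin 3) (Fin 3) K) - 1)).restrictScalars 𝒪[K]) ≤ scaleLattice (ϖ ^ 2) M ∧
                    ¬ M.map ((Matrix.toLin' ((((γ : GL (Fin 3) K) : Matrix (Fin 3) (Fin 3) K) - 1) ^ 2)).restrictScalars 𝒪[K]) ≤ scaleLattice (ϖ ^ 3) M,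
                  M.map ((Matrix.toLin' (((γ : GL (Fin 3) K) : Matrix (Fin 3) (Fin 3) K) - 1)).restrictScalars 𝒪[K]) ≤ scaleLattice ϖ M ∧
                    ¬ M.map ((Matrix.toLin' (((γ : GL (Fin 3) K) : Matrix (Fin 3) (Fin 3) K) - 1)).restrictScalars 𝒪[K]) ≤ scaleLattice (ϖ ^ 2) M ∧
                    M.map ((Matrix.toLin' ((((γ : GL (Fin 3) K) : Matrix (Fin 3) (Fin 3) K) - 1) ^ 2)).restrictScalars 𝒪[K]) ≤ scaleLattice (ϖ ^ 3) M ∧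
                    ∃ y ∈ M, ∃ a : K, Valued.v a = 1 ∧
                      Valued.v (ϖ⁻¹ * pairing σ (((StdForm.antidiagonal 3).over K)) y
                        ((((γ : GL (Fin 3) K) : Matrix (Fin 3) (Fin 3) K) - 1) *ᵥ y) - c₁ * a ^ 2) < 1,
                  M.map ((Matrix.toLin' (((γ : GL (Fin 3) K) : Matrix (Fin 3) (Fin 3) K) - 1)).restrictScalars 𝒪[K]) ≤ scaleLattice ϖ M ∧
                    ¬ M.map ((Matrix.toLin' (((γ : GL (Fin 3) K) : Matrix (Fin 3) (Fin 3) K) - 1)).restrictScalars 𝒪[K]) ≤ scaleLattice (ϖ ^ 2) M ∧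
                    M.map ((Matrix.toLin' ((((γ : GL (Fin 3) K) : Matrix (Fin 3) (Fin 3) K) - 1) ^ 2)).restrictScalars 𝒪[K]) ≤ scaleLattice (ϖ ^ 3) M ∧
                    ∃ y ∈ M, ∃ a : K, Valued.v a = 1 ∧
                      Valued.v (ϖ⁻¹ * pairing σ (((StdForm.antidiagonal 3).over K)) y
                        ((((γ : GL (Fin 3) K) : Matrix (Fin 3) (Fin 3) K) - 1) *ᵥ y) - c₁ * ε * a ^ 2) < 1,
                  M.map ((Matrix.toLin' (((γ : GL (Fin 3) K) : Matrix (Fin 3) (Fin 3) K) - 1)).restrictScalars 𝒪[K]) ≤ scaleLattice (ϖ ^ 2) M] : Fin 5 → Prop) j}.ncard) =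
      (if IsSquare (-1 : 𝓀[K]) then
          ((1 : ℕ) • (![0, 0, 0, 0, 1] : Fin 5 → ℕ) + NE • (![q ^ (3 * mA + 3), q ^ (3 * mA + 2), q.choose 2 * q ^ (2 * mA) * ∑ i ∈ Finset.range mA, q ^ i, q.choose 2 * q ^ (2 * mA) * ∑ i ∈ Finset.range mA, q ^ i,
          ∑ i ∈ Finset.range (mA + 1), q ^ (2 * i) + ∑ i ∈ Finset.range mA, q ^ (2 * mA + 1 + i)] : Fin 5 → ℕ) + NP • (![0, 0, q ^ (2 * mA), 0, ∑ i ∈ Finset.range mA, q ^ (2 * i)] : Fin 5 → ℕ) + NM • (![0, 0, 0, q ^ (2 * mA), ∑ i ∈ Finset.range mA, q ^ (2 * i)] : Fin 5 → ℕ)) j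
        else
          ((1 : ℕ) • (![0, 0, 0, 0, 1] : Fin 5 → ℕ) + NE • (![q ^ (3 * mA + 3), q ^ (3 * mA + 2), q.choose 2 * q ^ (2 * mA) * ∑ i ∈ Finset.range mA, q ^ i, q.choose 2 * q ^ (2 * mA) * ∑ i ∈ Finset.range mA, q ^ i,
          ∑ i ∈ Finset.range (mA + 1), q ^ (2 * i) + ∑ i ∈ Finset.range mA, q ^ (2 * mA + 1 + i)] : Fin 5 → ℕ) + NP • (![0, 0, if Even mA then q ^ (2 * mA) else 0, if Even mA then 0 else q ^ (2 * mA), ∑ i ∈ Finset.range mA, q ^ (2 * i)] : Fin 5 → ℕ) + NM • (![0, 0, if Even mA then 0 else q ^ (2 * mA), if Even mA then q ^ (2 * mA) else 0, ∑ i ∈ Finset.range mA, q ^ (2 * i)] : Fin 5 → ℕ)) j) := by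
  have hconf := forall_valued_sub_smul_one_apply_mul_self_le_det hvσ h2 hsq hd hanis₀ hanis₁ (mem_unitaryGroupOfForm_iff.1 hγU) hirr
    ((u : Matrix (Fin 1) (Fin 1) K) 0 0)
  exact strataCount_J₀_of_charpoly_block_raw_singleton_of_anisotropic_frame_of_entry_centred hσ hvσ hσϖ hϖ hres h2 hnorm mA hmA c₁ ε hc₁ hεv hε q hq hsq P hP hP0 hd hdσ hanis₀ hanis₁ hησ hη γ₁ u hu2 s hs hγ hγ' hγU hirr
    (exists_pow_le_v_apply_of_v_det_eq _ hdet) (forall_v_apply_le_pow_of_mul_self_le_det_of_v_det_eq _ hconf hdet) NE NP NM hNE hNP hNM j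


set_option maxHeartbeats 1600000 in
-- budget only: statement-heavy lattice tokens (verbatim the ★ head's budget).
/-- **EVEN ROOT DEPTH, DETERMINANT-KEYED — the same over the even head** (census `(NE, NO, NP, NM)` AT `γ′`). [cite: Kottwitz1986, §3] [cite: Rogawski1990, §4.9 pp. 54–56] [cite: BruhatTits1972, §10] -/
theorem strataCount_J₀_of_charpoly_block_even_singleton_of_anisotropic_frame_of_det_centred [ValuativeRel K] [(Valued.v : Valuation K ℤᵐ⁰).Compatible] [IsPrincipalIdealRing 𝒪[K]]
    (hσ : ∀ x, σ (σ x) = x) (hvσ : ∀ a, Valued.v (σ a) = Valued.v a) (hσϖ : σ ϖ = -ϖ)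
    (hϖ : Valued.v ϖ = WithZero.exp (-1 : ℤ)) (hres : ∀ x : K, Valued.v x ≤ 1 → Valued.v (σ x - x) < 1) (h2 : Valued.v (2 : K) = 1)
    (hnorm : ∀ u : K, σ u = u → Valued.v (u - 1) < 1 → ∃ z : K, z * σ z = u ∧ Valued.v (z - 1) ≤ Valued.v (u - 1)) [Fintype 𝓀[K]] [DecidableEq 𝓀[K]]
    {d₀ : ℕ}
    (mA : ℕ) (hmA : d₀ = 2 * mA + 2)
    (c₁ ε : K) (hc₁ : Valued.v c₁ = 1) (hεv : Valued.v ε = 1) (hε : ∀ z : K, Valued.v z ≤ 1 → Valued.v (z ^ 2 - ε) = 1)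
    (q : ℕ) (hq : q = Fintype.card 𝓀[K])
    (hsq : ∀ t : K, Valued.v (t - 1) < 1 → IsSquare t)
    {d : Fin 2 → K} {η : K} (P : GL (Fin 3) K)
    (hP : formCongr σ P ((StdForm.antidiagonal 3).over K) =
      !![(Matrix.diagonal d) 0 0, 0, (Matrix.diagonal d) 0 1; 0, η, 0; (Matrix.diagonal d) 1 0, 0, (Matrix.diagonal d) 1 1])
    (hP0 : mapGL P (stdLattice K 3) = stdLattice K 3)
    (hd : ∀ i, Valued.v (d i) = 1) (hdσ : ∀ i, σ (d i) = d i)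
    (hanis₀ : ∀ c : K, Valued.v c ≤ 1 → Valued.v (d 0 + d 1 * (σ c * c)) = 1)
    (hanis₁ : ∀ c : K, Valued.v c ≤ 1 → Valued.v (d 0 * (σ c * c) + d 1) = 1)
    (hησ : σ η = η) (hη : Valued.v η = 1)
    (γ₁ : GL (Fin 2) K) (u : GL (Fin 1) K) (hu2 : Valued.v ((u : Matrix (Fin 1) (Fin 1) K) 0 0 - 1) ≤ Valued.v ϖ ^ 2)
    (s : Kˣ) (hs : (s : K) * (u : Matrix (Fin 1) (Fin 1) K) 0 0 = 1)
    {γ γ' : unitaryGroupOfForm σ ((StdForm.antidiagonal 3).over K)} (hγ : (γ : GL (Fin 3) K) = P * endoGL (γ₁, u) * P⁻¹)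
    (hγ' : (γ' : GL (Fin 3) K) = P * endoGL (Matrix.GeneralLinearGroup.scalar (Fin 2) s * γ₁, (1 : GL (Fin 1) K)) * P⁻¹)
    (hγU : γ₁ ∈ unitaryGroupOfForm σ (Matrix.diagonal d))
    (hirr : ∀ x : K, ¬ (γ₁ : Matrix (Fin 2) (Fin 2) K).charpoly.IsRoot x)
    (hdet : Valued.v ((γ₁ : Matrix (Fin 2) (Fin 2) K) - ((u : Matrix (Fin 1) (Fin 1) K) 0 0) • (1 : Matrix (Fin 2) (Fin 2) K)).det = Valued.v ϖ ^ (2 * d₀))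
    (NE NO NP NM : ℕ)
    (hNE : ({w | w ∈ {w | ∃ c, ((latticeGraph σ ϖ ((StdForm.antidiagonal 3).over K)).Adj (⟨stdLattice K 3, 0, isSelfDualLattice_stdLattice_three_of_v hϖ⟩ : {M : Submodule 𝒪[K] (Fin 3 → K) // IsVertex σ ϖ ((StdForm.antidiagonal 3).over K) M}) c ∧ (latticeGraph σ ϖ ((StdForm.antidiagonal 3).over K)).dist ⟨stdLattice K 3, 0, isSelfDualLattice_stdLattice_three_of_v hϖ⟩ c = (latticeGraph σ ϖ ((StdForm.antidiagonal 3).over K)).dist ⟨stdLattice K 3, 0, isSelfDualLattice_stdLattice_three_of_v hϖ⟩ (⟨stdLattice K 3, 0, isSelfDualLattice_stdLattice_three_of_v hϖ⟩ : {M : Submodule 𝒪[K] (Fin 3 → K) // IsVertex σ ϖ ((StdForm.antidiagonal 3).over K) M}) + 1 ∧ latticeGraphIso σ ϖ ((StdForm.antidiagonal 3).over K) γ' c = c) ∧ ((latticeGraph σ ϖ ((StdForm.antidiagonal 3).over K)).Adj c w ∧ (latticeGraph σ ϖ ((StdForm.antidiagonal 3).over K)).dist ⟨stdLattice K 3, 0,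 isSelfDualLattice_stdLattice_three_of_v hϖ⟩ w = (latticeGraph σ ϖ ((StdForm.antidiagonal 3).over K)).dist ⟨stdLattice K 3, 0, isSelfDualLattice_stdLattice_three_of_v hϖ⟩ c + 1 ∧ latticeGraphIso σ ϖ ((StdForm.antidiagonal 3).over K) γ' w = w)} ∧ (¬ w.1.map ((Matrix.toLin' (((γ' : GL (Fin 3) K) : Matrix (Fin 3) (Fin 3) K) - 1)).restrictScalars 𝒪[K]) ≤ scaleLattice (ϖ ^ d₀) w.1 ∧ (w.1.map ((Matrix.toLin' (((γ' : GL (Fin 3) K) : Matrix (Fin 3) (Fin 3) K) - 1)).restrictScalars 𝒪[K]) ≤ scaleLattice (ϖ ^ (d₀ - 2)) w.1 ∧ ¬ w.1.map ((Matrix.toLin' (((γ' : GL (Fin 3) K) : Matrix (Fin 3) (Fin 3) K) - 1)).restrictScalars 𝒪[K]) ≤ scaleLattice (ϖ ^ (d₀ - 1)) w.1))}).ncard = NE)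
    (hNO : ({w | w ∈ {w | ∃ c, ((latticeGraph σ ϖ ((StdForm.antidiagonal 3).over K)).Adj (⟨stdLattice K 3, 0, isSelfDualLattice_stdLattice_three_of_v hϖ⟩ : {M : Submodule 𝒪[K] (Fin 3 → K) // IsVertex σ ϖ ((StdForm.antidiagonal 3).over K) M}) c ∧ (latticeGraph σ ϖ ((StdForm.antidiagonal 3).over K)).dist ⟨stdLattice K 3, 0, isSelfDualLattice_stdLattice_three_of_v hϖ⟩ c = (latticeGraph σ ϖ ((StdForm.antidiagonal 3).over K)).dist ⟨stdLattice K 3, 0, isSelfDualLattice_stdLattice_three_of_v hϖ⟩ (⟨stdLattice K 3, 0, isSelfDualLattice_stdLattice_three_of_v hϖ⟩ : {M : Submodule 𝒪[K] (Fin 3 → K) // IsVertex σ ϖ ((StdForm.antidiagonal 3).over K) M}) + 1 ∧ latticeGraphIso σ ϖ ((StdForm.antidiagonal 3).over K) γ' c = c) ∧ ((latticeGraph σ ϖ ((StdForm.antidiagonal 3).over K)).Adj c w ∧ (latticeGraph σ ϖ ((StdForm.antidiagonal 3).over K)).dist ⟨stdLattice K 3, 0, isSelfDualLattice_stdLattice_three_of_v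 hϖ⟩ w = (latticeGraph σ ϖ ((StdForm.antidiagonal 3).over K)).dist ⟨stdLattice K 3, 0, isSelfDualLattice_stdLattice_three_of_v hϖ⟩ c + 1 ∧ latticeGraphIso σ ϖ ((StdForm.antidiagonal 3).over K) γ' w = w)} ∧ (¬ w.1.map ((Matrix.toLin' (((γ' : GL (Fin 3) K) : Matrix (Fin 3) (Fin 3) K) - 1)).restrictScalars 𝒪[K]) ≤ scaleLattice (ϖ ^ d₀) w.1 ∧ (w.1.map ((Matrix.toLin' (((γ' : GL (Fin 3) K) : Matrix (Fin 3) (Fin 3) K) - 1)).restrictScalars 𝒪[K]) ≤ scaleLattice (ϖ ^ (d₀ - 1)) w.1 ∧ ¬ w.1.map ((Matrix.toLin' (((γ' : GL (Fin 3) K) : Matrix (Fin 3) (Fin 3) K) - 1)).restrictScalars 𝒪[K]) ≤ scaleLattice (ϖ ^ d₀) w.1) ∧ ¬ w.1.map ((Matrix.toLin' ((((γ' : GL (Fin 3) K) : Matrix (Fin 3) (Fin 3) K) - 1) ^ 2)).restrictScalars 𝒪[K]) ≤ scaleLattice (ϖ ^ (2 * d₀ - 1)) w.1)}).ncard = NO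)
    (hNP : ({w | w ∈ {w | ∃ c, ((latticeGraph σ ϖ ((StdForm.antidiagonal 3).over K)).Adj (⟨stdLattice K 3, 0, isSelfDualLattice_stdLattice_three_of_v hϖ⟩ : {M : Submodule 𝒪[K] (Fin 3 → K) // IsVertex σ ϖ ((StdForm.antidiagonal 3).over K) M}) c ∧ (latticeGraph σ ϖ ((StdForm.antidiagonal 3).over K)).dist ⟨stdLattice K 3, 0, isSelfDualLattice_stdLattice_three_of_v hϖ⟩ c = (latticeGraph σ ϖ ((StdForm.antidiagonal 3).over K)).dist ⟨stdLattice K 3, 0, isSelfDualLattice_stdLattice_three_of_v hϖ⟩ (⟨stdLattice K 3, 0, isSelfDualLattice_stdLattice_three_of_v hϖ⟩ : {M : Submodule 𝒪[K] (Fin 3 → K) // IsVertex σ ϖ ((StdForm.antidiagonal 3).over K) M}) + 1 ∧ latticeGraphIso σ ϖ ((StdForm.antidiagonal 3).over K) γ' c = c) ∧ ((latticeGraph σ ϖ ((StdForm.antidiagonal 3).over K)).Adj c w ∧ (latticeGraph σ ϖ ((StdForm.antidiagonal 3).over K)).dist ⟨stdLattice K 3, 0, isSelfDualLattice_stdLattice_three_of_v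 hϖ⟩ w = (latticeGraph σ ϖ ((StdForm.antidiagonal 3).over K)).dist ⟨stdLattice K 3, 0, isSelfDualLattice_stdLattice_three_of_v hϖ⟩ c + 1 ∧ latticeGraphIso σ ϖ ((StdForm.antidiagonal 3).over K) γ' w = w)} ∧ (¬ w.1.map ((Matrix.toLin' (((γ' : GL (Fin 3) K) : Matrix (Fin 3) (Fin 3) K) - 1)).restrictScalars 𝒪[K]) ≤ scaleLattice (ϖ ^ d₀) w.1 ∧ (w.1.map ((Matrix.toLin' (((γ' : GL (Fin 3) K) : Matrix (Fin 3) (Fin 3) K) - 1)).restrictScalars 𝒪[K]) ≤ scaleLattice (ϖ ^ (d₀ - 1)) w.1 ∧ ¬ w.1.map ((Matrix.toLin' (((γ' : GL (Fin 3) K) : Matrix (Fin 3) (Fin 3) K) - 1)).restrictScalars 𝒪[K]) ≤ scaleLattice (ϖ ^ d₀) w.1) ∧ w.1.map ((Matrix.toLin' ((((γ' : GL (Fin 3) K) : Matrix (Fin 3) (Fin 3) K) - 1) ^ 2)).restrictScalars 𝒪[K]) ≤ scaleLattice (ϖ ^ (2 * d₀ - 1)) w.1 ∧ ∃ y ∈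 w.1, ∃ a : K, Valued.v a = 1 ∧ Valued.v ((ϖ ^ (d₀ - 1))⁻¹ * pairing σ ((StdForm.antidiagonal 3).over K) y ((((γ' : GL (Fin 3) K) : Matrix (Fin 3) (Fin 3) K) - 1) *ᵥ y) - (c₁) * a ^ 2) < 1)}).ncard = NP)
    (hNM : ({w | w ∈ {w | ∃ c, ((latticeGraph σ ϖ ((StdForm.antidiagonal 3).over K)).Adj (⟨stdLattice K 3, 0, isSelfDualLattice_stdLattice_three_of_v hϖ⟩ : {M : Submodule 𝒪[K] (Fin 3 → K) // IsVertex σ ϖ ((StdForm.antidiagonal 3).over K) M}) c ∧ (latticeGraph σ ϖ ((StdForm.antidiagonal 3).over K)).dist ⟨stdLattice K 3, 0, isSelfDualLattice_stdLattice_three_of_v hϖ⟩ c = (latticeGraph σ ϖ ((StdForm.antidiagonal 3).over K)).dist ⟨stdLattice K 3, 0, isSelfDualLattice_stdLattice_three_of_v hϖ⟩ (⟨stdLattice K 3, 0, isSelfDualLattice_stdLattice_three_of_v hϖ⟩ : {M : Submodule 𝒪[K] (Fin 3 → K) // IsVertex σ ϖ ((StdForm.antidiagonal 3).over K) M}) +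 1 ∧ latticeGraphIso σ ϖ ((StdForm.antidiagonal 3).over K) γ' c = c) ∧ ((latticeGraph σ ϖ ((StdForm.antidiagonal 3).over K)).Adj c w ∧ (latticeGraph σ ϖ ((StdForm.antidiagonal 3).over K)).dist ⟨stdLattice K 3, 0, isSelfDualLattice_stdLattice_three_of_v hϖ⟩ w = (latticeGraph σ ϖ ((StdForm.antidiagonal 3).over K)).dist ⟨stdLattice K 3, 0, isSelfDualLattice_stdLattice_three_of_v hϖ⟩ c + 1 ∧ latticeGraphIso σ ϖ ((StdForm.antidiagonal 3).over K) γ' w = w)} ∧ (¬ w.1.map ((Matrix.toLin' (((γ' : GL (Fin 3) K) : Matrix (Fin 3) (Fin 3) K) - 1)).restrictScalars 𝒪[K]) ≤ scaleLattice (ϖ ^ d₀) w.1 ∧ (w.1.map ((Matrix.toLin' (((γ' : GL (Fin 3) K) : Matrix (Fin 3) (Fin 3) K) - 1)).restrictScalars 𝒪[K]) ≤ scaleLattice (ϖ ^ (d₀ - 1)) w.1 ∧ ¬ w.1.map ((Matrix.toLin' (((γ' : GL (Fin 3) K) : Matrix (Fin 3) (Fin 3) K) - 1)).restrictScalars 𝒪[K])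 ≤ scaleLattice (ϖ ^ d₀) w.1) ∧ w.1.map ((Matrix.toLin' ((((γ' : GL (Fin 3) K) : Matrix (Fin 3) (Fin 3) K) - 1) ^ 2)).restrictScalars 𝒪[K]) ≤ scaleLattice (ϖ ^ (2 * d₀ - 1)) w.1 ∧ ¬ (∃ y ∈ w.1, ∃ a : K, Valued.v a = 1 ∧ Valued.v ((ϖ ^ (d₀ - 1))⁻¹ * pairing σ ((StdForm.antidiagonal 3).over K) y ((((γ' : GL (Fin 3) K) : Matrix (Fin 3) (Fin 3) K) - 1) *ᵥ y) - (c₁) * a ^ 2) < 1))}).ncard = NM) (j : Fin 5) :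
    ({M : Submodule 𝒪[K] (Fin 3 → K) | IsSelfDualLattice σ ϖ ((StdForm.antidiagonal 3).over K) M ∧ mapGL (γ : GL (Fin 3) K) M = M ∧
        (![¬ M.map ((Matrix.toLin' (((γ : GL (Fin 3) K) : Matrix (Fin 3) (Fin 3) K) - 1)).restrictScalars 𝒪[K]) ≤ scaleLattice ϖ M,
                  M.map ((Matrix.toLin' (((γ : GL (Fin 3) K) : Matrix (Fin 3) (Fin 3) K) - 1)).restrictScalars 𝒪[K]) ≤ scaleLattice ϖ M ∧
                    ¬ M.map ((Matrix.toLin' (((γ : GL (Fin 3) K) : Matrix (Fin 3) (Fin 3) K) - 1)).restrictScalars 𝒪[K]) ≤ scaleLattice (ϖ ^ 2) M ∧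
                    ¬ M.map ((Matrix.toLin' ((((γ : GL (Fin 3) K) : Matrix (Fin 3) (Fin 3) K) - 1) ^ 2)).restrictScalars 𝒪[K]) ≤ scaleLattice (ϖ ^ 3) M,
                  M.map ((Matrix.toLin' (((γ : GL (Fin 3) K) : Matrix (Fin 3) (Fin 3) K) - 1)).restrictScalars 𝒪[K]) ≤ scaleLattice ϖ M ∧
                    ¬ M.map ((Matrix.toLin' (((γ : GL (Fin 3) K) : Matrix (Fin 3) (Fin 3) K) - 1)).restrictScalars 𝒪[K]) ≤ scaleLattice (ϖ ^ 2) M ∧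
                    M.map ((Matrix.toLin' ((((γ : GL (Fin 3) K) : Matrix (Fin 3) (Fin 3) K) - 1) ^ 2)).restrictScalars 𝒪[K]) ≤ scaleLattice (ϖ ^ 3) M ∧
                    ∃ y ∈ M, ∃ a : K, Valued.v a = 1 ∧
                      Valued.v (ϖ⁻¹ * pairing σ (((StdForm.antidiagonal 3).over K)) y
                        ((((γ : GL (Fin 3) K) : Matrix (Fin 3) (Fin 3) K) - 1) *ᵥ y) - c₁ * a ^ 2) < 1,
                  M.map ((Matrix.toLin' (((γ : GL (Fin 3) K) : Matrix (Fin 3) (Fin 3) K) - 1)).restrictScalars 𝒪[K]) ≤ scaleLattice ϖ M ∧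
                    ¬ M.map ((Matrix.toLin' (((γ : GL (Fin 3) K) : Matrix (Fin 3) (Fin 3) K) - 1)).restrictScalars 𝒪[K]) ≤ scaleLattice (ϖ ^ 2) M ∧
                    M.map ((Matrix.toLin' ((((γ : GL (Fin 3) K) : Matrix (Fin 3) (Fin 3) K) - 1) ^ 2)).restrictScalars 𝒪[K]) ≤ scaleLattice (ϖ ^ 3) M ∧
                    ∃ y ∈ M, ∃ a : K, Valued.v a = 1 ∧
                      Valued.v (ϖ⁻¹ * pairing σ (((StdForm.antidiagonal 3).over K)) y
                        ((((γ : GL (Fin 3) K) : Matrix (Fin 3) (Fin 3) K) - 1) *ᵥ y) - c₁ * ε * a ^ 2) < 1,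
                  M.map ((Matrix.toLin' (((γ : GL (Fin 3) K) : Matrix (Fin 3) (Fin 3) K) - 1)).restrictScalars 𝒪[K]) ≤ scaleLattice (ϖ ^ 2) M] : Fin 5 → Prop) j}.ncard) =
      (if IsSquare (-1 : 𝓀[K]) then
          ((1 : ℕ) • (![0, 0, 0, 0, 1] : Fin 5 → ℕ) + NE • (if mA = 0 then (![1, 0, 0, 0, 0] : Fin 5 → ℕ) else (![q ^ (3 * (mA - 1) + 3), q ^ (3 * (mA - 1) + 2), q.choose 2 * q ^ (2 * (mA - 1)) * ∑ i ∈ Finset.range (mA - 1), q ^ i, q.choose 2 * q ^ (2 * (mA - 1)) * ∑ i ∈ Finset.range (mA - 1), q ^ i,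
          ∑ i ∈ Finset.range (mA - 1 + 1), q ^ (2 * i) + ∑ i ∈ Finset.range (mA - 1), q ^ (2 * (mA - 1) + 1 + i)] : Fin 5 → ℕ)) + NO • (![q ^ (3 * mA + 1), q ^ (3 * mA), q.choose 2 * q ^ (2 * mA - 2) * ∑ i ∈ Finset.range mA, q ^ i, q.choose 2 * q ^ (2 * mA - 2) * ∑ i ∈ Finset.range mA, q ^ i,
          ∑ i ∈ Finset.range mA, q ^ (2 * i) + ∑ i ∈ Finset.range mA, q ^ (2 * mA - 1 + i)] : Fin 5 → ℕ) + NP • (![0, 0, q ^ (2 * mA), 0, ∑ i ∈ Finset.range mA, q ^ (2 * i)] : Fin 5 → ℕ) + NM • (![0, 0, 0, q ^ (2 * mA), ∑ i ∈ Finset.range mA, q ^ (2 * i)] : Fin 5 → ℕ)) j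
        else
          ((1 : ℕ) • (![0, 0, 0, 0, 1] : Fin 5 → ℕ) + NE • (if mA = 0 then (![1, 0, 0, 0, 0] : Fin 5 → ℕ) else (![q ^ (3 * (mA - 1) + 3), q ^ (3 * (mA - 1) + 2), q.choose 2 * q ^ (2 * (mA - 1)) * ∑ i ∈ Finset.range (mA - 1), q ^ i, q.choose 2 * q ^ (2 * (mA - 1)) * ∑ i ∈ Finset.range (mA - 1), q ^ i,
          ∑ i ∈ Finset.range (mA - 1 + 1), q ^ (2 * i) + ∑ i ∈ Finset.range (mA - 1), q ^ (2 * (mA - 1) + 1 + i)] : Fin 5 → ℕ)) + NO • (![q ^ (3 * mA + 1), q ^ (3 * mA), q.choose 2 * q ^ (2 * mA - 2) * ∑ i ∈ Finset.range mA, q ^ i, q.choose 2 * q ^ (2 * mA - 2) * ∑ i ∈ Finset.range mA, q ^ i,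
          ∑ i ∈ Finset.range mA, q ^ (2 * i) + ∑ i ∈ Finset.range mA, q ^ (2 * mA - 1 + i)] : Fin 5 → ℕ) + NP • (![0, 0, if Even mA then q ^ (2 * mA) else 0, if Even mA then 0 else q ^ (2 * mA), ∑ i ∈ Finset.range mA, q ^ (2 * i)] : Fin 5 → ℕ) + NM • (![0, 0, if Even mA then 0 else q ^ (2 * mA), if Even mA then q ^ (2 * mA) else 0, ∑ i ∈ Finset.range mA, q ^ (2 * i)] : Fin 5 → ℕ)) j) := by
  have hconf := forall_valued_sub_smul_one_apply_mul_self_le_det hvσ h2 hsq hd hanis₀ hanis₁ (mem_unitaryGroupOfForm_iff.1 hγU) hirr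
    ((u : Matrix (Fin 1) (Fin 1) K) 0 0)
  exact strataCount_J₀_of_charpoly_block_even_singleton_of_anisotropic_frame_of_entry_centred hσ hvσ hσϖ hϖ hres h2 hnorm mA hmA c₁ ε hc₁ hεv hε q hq hsq P hP hP0 hd hdσ hanis₀ hanis₁ hησ hη γ₁ u hu2 s hs hγ hγ' hγU hirr
    (exists_pow_le_v_apply_of_v_det_eq _ hdet) (forall_v_apply_le_pow_of_mul_self_le_det_of_v_det_eq _ hconf hdet) NE NO NP NM hNE hNO hNP hNM j

end Literature.NumberTheory.Rogawski1990.TypeOneRamifiedJunction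

end
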